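/-
Copyright: cell `langlands-arthur-audit` (papers/Langlands/langlands-arthur-audit), unit `pub-arthur-down-g33`
(downstream tracer, gen 33).  Tenth file of the exact-support certificates of the downstream register (module M198 of the
cell's MODULE-MAP — CLAIMed in `lean/MODULE-MAP2.md` 2026-08-22T01:23Z under the id « M197 » and CORRECTED there to M198 per the referee's first-come
ruling G-REF-g152-1, which assigns M197 to `pub-arthur-up-g59`'s `Leaves/WeightedLieInstances.lean`; v1.1 = this header erratum, nothing else changed): `DownstreamSupport.lean` … `DownstreamSupport8.lean` are full or CLOSED and
`DownstreamSupport9.lean` (sections 80–84, with section 85 to follow there; its v4 / v5 are in the gate's queue behind the farm's rebuild of `Downstream22`)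
carries the supports of `Downstream21.lean` / `Downstream22.lean`; the supports of the NEW register file `Downstream23.lean` (tranches ≥ 83, a sibling of
`Downstream22.lean` importing `Downstream21`) start here, APPEND-ONLY in the same conventions and the same namespace `…Arthur2013.Downstream.Support`; this
file imports `…DownstreamSupport9` (v3 or later in the tree; through it every earlier support file and the canonical readings `canon`, `canon₂₅`, `canon₂₇`,
`νtop`, `μtop`, `κtop`, `κnoMok`, the countermodel lemmas) and `…Downstream23`; v1 = section 86, the supports of the eighty-third tranche (`Downstream23.lean`
v1, this unit: MR-NUMBER CITERS, III — NEW row B121 Hansen – Mann 2026: HYPOTHESIS node `HMwellUnderstood` supplied ⇐ book ∧ A5 ∧ Mok ∧ KMSW scope ∧ A9 ∧ C62 ∧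
C185 ∧ C63, `HMcompact`; NEW row B122 Sunohara 2025: node `SunoharaHyp` supplied ⇐ book ∧ Mok, `SunoharaTransfer`; NEW row C210 Clozel – Thorne 2014: `CTdescent`
⇐ Mok; NEW row C211 Disegni – W. Zhang 2024/2025: node `DZhypCoh` (no supplier), `DZpadicL` ⇐ Mok ∧ KMSW scope, `DZcycles`; `canon₈₃W`, `canon_implications₈₃W`,
`c83_all_of`, `eightythird_holds_top`, `dz83_need_node_top`, `c83_book_cm`, `c83_mok_cm`, `c83_kmsw_importDenied`, `c83_regraded`); v2 (unit `pub-arthur-down-g34`, downstream tracer gen 34) = sections 87, 88 and 89, the supports of the eighty-fourth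
tranche (`Downstream23.lean` v2: THE BOOK'S SERIES LINE — NEW rows B123 Kaletha 2013 (`KalethaWhittaker`, `KalethaContragredient` ⇐ book), C212 Pantano – Paul –
Salamanca-Riba 2014 (`PPSRunipotent` ⇐ book, `PPSRgenuine` ⇐ PPSRunipotent), C213 Jiang – Liu 2016 (`JLresidualFC` ⇐ book ∧ C179), C214 Bertoloni Meli 2021 (node
`BMassumptions` supplied ⇐ A13, `BMaveraging` ⇐ node), C215 Mok 2018 (`MokCuspidalDecomposition` ⇐ book, `MokRStable`), C216 Comtat – Lesesvre – Man 2025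
(`CLMspherical` ⇐ book ∧ C180 ∧ C182); `canon₈₄W`, `canon_implications₈₄W`, `c84_all_of`, `eightyfourth_holds_top`, `c₇₆none`, `c84_rows_denied_top`,
`c84_book_cm`, `c84_mok_cm`, `c84_kmsw_importDenied`, `c84_regraded`) and of the eighty-fifth tranche (`Downstream24.lean` v1, imported from v2 on: THE BOOK'S SERIES
LINE, II — NEW rows C217 Jiang – Liu AIF 2016 (`JLpartitionBound` ⇐ book), C218 Kret 2012 (`KretHypGSp` ⇐ book, `KretNewtonC` ⇐ KretHypGSp, `KretGSpin` ⇐ book), B124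
Le 2025 (`LeTwistedGGP` ⇐ Mok ∧ KMSW scope ∧ A8-p ∧ A10); `canon₈₅W`, `c₄₆noA10`, `canon_implications₈₅W`, `c85_all_of`, `eightyfifth_holds_top`, `c85_rows_denied_top`,
`c85_book_cm`, `c85_mok_cm`, `c85_kmsw_importDenied`, `c85_regraded`) and of the eighty-sixth tranche (`Downstream24.lean` v2: THE BOOK'S SERIES LINE, III — NEW rows C219 J. Cohen
2014 (node `CohenStableDensity` unsupplied, `CohenOrbitalSpectral` ⇐ book ∧ node), B125 L. Shi 2025 (node `ShiMultiplicityOne` ⇐ Mok ∧ C110, `ShiRegulator` ⇐ node); `canon₈₆W`,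
`c₂₄noC110`, `canon_implications₈₆W`, `c86_all_of`, `eightysixth_holds_top`, `c86_node_denied_top`, `c86_row_denied_top`, `c86_book_cm`, `c86_mok_cm`, `c86_kmsw_importDenied`,
`c86_regraded`); v3 (unit `pub-arthur-down-g35`, downstream tracer gen 35) = section 90, the supports of the eighty-seventh tranche (`Downstream24.lean` v3:
THE CITATION GRAPH, I — NEW rows C220 Shin – Templier 2014 (`STfiniteness`, `STgrowth` ⇐ book ∧ Mok; `STunitaryGrowth` premise-free), C221 S.-Y. Chen, Annals to appear
(`ChenRSGL2` ⇐ KMSW scope, `ChenBlasius` ⇐ ChenRSGL2, `ChenDeligneSym` ⇐ book), C222 S.-Y. Chen IMRN 2024 (`ChenSelfDualExistence` ⇐ book ∧ B101, `ChenBWduality`,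
`ChenBWratios`); `canon₈₇W`, `canon_implications₈₇W`, `c87_all_of`, `eightyseventh_holds_top`, `c87_row_denied_top`, `c87_book_cm`, `c87_mok_cm`, `c87_kmsw_importDenied`,
`c87_regraded`); v4 (this unit) = section 91, the supports of the eighty-eighth tranche (NEW `Downstream25.lean` v1: THE CITATION GRAPH, II — NEW rows C223
Kim – Yamauchi G_2 2024/25 (`KYGGarchimedean` ⇐ book ∧ B1 `AMR`; `KYGGassump`, `KYGGFourier` ⇐ it), C224 Haan – Kwon 2026 (`HKggp` ⇐ book ∧ B3 ∧ C1 ∧ C1 ∧ A5 ∧ C28),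
C225 Kim – Yamauchi 2013/2016 (node `KYArtinHyps`; `KYArtin` ⇐ D17's node `ArthurGSp4` ∧ node; control `KYSym3` premise-free); this file now also imports `…Downstream25`;
`canon₈₈W`, `canon_implications₈₈W`, `c88_all_of`, `c₁noB1`, `c₁₀noGSp4`, `eightyeighth_holds_top`, `c88_node_denied_top`, `c88_rows_denied_top`, `c88_book_cm`,
`c88_mok_kmsw_free`, `c88_regraded`).  Nothing of the first nine
files is redeclared or changed.
-/
import HarnessLib
import Literature.NumberTheory.Automorphic.Arthur2013.DownstreamSupport9
import Literature.NumberTheory.Automorphic.Arthur2013.Downstream23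
import Literature.NumberTheory.Automorphic.Arthur2013.Downstream24
import Literature.NumberTheory.Automorphic.Arthur2013.Downstream25

/-!
# Downstream of Arthur (2013): exact leaf support of the downstream register, tenth file (sections ≥ 86)

**Source reproduced.**  Nothing beyond what `Downstream.lean` … `Downstream23.lean` transcribe (the downstream
authors' own sentences, cited there chunk by chunk) and what the three leaf-support modules certify
(`Arthur2013/LeafSupport.lean`, `Mok2015/LeafSupport.lean`, `KMSW2014/LeafSupport.lean`: for every leaf a
kernel-checked countermodel of the DAG as typed).  As in the first nine files: a CANONICAL READING assigns to each
typed downstream statement the conjunction of DAG outputs its edge receives, the tranche's edges are shown to hold in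
that reading for arbitrary node assignments, and the countermodels then give the « only if » half of each support —
which leaves are load-bearing for which downstream theorem, in the register AS TYPED (a statement about the cell's
transcription, not about the mathematics).  [cite: Arthur2013, §1.5 with AGIKMS2024 l.380-382 (the conditional
reading whose supports are certified)]

**v1 (section 86; unit `pub-arthur-down-g33`).**  The eighty-third tranche (`Downstream23.lean` v1, NEW module M196) types MR-NUMBER CITERS, III — the Mok / KMSW
number sweep of the held corpus and the hypothesis-discharge rows deferred from tranche 82: NEW rows B121 Hansen – Mann arXiv:2606.00983 (2026; HYPOTHESIS node
`HMwellUnderstood` = their « well-understood » condition asserted for SO_2n+1 / U_n in Example 6.3, SUPPLIED ⇐ book ∧ row A5's `IshimotoGeneric` ∧ Mok ∧ KMSW's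
proved scope ∧ row A9's `ChenZou` ∧ row C62's `PengFS` ∧ row C185's `DvHKZ` ∧ row C63's `BMHN`; `HMcompact` = Theorem 6.12 ⇐ node), B122 Sunohara arXiv:2505.04910
(2025; node `SunoharaHyp` = Hypothesis 4.2 for the inner forms of quasi-split Sp / odd SO / U / odd GSpin, SUPPLIED ⇐ book ∧ Mok as his discharge sentence prints it;
`SunoharaTransfer` = Theorems 1.1 / 1.2 ⇐ node), C210 Clozel – Thorne, Compositio 2014 (`CTdescent` ⇐ Mok), C211 Disegni – W. Zhang arXiv:2410.08401 (node
`DZhypCoh`, no supplier; `DZpadicL` = Theorems A / B ⇐ Mok ∧ KMSW scope; `DZcycles` = Theorems C / D ⇐ DZpadicL ∧ node ∧ Mok ∧ KMSW scope).  Certified here with ONE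
parametrised reading `canon₈₃W ν μ κ ig cz pf dv bm hc` (the five row premises of B121's supply edge and the value of C211's node as parameters; every other
value written out) whose edges hold for every `Consumers` / `Consumers25` / `Consumers27` assignment and every hc (`canon_implications₈₃W`): at the top (tranches 1,
25, 27 read canonically, node granted) all eight statements hold (`eightythird_holds_top`); with C211's node DENIED at the top Theorems C / D FAIL and everything else
holds (`dz83_need_node_top`); in the book countermodel of ANY of the 24 leaves (Mok, KMSW at the top) B121's node and theorem and B122's node and theorems FAIL while
C210 and C211 HOLD (`c83_book_cm`); with Mok read by the countermodel of ANY of its leaves, KMSW without its Mok import and the book at the top, all statements but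
C211's node FAIL (`c83_mok_cm` — Mok is load-bearing for every row of the tranche); with the book AND Mok at the top but KMSW without its Mok import (its proved scope
then fails at every rank, `κnoMok_facts`) B121 and C211 FAIL while B122 and C210 HOLD (`c83_kmsw_importDenied` — B122's hypothesis covers inner unitary groups, yet
as printed and typed nothing of KMSW supports it).  In one statement (`c83_regraded`): support(`HMcompact`) = book 24 ∪ Mok 29 ∪ KMSW's import / scope (through
eight premises); support(`SunoharaTransfer`) = book 24 ∪ Mok 29, KMSW ∩ support = ∅; support(`CTdescent`) = Mok 29; support(`DZpadicL`) = Mok 29 ∪ KMSW scope;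
support(`DZcycles`) = the same ∪ {the KSZ-sequel node}.

**v2 (section 87; unit `pub-arthur-down-g34`).**  The eighty-fourth tranche (`Downstream23.lean` v2) types THE BOOK'S SERIES LINE — consumers found by searching
the held corpus for the series words of the book's bibliography line: NEW rows B123 Kaletha, Algebra Number Theory 7 (2013) (`KalethaWhittaker` = Thm 4.3,
`KalethaContragredient` = Thm 5.9 / Cor. 5.10 ⇐ book), C212 Pantano – Paul – Salamanca-Riba, Pacific J. Math. 271 (2014) (`PPSRunipotent` = their Theorem 29
⇐ book; `PPSRgenuine` = Theorem 6 ⇐ PPSRunipotent), C213 Jiang – Liu, Pacific J. Math. 281 (2016) (`JLresidualFC` ⇐ book ∧ row C179's `JLZResidualPoles`),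
C214 Bertoloni Meli arXiv:2103.11538 (HYPOTHESIS node `BMassumptions` SUPPLIED ⇐ row A13's `BMN`; `BMaveraging` = Thm 1.1 ⇐ node), C215 Mok, Sci. China Math.
61 (2018) (`MokCuspidalDecomposition` = Thm 3.6 ⇐ book; `MokRStable` = Thms 4.1 / 4.4 ⇐ Thm 3.6 ∧ book), C216 Comtat – Lesesvre – Man arXiv:2502.17234
(`CLMspherical` = Prop. 2.1 ⇐ book ∧ row C180's `SchmidtParamodular` ∧ row C182's `SchmidtCAP`).  Certified here with ONE parametrised reading `canon₈₄W ν
jlz sp scap bmn` (the four ROW premises of the tranche as parameters; every other value written out) whose edges hold for every `Consumers19` / `Consumers20` /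
`Consumers27` / `Consumers76` assignment (`canon_implications₈₄W`): at the top (tranches 19, 20, 27, 76 read canonically) all ten statements hold
(`eightyfourth_holds_top`); at the top with the three book-side ROW premises DENIED (C179, C180, C182 := False, through the register's own `canon₇₆`-free
instantiation) C213 and C216 FAIL while the eight other statements hold (`c84_rows_denied_top` — the conduits are load-bearing as typed); in the book
countermodel of ANY of the 24 leaves (Mok, KMSW at the top) the eight book-side statements — B123 ×2, C212 ×2, C213, C215 ×2, C216 — FAIL while C214's
node and theorem HOLD (`c84_book_cm`); with Mok read by the countermodel of ANY of its leaves, KMSW without its Mok import and the book at the top, C214's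
node and theorem FAIL and the eight book-side statements HOLD (`c84_mok_cm`); with the book AND Mok at the top but KMSW without its Mok import (its proved scope then
fails at every rank, `κnoMok_facts`) C214 FAILS and the eight others HOLD (`c84_kmsw_importDenied`).  In one statement (`c84_regraded`): support(B123) =
support(C212) = support(C215) = book 24; support(C213) = book 24 (directly and through C179); support(C216) = book 24 (directly and through C180 / C182);
support(C214) = support(A13) = Mok 29 ∪ KMSW's import / scope, book ∩ support(C214) = ∅; Mok ∩ support = KMSW ∩ support = ∅ for the five other rows.

**v2 (section 88; unit `pub-arthur-down-g34`).**  The eighty-fifth tranche (`Downstream24.lean` v1, the twenty-fourth register file) types THE BOOK'S SERIES LINE, II: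
NEW rows C217 Jiang – Liu, Ann. Inst. Fourier 66 (2016) (`JLpartitionBound` = Thm 1.3 ⇐ book), C218 Kret arXiv:1209.0264 (2012) (`KretHypGSp` = his Theorem 33 ⇐ book;
`KretNewtonC` = the type (C) non-emptiness ⇐ KretHypGSp; `KretGSpin` = Theorem 35 ⇐ book), B124 N. H. Le arXiv:2511.01301 (2025) (`LeTwistedGGP` = Thm 1.2 ⇐ Mok ∧ KMSW's
proved scope ∧ row A8-p's `Consumers13.MRpadic` ∧ row A10's `Consumers46.ChenZouLLCU`).  Certified here with ONE parametrised reading `canon₈₅W ν μ κ mr cz` (the two ROW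
premises of B124 as parameters; every other value written out) whose edges hold for every `Consumers13` / `Consumers46` assignment (`canon_implications₈₅W`): at the top
(tranches 13, 46 read canonically) all five statements hold (`eightyfifth_holds_top`); at the top with B124's row premises DENIED — both (`c₁₃noA8p`, `c₄₆noA10`), A8-p
alone, A10 alone — B124 FAILS each time while the four book-side statements hold (`c85_rows_denied_top` — each conduit is load-bearing as typed); in the book
countermodel of ANY of the 24 leaves (Mok, KMSW at the top) ALL FIVE statements FAIL — C217, C218 ×3 directly, B124 through row A8-p, whose canonical reading carries the
book (`c85_book_cm`); with Mok read by the countermodel of ANY of its leaves, KMSW without its Mok import and the book at the top, B124 FAILS and the four book-side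
statements HOLD (`c85_mok_cm`); with the book AND Mok at the top but KMSW without its Mok import (its proved scope then fails at every rank, `κnoMok_facts`) B124 FAILS and
the four others HOLD (`c85_kmsw_importDenied`).  In one statement (`c85_regraded`): support(C217) = support(C218) = book 24, Mok ∩ support = KMSW ∩ support = ∅;
support(B124) = book 24 (through A8-p) ∪ Mok 29 ∪ KMSW's import / scope — a local theorem on unitary groups whose typed support contains Arthur's book.

**v2 (section 89; unit `pub-arthur-down-g34`).**  The eighty-sixth tranche (`Downstream24.lean` v2) types THE BOOK'S SERIES LINE, III: NEW rows C219 J. Cohen arXiv:1407.4316 (2014;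
HYPOTHESIS node `CohenStableDensity` = his Théorème 7.7, communicated by Waldspurger, NO supplier edge; `CohenOrbitalSpectral` = Théorème 7.9 ⇐ book ∧ node) and B125 L. Shi
arXiv:2510.08708 (2025; node `ShiMultiplicityOne` = Theorem 3.30 ⇐ Mok ∧ row C110's `Consumers24.LSZEuler`; `ShiRegulator` = Theorem 1.5 ⇐ node).  Certified here with ONE parametrised
reading `canon₈₆W ν μ w lsz` (Cohen's node and C110's value as parameters) whose edges hold for every `Consumers24` assignment and every value of the node
(`canon_implications₈₆W`): at the top with the node GRANTED all four statements hold (`eightysixth_holds_top`); with the node DENIED at the top Cohen's theorem FAILS and Shi's two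
statements hold (`c86_node_denied_top` — the unsupplied node is load-bearing); with row C110 DENIED at the top (`c₂₄noC110`) Shi's node and theorem FAIL (`c86_row_denied_top`); in
the book countermodel of ANY leaf (node granted; Mok, KMSW at the top) Cohen's theorem FAILS and Shi's statements HOLD (`c86_book_cm`); with Mok read by the countermodel of ANY of its
leaves (book at the top, KMSW without its Mok import) Shi's statements FAIL and Cohen's theorem HOLDS (`c86_mok_cm`); with only KMSW's Mok import denied all four HOLD
(`c86_kmsw_importDenied` — KMSW ∩ support = ∅ for both rows).  In one statement (`c86_regraded`): support(C219) = book 24 ∪ {node}; support(B125) = Mok 29 (directly and through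
C110); book ∩ support(B125) = Mok ∩ support(C219) = KMSW ∩ support = ∅.

**v3 (section 90; unit `pub-arthur-down-g35`).**  The eighty-seventh tranche (`Downstream24.lean` v3) types THE CITATION GRAPH, I: NEW rows C220 Shin – Templier, Compositio
Math. 150 (2014) (`STfiniteness` = Thm 5.19, `STgrowth` = Thms 6.1 / 6.6 ⇐ book ∧ Mok under their explicit Hypothesis 4.8; `STunitaryGrowth` = Thm 6.17, PREMISE-FREE via
Labesse), C221 S.-Y. Chen arXiv:2205.15382 (to appear, Ann. of Math.; `ChenRSGL2` = Thm 5.5 ⇐ KMSW's proved scope; `ChenBlasius` = Thm 5.7 = Thm B ⇐ ChenRSGL2; `ChenDeligneSym` =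
Thm 5.9 = Thm A ⇐ book) and C222 S.-Y. Chen IMRN 2024 (`ChenSelfDualExistence` = Lemma 4.5 ⇐ book ∧ row B101's `Consumers26.HLL`; `ChenBWduality` = Thm 4.7 ⇐ it; `ChenBWratios`
= Thm 4.10 ⇐ it).  Certified here with ONE parametrised reading `canon₈₇W ν μ κ hll` (row B101's value as the parameter) whose edges hold for every `Consumers26` assignment
(`canon_implications₈₇W`): at the top (B101 read canonically, `canon₂₆` of §29) all nine statements hold (`eightyseventh_holds_top`); at the top with row B101 DENIED (§29's
`canon₂₆noB101`) every edge holds, C222's three statements FAIL, the six others HOLD (`c87_row_denied_top` — B101 is load-bearing for C222 as typed); in the book countermodel of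
ANY leaf (Mok, KMSW at the top) C220's two classical theorems, C221's Theorem A and C222's three statements FAIL while C220's control and C221's two KMSW-side theorems HOLD
(`c87_book_cm`); with Mok read by the countermodel of ANY of its leaves (book at the top, KMSW without its Mok import) C220's two theorems and C221's two KMSW-side theorems FAIL,
the control, Theorem A and C222 HOLD (`c87_mok_cm`); with only KMSW's Mok import denied (book and Mok at the top; KMSW's scope then fails at every rank) C221's two KMSW-side
theorems FAIL and the seven others HOLD (`c87_kmsw_importDenied`).  In one statement (`c87_regraded`): support(C220's Thms 5.19 / 6.1 / 6.6) = book 24 ∪ Mok 29, KMSW ∩ support = ∅;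
support(C220's Thm 6.17) = ∅; support(C221's Thms 5.5 / B) = KMSW's import-and-scope (Mok's inputs through it), book ∩ support = ∅; support(C221's Thm A) = book 24;
support(C222) = book 24 (directly and through B101).

**v4 (section 91; unit `pub-arthur-down-g35`).**  The eighty-eighth tranche (NEW `Downstream25.lean` v1, the twenty-fifth register file) types THE CITATION GRAPH, II:
rows C223 Kim – Yamauchi arXiv:2411.16953 (G_2: `KYGGarchimedean` = Appendix A ⇐ book ∧ row B1's `Consumers.AMR`; `KYGGassump` ⇐ it; `KYGGFourier` = Thms 1.1 / 1.4 at level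
one ⇐ it), C224 Haan – Kwon arXiv:2605.04389 (2026; `HKggp` = Thm 1.1 ⇐ book ∧ B3 `Consumers6.AtobeGanEvenQS` ∧ C1 `GanIchino11` / `GanIchino14` ∧ A5 `IshimotoGeneric` ∧ C28
`Consumers11.LiMpApackets`), C225 Kim – Yamauchi 2013/2016 (hypothesis node `KYArtinHyps`; `KYArtin` = Thm 1.1 ⇐ row D17's node `Consumers10.ArthurGSp4` ∧ node; control `KYSym3` =
Thm 10.1, premise-free).  Certified with ONE reading `canon₈₈W ν c c₆ c₁₀ c₁₁ hyps` parametrised by the ASSIGNMENTS of tranches 1 / 6 / 10 / 11 and the node's value, whose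
edges hold for every such assignment (`canon_implications₈₈W`): at the top (tranches 1 / 6 / 10 / 11 canonical, node granted) all seven statements hold
(`eightyeighth_holds_top`); with the node DENIED Kim – Yamauchi's Theorem 1.1 FAILS, the rest hold (`c88_node_denied_top`); with row B1 denied (`c₁noB1`) C223's three statements
FAIL, with row C28 denied (§29's `canon₁₁noC28`) C224 FAILS, with D17's node denied (`c₁₀noGSp4`) C225's theorem FAILS — every typed conduit is load-bearing
(`c88_rows_denied_top`); in the book countermodel of ANY leaf all six book-side statements FAIL while the control and the (granted) node hold (`c88_book_cm`); with Mok
read by the countermodel of ANY of its leaves AND KMSW without its Mok import (book at the top) ALL SEVEN HOLD (`c88_mok_kmsw_free` — Mok ∩ support = KMSW ∩ support = ∅ for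
the whole tranche).  In one statement (`c88_regraded`): support(C223) = support(C224) = book 24 (through B1 resp. B3 / C1 / A5 / C28); support(`KYArtin`) = book 24 (through
`ArthurGSp4` ⇐ `GeeTaibi`) ∪ {node}; support(`KYSym3`) = ∅.

**Deliberately not here.**  Any claim about the content or truth of a downstream statement; no new named fact (every
canonical value is written out); no Mathlib, no `axiom`, no `sorry`, no `opaque`.
-/

set_option autoImplicit false

namespace Literature.NumberTheory.Automorphic.Arthur2013

namespace Downstream

namespace Support
/-! ## 86. Eighty-third tranche (v1 of this file, after `Downstream23.lean` v1; unit `pub-arthur-down-g33`): supports of MR-NUMBER CITERS, III — NEW rows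
B121 `HMwellUnderstood` (node, supplied) / `HMcompact`, B122 `SunoharaHyp` (node, supplied) / `SunoharaTransfer`, C210 `CTdescent`, C211 `DZhypCoh` (node) /
`DZpadicL` / `DZcycles`; see the module docstring for the summary. -/

section Canon83

variable (ν : Nodes) (μ : Mok2015.Nodes) (κ : KMSW2014.Nodes)

/-- The parametrised canonical reading of the eighty-third tranche: `ig`, `cz`, `pf`, `dv`, `bm` := the values of rows A5 / A9 / C62 / C185 / C63 (the row premises of B121's supply edge), `hc` := the value of C211's cohomology node; B121 := book ∧ ig ∧ Mok ∧ KMSW scope ∧ cz ∧ pf ∧ dv ∧ bm; B122 := book ∧ Mok; C210 := Mok; C211 := Mok ∧ KMSW scope (∧ hc for Theorems C / D). [cite: HansenMann2026CategoricalLLC, Example 6.3; Sunohara2025StableTransfer, §4.2; ClozelThorne2014LevelRaisingI, Prop. 2.9; DisegniZhang2024GGPcycles, Remark l.952-955 (canonical model; bookkeeping)] [claim: KalethaMinguezShinWhite2014, under-review] -/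
abbrev canon₈₃W (ig cz pf dv bm hc : Prop) : Consumers83 where
  HMwellUnderstood := (∀ N, ν.Everything N) ∧ ig ∧ (∀ N, μ.Everything N) ∧ (∀ N, κ.Scope N) ∧ cz ∧ pf ∧ dv ∧ bm
  HMcompact := (∀ N, ν.Everything N) ∧ ig ∧ (∀ N, μ.Everything N) ∧ (∀ N, κ.Scope N) ∧ cz ∧ pf ∧ dv ∧ bm
  SunoharaHyp := (∀ N, ν.Everything N) ∧ (∀ N, μ.Everything N)
  SunoharaTransfer := (∀ N, ν.Everything N) ∧ (∀ N, μ.Everything N)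
  CTdescent := ∀ N, μ.Everything N
  DZhypCoh := hc
  DZpadicL := (∀ N, μ.Everything N) ∧ (∀ N, κ.Scope N)
  DZcycles := ((∀ N, μ.Everything N) ∧ (∀ N, κ.Scope N)) ∧ hc ∧ (∀ N, μ.Everything N) ∧ (∀ N, κ.Scope N)

/-- Every eighty-third-tranche edge holds in the parametrised reading, for arbitrary ν, μ, κ, for EVERY assignment of the first, twenty-fifth and twenty-seventh tranches' fields and every value of the node. [cite: HansenMann2026CategoricalLLC, Example 6.3; Sunohara2025StableTransfer, §4.2; ClozelThorne2014LevelRaisingI, Prop. 2.9 (3); DisegniZhang2024GGPcycles, §2.2 (bookkeeping proved here)] [claim: KalethaMinguezShinWhite2014, under-review] -/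
theorem canon_implications₈₃W (c : Consumers) (c₂₅ : Consumers25) (c₂₇ : Consumers27) (hc : Prop) :
    Implications83 ν μ κ c c₂₅ c₂₇ (canon₈₃W ν μ κ c.IshimotoGeneric c.ChenZou c₂₇.PengFS c₂₅.DvHKZ c₂₇.BMHN hc) where
  hmNode := fun a b d e f g h i => ⟨a, b, d, e, f, g, h, i⟩
  hmCompact := fun h => h
  suNode := fun a b => ⟨a, b⟩
  suTransfer := fun h => h
  ct := fun h => h
  dzL := fun a b => ⟨a, b⟩
  dzCycles := fun hl hh hm hk => ⟨hl, hh, hm, hk⟩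

/-- In the parametrised reading all eight statements hold as soon as the book's and Mok's outputs and KMSW's proved scope hold at all ranks, the five row premises
hold and the node holds — through the tranche's own bookkeeping theorems `hm_of_rows`, `sunohara_of_book_and_mok`, `dz_of_mok_scope_node`. [cite: HansenMann2026CategoricalLLC, Thm 6.12; Sunohara2025StableTransfer, Thms 1.1, 1.2; ClozelThorne2014LevelRaisingI, Prop. 2.9 (3); DisegniZhang2024GGPcycles, Thms A–D (bookkeeping proved here)] [claim: KalethaMinguezShinWhite2014, under-review] -/
theorem c83_all_of (c : Consumers) (c₂₅ : Consumers25) (c₂₇ : Consumers27) (hc : Prop) (hν : ∀ N, ν.Everything N) (hμ : ∀ N, μ.Everything N)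
    (hκ : ∀ N, κ.Scope N) (hI : c.IshimotoGeneric) (hCZ : c.ChenZou) (hP : c₂₇.PengFS) (hD : c₂₅.DvHKZ) (hB : c₂₇.BMHN) (hH : hc) :
    ((canon₈₃W ν μ κ c.IshimotoGeneric c.ChenZou c₂₇.PengFS c₂₅.DvHKZ c₂₇.BMHN hc).HMwellUnderstood ∧ (canon₈₃W ν μ κ c.IshimotoGeneric c.ChenZou c₂₇.PengFS c₂₅.DvHKZ c₂₇.BMHN hc).HMcompact ∧ (canon₈₃W ν μ κ c.IshimotoGeneric c.ChenZou c₂₇.PengFS c₂₅.DvHKZ c₂₇.BMHN hc).SunoharaHyp ∧ (canon₈₃W ν μ κ c.IshimotoGeneric c.ChenZou c₂₇.PengFS c₂₅.DvHKZ c₂₇.BMHN hc).SunoharaTransfer ∧ (canon₈₃W ν μ κ c.IshimotoGeneric c.ChenZou c₂₇.PengFS c₂₅.DvHKZ c₂₇.BMHN hc).CTdescent ∧ (canon₈₃W ν μ κ c.IshimotoGeneric c.ChenZou c₂₇.PengFS c₂₅.DvHKZ c₂₇.BMHN hc).DZhypCoh ∧ (canon₈₃W ν μ κ c.IshimotoGeneric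 c.ChenZou c₂₇.PengFS c₂₅.DvHKZ c₂₇.BMHN hc).DZpadicL ∧ (canon₈₃W ν μ κ c.IshimotoGeneric c.ChenZou c₂₇.PengFS c₂₅.DvHKZ c₂₇.BMHN hc).DZcycles) :=
  have X := canon_implications₈₃W ν μ κ c c₂₅ c₂₇ hc
  have h1 := hm_of_rows X hν hI hμ hκ hCZ hP hD hB
  have h2 := sunohara_of_book_and_mok X hν hμ
  have h4 := dz_of_mok_scope_node X hμ hκ hH
  ⟨h1.1, h1.2, h2.1, h2.2, X.ct hμ, hH, h4.1, h4.2⟩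

end Canon83

/-- At the top (every input of the three DAGs; tranches 1, 25, 27 read canonically; C211's node granted) all eight statements of the tranche hold. [cite: HansenMann2026CategoricalLLC, Thm 6.12; Sunohara2025StableTransfer, Thms 1.1, 1.2; ClozelThorne2014LevelRaisingI, Prop. 2.9 (3); DisegniZhang2024GGPcycles, Thms A–D (bookkeeping proved here)] [claim: KalethaMinguezShinWhite2014, under-review] -/
theorem eightythird_holds_top : ((canon₈₃W νtop μtop κtop (canon νtop μtop κtop).IshimotoGeneric (canon νtop μtop κtop).ChenZou (canon₂₇ νtop μtop κtop).PengFS (canon₂₅ νtop μtop κtop).DvHKZ (canon₂₇ νtop μtop κtop).BMHN True).HMwellUnderstood ∧ (canon₈₃W νtop μtop κtop (canon νtop μtop κtop).IshimotoGeneric (canon νtop μtop κtop).ChenZou (canon₂₇ νtop μtop κtop).PengFS (canon₂₅ νtop μtop κtop).DvHKZ (canon₂₇ νtop μtop κtop).BMHN True).HMcompact ∧ (canon₈₃W νtop μtop κtop (canon νtop μtop κtop).IshimotoGeneric (canon νtop μtop κtop).ChenZou (canon₂₇ νtop μtop κtop).PengFS (canon₂₅ νtop μtop κtop).DvHKZ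 (canon₂₇ νtop μtop κtop).BMHN True).SunoharaHyp ∧ (canon₈₃W νtop μtop κtop (canon νtop μtop κtop).IshimotoGeneric (canon νtop μtop κtop).ChenZou (canon₂₇ νtop μtop κtop).PengFS (canon₂₅ νtop μtop κtop).DvHKZ (canon₂₇ νtop μtop κtop).BMHN True).SunoharaTransfer ∧ (canon₈₃W νtop μtop κtop (canon νtop μtop κtop).IshimotoGeneric (canon νtop μtop κtop).ChenZou (canon₂₇ νtop μtop κtop).PengFS (canon₂₅ νtop μtop κtop).DvHKZ (canon₂₇ νtop μtop κtop).BMHN True).CTdescent ∧ (canon₈₃W νtop μtop κtop (canon νtop μtop κtop).IshimotoGeneric (canon νtop μtop κtop).ChenZou (canon₂₇ νtop μtop κtop).PengFS (canon₂₅ νtop μtop κtop).DvHKZ (canon₂₇ νtop μtop κtop).BMHN True).DZhypCoh ∧ (canon₈₃W νtop μtop κtop (canon νtop μtop κtop).IshimotoGeneric (canon νtop μtop κtop).ChenZou (canon₂₇ νtop μtop κtop).PengFS (canon₂₅ νtop μtop κtop).DvHKZ (canon₂₇ νtop μtop κtop).BMHN True).DZpadicL ∧ (canon₈₃W νtop μtop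 κtop (canon νtop μtop κtop).IshimotoGeneric (canon νtop μtop κtop).ChenZou (canon₂₇ νtop μtop κtop).PengFS (canon₂₅ νtop μtop κtop).DvHKZ (canon₂₇ νtop μtop κtop).BMHN True).DZcycles) :=
  have b : ∀ N, νtop.Everything N := bookInputs_top.everything
  have m : ∀ N, μtop.Everything N := mokInputs_top.everything
  have s : ∀ N, κtop.Scope N := (kmswInputs_top μtop).1.scope mokInputs_top
  c83_all_of νtop μtop κtop (canon νtop μtop κtop) (canon₂₅ νtop μtop κtop) (canon₂₇ νtop μtop κtop) True b m s b ⟨b, m⟩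
    twentyseventh_holds_top.2.1 twentyfifth_holds_top.1.1 twentyseventh_holds_top.2.2.1 trivial

/-- C211's COHOMOLOGY NODE IS LOAD-BEARING FOR THEOREMS C / D AND SUPPLIED BY NOTHING, AS TYPED: at the top with the node DENIED every edge holds, Theorems A / B and
every other row hold, Theorems C / D FAIL. [cite: DisegniZhang2024GGPcycles, Remark l.952-955 (« expected to be proven in a sequel to [KSZ] ») (separating model; bookkeeping proved here)] [claim: KalethaMinguezShinWhite2014, under-review] -/
theorem dz83_need_node_top :
    Implications83 νtop μtop κtop (canon νtop μtop κtop) (canon₂₅ νtop μtop κtop) (canon₂₇ νtop μtop κtop) (canon₈₃W νtop μtop κtop (canon νtop μtop κtop).IshimotoGeneric (canon νtop μtop κtop).ChenZou (canon₂₇ νtop μtop κtop).PengFS (canon₂₅ νtop μtop κtop).DvHKZ (canon₂₇ νtop μtop κtop).BMHN False) ∧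
      (canon₈₃W νtop μtop κtop (canon νtop μtop κtop).IshimotoGeneric (canon νtop μtop κtop).ChenZou (canon₂₇ νtop μtop κtop).PengFS (canon₂₅ νtop μtop κtop).DvHKZ (canon₂₇ νtop μtop κtop).BMHN False).HMcompact ∧ (canon₈₃W νtop μtop κtop (canon νtop μtop κtop).IshimotoGeneric (canon νtop μtop κtop).ChenZou (canon₂₇ νtop μtop κtop).PengFS (canon₂₅ νtop μtop κtop).DvHKZ (canon₂₇ νtop μtop κtop).BMHN False).SunoharaTransfer ∧ (canon₈₃W νtop μtop κtop (canon νtop μtop κtop).IshimotoGeneric (canon νtop μtop κtop).ChenZou (canon₂₇ νtop μtop κtop).PengFS (canon₂₅ νtop μtop κtop).DvHKZ (canon₂₇ νtop μtop κtop).BMHN False).CTdescent ∧ (canon₈₃W νtop μtop κtop (canon νtop μtop κtop).IshimotoGeneric (canon νtop μtop κtop).ChenZou (canon₂₇ νtop μtop κtop).PengFS (canon₂₅ νtop μtop κtop).DvHKZ (canon₂₇ νtop μtop κtop).BMHN False).DZpadicL ∧ ¬ (canon₈₃W νtop μtop κtop (canon νtop μtop κtop).IshimotoGeneric (canon νtop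 μtop κtop).ChenZou (canon₂₇ νtop μtop κtop).PengFS (canon₂₅ νtop μtop κtop).DvHKZ (canon₂₇ νtop μtop κtop).BMHN False).DZhypCoh ∧ ¬ (canon₈₃W νtop μtop κtop (canon νtop μtop κtop).IshimotoGeneric (canon νtop μtop κtop).ChenZou (canon₂₇ νtop μtop κtop).PengFS (canon₂₅ νtop μtop κtop).DvHKZ (canon₂₇ νtop μtop κtop).BMHN False).DZcycles :=
  have b : ∀ N, νtop.Everything N := bookInputs_top.everything
  have m : ∀ N, μtop.Everything N := mokInputs_top.everything
  have s : ∀ N, κtop.Scope N := (kmswInputs_top μtop).1.scope mokInputs_top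
  ⟨canon_implications₈₃W _ _ _ _ _ _ _,
    ⟨b, b, m, s, ⟨b, m⟩, twentyseventh_holds_top.2.1, twentyfifth_holds_top.1.1, twentyseventh_holds_top.2.2.1⟩, ⟨b, m⟩, m, ⟨m, s⟩, id, fun h => h.2.1⟩

/-- BOOK SIDE, EXACT SUPPORT AS TYPED: in the book countermodel of ANY leaf `l` (Mok and KMSW at the top; tranches 1, 25, 27 read canonically over the countermodel;
node granted; every edge valid) B121's node and Theorem 6.12 FAIL (the book premise « due to Arthur [ArthurBook] » is load-bearing) and B122's node and
Theorems 1.1 / 1.2 FAIL (« the works of Arthur »), while C210 and all of C211 HOLD (Mok / KMSW only). [cite: HansenMann2026CategoricalLLC, Example 6.3; Sunohara2025StableTransfer, §4.2; ClozelThorne2014LevelRaisingI, Prop. 2.9 (3); DisegniZhang2024GGPcycles, Remark l.952-955 (bookkeeping proved here)] [claim: KalethaMinguezShinWhite2014, under-review] -/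
theorem c83_book_cm (l : LeafSupport.Leaf) :
    Implications83 (LeafSupport.mkN (LeafSupport.cm l)) μtop κtop (canon (LeafSupport.mkN (LeafSupport.cm l)) μtop κtop) (canon₂₅ (LeafSupport.mkN (LeafSupport.cm l)) μtop κtop) (canon₂₇ (LeafSupport.mkN (LeafSupport.cm l)) μtop κtop) (canon₈₃W (LeafSupport.mkN (LeafSupport.cm l)) μtop κtop (canon (LeafSupport.mkN (LeafSupport.cm l)) μtop κtop).IshimotoGeneric (canon (LeafSupport.mkN (LeafSupport.cm l)) μtop κtop).ChenZou (canon₂₇ (LeafSupport.mkN (LeafSupport.cm l)) μtop κtop).PengFS (canon₂₅ (LeafSupport.mkN (LeafSupport.cm l)) μtop κtop).DvHKZ (canon₂₇ (LeafSupport.mkN (LeafSupport.cm l)) μtop κtop).BMHN True) ∧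
      (∀ l', l' ≠ l → (LeafSupport.mkN (LeafSupport.cm l)).leaf l') ∧ ¬ (LeafSupport.mkN (LeafSupport.cm l)).leaf l ∧
      ¬ (canon₈₃W (LeafSupport.mkN (LeafSupport.cm l)) μtop κtop (canon (LeafSupport.mkN (LeafSupport.cm l)) μtop κtop).IshimotoGeneric (canon (LeafSupport.mkN (LeafSupport.cm l)) μtop κtop).ChenZou (canon₂₇ (LeafSupport.mkN (LeafSupport.cm l)) μtop κtop).PengFS (canon₂₅ (LeafSupport.mkN (LeafSupport.cm l)) μtop κtop).DvHKZ (canon₂₇ (LeafSupport.mkN (LeafSupport.cm l)) μtop κtop).BMHN True).HMwellUnderstood ∧ ¬ (canon₈₃W (LeafSupport.mkN (LeafSupport.cm l)) μtop κtop (canon (LeafSupport.mkN (LeafSupport.cm l)) μtop κtop).IshimotoGeneric (canon (LeafSupport.mkN (LeafSupport.cm l)) μtop κtop).ChenZou (canon₂₇ (LeafSupport.mkN (LeafSupport.cm l)) μtop κtop).PengFS (canon₂₅ (LeafSupport.mkN (LeafSupport.cm l)) μtop κtop).DvHKZ (canon₂₇ (LeafSupport.mkN (LeafSupport.cm l)) μtop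 κtop).BMHN True).HMcompact ∧ ¬ (canon₈₃W (LeafSupport.mkN (LeafSupport.cm l)) μtop κtop (canon (LeafSupport.mkN (LeafSupport.cm l)) μtop κtop).IshimotoGeneric (canon (LeafSupport.mkN (LeafSupport.cm l)) μtop κtop).ChenZou (canon₂₇ (LeafSupport.mkN (LeafSupport.cm l)) μtop κtop).PengFS (canon₂₅ (LeafSupport.mkN (LeafSupport.cm l)) μtop κtop).DvHKZ (canon₂₇ (LeafSupport.mkN (LeafSupport.cm l)) μtop κtop).BMHN True).SunoharaHyp ∧ ¬ (canon₈₃W (LeafSupport.mkN (LeafSupport.cm l)) μtop κtop (canon (LeafSupport.mkN (LeafSupport.cm l)) μtop κtop).IshimotoGeneric (canon (LeafSupport.mkN (LeafSupport.cm l)) μtop κtop).ChenZou (canon₂₇ (LeafSupport.mkN (LeafSupport.cm l)) μtop κtop).PengFS (canon₂₅ (LeafSupport.mkN (LeafSupport.cm l)) μtop κtop).DvHKZ (canon₂₇ (LeafSupport.mkN (LeafSupport.cm l)) μtop κtop).BMHN True).SunoharaTransfer ∧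
      (canon₈₃W (LeafSupport.mkN (LeafSupport.cm l)) μtop κtop (canon (LeafSupport.mkN (LeafSupport.cm l)) μtop κtop).IshimotoGeneric (canon (LeafSupport.mkN (LeafSupport.cm l)) μtop κtop).ChenZou (canon₂₇ (LeafSupport.mkN (LeafSupport.cm l)) μtop κtop).PengFS (canon₂₅ (LeafSupport.mkN (LeafSupport.cm l)) μtop κtop).DvHKZ (canon₂₇ (LeafSupport.mkN (LeafSupport.cm l)) μtop κtop).BMHN True).CTdescent ∧ (canon₈₃W (LeafSupport.mkN (LeafSupport.cm l)) μtop κtop (canon (LeafSupport.mkN (LeafSupport.cm l)) μtop κtop).IshimotoGeneric (canon (LeafSupport.mkN (LeafSupport.cm l)) μtop κtop).ChenZou (canon₂₇ (LeafSupport.mkN (LeafSupport.cm l)) μtop κtop).PengFS (canon₂₅ (LeafSupport.mkN (LeafSupport.cm l)) μtop κtop).DvHKZ (canon₂₇ (LeafSupport.mkN (LeafSupport.cm l)) μtop κtop).BMHN True).DZpadicL ∧ (canon₈₃W (LeafSupport.mkN (LeafSupport.cm l)) μtop κtop (canon (LeafSupport.mkN (LeafSupport.cm l)) μtop κtop).IshimotoGeneric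 (canon (LeafSupport.mkN (LeafSupport.cm l)) μtop κtop).ChenZou (canon₂₇ (LeafSupport.mkN (LeafSupport.cm l)) μtop κtop).PengFS (canon₂₅ (LeafSupport.mkN (LeafSupport.cm l)) μtop κtop).DvHKZ (canon₂₇ (LeafSupport.mkN (LeafSupport.cm l)) μtop κtop).BMHN True).DZcycles :=
  have cmod := LeafSupport.countermodel l
  have nb := not_B_cm l
  have m : ∀ N, μtop.Everything N := mokInputs_top.everything
  have s : ∀ N, κtop.Scope N := (kmswInputs_top μtop).1.scope mokInputs_top
  ⟨canon_implications₈₃W _ _ _ _ _ _ _, cmod.2.1, cmod.2.2.1, fun h => nb h.1, fun h => nb h.1, fun h => nb h.1, fun h => nb h.1,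
    m, ⟨m, s⟩, ⟨⟨m, s⟩, trivial, m, s⟩⟩

/-- MOK SIDE, EXACT SUPPORT AS TYPED — EVERY ROW OF THE TRANCHE: with the book at the top, Mok read by the countermodel of ANY of its leaves and KMSW WITHOUT its Mok
import (`κnoMok`), tranches 1, 25, 27 read canonically over these, node granted, every edge valid: B121, B122, C210 and C211's theorems all FAIL. [cite: HansenMann2026CategoricalLLC, Example 6.3 (« due to Mok »); Sunohara2025StableTransfer, §4.2 (« Mok »); ClozelThorne2014LevelRaisingI, Prop. 2.9 (3) (« [Mok, Theorem 2.5.2] »); DisegniZhang2024GGPcycles, l.1550 (« [mok, KMSW] ») (bookkeeping proved here)] [claim: KalethaMinguezShinWhite2014, under-review] -/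
theorem c83_mok_cm (l : Mok2015.LeafSupport.Leaf) :
    ¬ (Mok2015.LeafSupport.mkN (Mok2015.LeafSupport.cm l)).leaf l ∧ Implications83 νtop (Mok2015.LeafSupport.mkN (Mok2015.LeafSupport.cm l)) κnoMok (canon νtop (Mok2015.LeafSupport.mkN (Mok2015.LeafSupport.cm l)) κnoMok) (canon₂₅ νtop (Mok2015.LeafSupport.mkN (Mok2015.LeafSupport.cm l)) κnoMok) (canon₂₇ νtop (Mok2015.LeafSupport.mkN (Mok2015.LeafSupport.cm l)) κnoMok) (canon₈₃W νtop (Mok2015.LeafSupport.mkN (Mok2015.LeafSupport.cm l)) κnoMok (canon νtop (Mok2015.LeafSupport.mkN (Mok2015.LeafSupport.cm l)) κnoMok).IshimotoGeneric (canon νtop (Mok2015.LeafSupport.mkN (Mok2015.LeafSupport.cm l)) κnoMok).ChenZou (canon₂₇ νtop (Mok2015.LeafSupport.mkN (Mok2015.LeafSupport.cm l)) κnoMok).PengFS (canon₂₅ νtop (Mok2015.LeafSupport.mkN (Mok2015.LeafSupport.cm l)) κnoMok).DvHKZ (canon₂₇ νtop (Mok2015.LeafSupport.mkN (Mok2015.LeafSupport.cm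 l)) κnoMok).BMHN True) ∧
      ¬ (canon₈₃W νtop (Mok2015.LeafSupport.mkN (Mok2015.LeafSupport.cm l)) κnoMok (canon νtop (Mok2015.LeafSupport.mkN (Mok2015.LeafSupport.cm l)) κnoMok).IshimotoGeneric (canon νtop (Mok2015.LeafSupport.mkN (Mok2015.LeafSupport.cm l)) κnoMok).ChenZou (canon₂₇ νtop (Mok2015.LeafSupport.mkN (Mok2015.LeafSupport.cm l)) κnoMok).PengFS (canon₂₅ νtop (Mok2015.LeafSupport.mkN (Mok2015.LeafSupport.cm l)) κnoMok).DvHKZ (canon₂₇ νtop (Mok2015.LeafSupport.mkN (Mok2015.LeafSupport.cm l)) κnoMok).BMHN True).HMcompact ∧ ¬ (canon₈₃W νtop (Mok2015.LeafSupport.mkN (Mok2015.LeafSupport.cm l)) κnoMok (canon νtop (Mok2015.LeafSupport.mkN (Mok2015.LeafSupport.cm l)) κnoMok).IshimotoGeneric (canon νtop (Mok2015.LeafSupport.mkN (Mok2015.LeafSupport.cm l)) κnoMok).ChenZou (canon₂₇ νtop (Mok2015.LeafSupport.mkN (Mok2015.LeafSupport.cm l)) κnoMok).PengFS (canon₂₅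 νtop (Mok2015.LeafSupport.mkN (Mok2015.LeafSupport.cm l)) κnoMok).DvHKZ (canon₂₇ νtop (Mok2015.LeafSupport.mkN (Mok2015.LeafSupport.cm l)) κnoMok).BMHN True).SunoharaTransfer ∧ ¬ (canon₈₃W νtop (Mok2015.LeafSupport.mkN (Mok2015.LeafSupport.cm l)) κnoMok (canon νtop (Mok2015.LeafSupport.mkN (Mok2015.LeafSupport.cm l)) κnoMok).IshimotoGeneric (canon νtop (Mok2015.LeafSupport.mkN (Mok2015.LeafSupport.cm l)) κnoMok).ChenZou (canon₂₇ νtop (Mok2015.LeafSupport.mkN (Mok2015.LeafSupport.cm l)) κnoMok).PengFS (canon₂₅ νtop (Mok2015.LeafSupport.mkN (Mok2015.LeafSupport.cm l)) κnoMok).DvHKZ (canon₂₇ νtop (Mok2015.LeafSupport.mkN (Mok2015.LeafSupport.cm l)) κnoMok).BMHN True).CTdescent ∧ ¬ (canon₈₃W νtop (Mok2015.LeafSupport.mkN (Mok2015.LeafSupport.cm l)) κnoMok (canon νtop (Mok2015.LeafSupport.mkN (Mok2015.LeafSupport.cm l)) κnoMok).IshimotoGeneric (canon νtop (Mok2015.LeafSupport.mkN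 (Mok2015.LeafSupport.cm l)) κnoMok).ChenZou (canon₂₇ νtop (Mok2015.LeafSupport.mkN (Mok2015.LeafSupport.cm l)) κnoMok).PengFS (canon₂₅ νtop (Mok2015.LeafSupport.mkN (Mok2015.LeafSupport.cm l)) κnoMok).DvHKZ (canon₂₇ νtop (Mok2015.LeafSupport.mkN (Mok2015.LeafSupport.cm l)) κnoMok).BMHN True).DZpadicL ∧ ¬ (canon₈₃W νtop (Mok2015.LeafSupport.mkN (Mok2015.LeafSupport.cm l)) κnoMok (canon νtop (Mok2015.LeafSupport.mkN (Mok2015.LeafSupport.cm l)) κnoMok).IshimotoGeneric (canon νtop (Mok2015.LeafSupport.mkN (Mok2015.LeafSupport.cm l)) κnoMok).ChenZou (canon₂₇ νtop (Mok2015.LeafSupport.mkN (Mok2015.LeafSupport.cm l)) κnoMok).PengFS (canon₂₅ νtop (Mok2015.LeafSupport.mkN (Mok2015.LeafSupport.cm l)) κnoMok).DvHKZ (canon₂₇ νtop (Mok2015.LeafSupport.mkN (Mok2015.LeafSupport.cm l)) κnoMok).BMHN True).DZcycles :=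
  have cmod := Mok2015.LeafSupport.countermodel l
  have nm := not_M_cm l
  ⟨cmod.2.2.1, canon_implications₈₃W _ _ _ _ _ _ _, fun h => nm h.2.2.1, fun h => nm h.2, nm, fun h => nm h.1, fun h => nm h.2.2.1⟩

/-- KMSW SIDE, AS TYPED: with the book AND Mok at the top but KMSW WITHOUT its Mok import (`κnoMok`: KMSW's edges, published leaves, weighted FL and both sequels
hold, its proved scope fails at every rank — `κnoMok_facts`), tranches 1, 25, 27 read canonically, node granted, every edge valid: B121's node / theorem and
C211's theorems FAIL (KMSW's scope load-bearing: « [KMSW] for inner forms », « [mok, KMSW] »), while B122's node / theorems and C210 HOLD — B122's hypothesis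
covers the inner forms of unitary groups, but its printed discharge cites no KMSW, and the register types what is printed. [cite: Sunohara2025StableTransfer, §4.2 (l.1531); HansenMann2026CategoricalLLC, Example 6.3; DisegniZhang2024GGPcycles, l.1705 (separating model; bookkeeping proved here)] [claim: KalethaMinguezShinWhite2014, under-review] -/
theorem c83_kmsw_importDenied :
    Implications83 νtop μtop κnoMok (canon νtop μtop κnoMok) (canon₂₅ νtop μtop κnoMok) (canon₂₇ νtop μtop κnoMok) (canon₈₃W νtop μtop κnoMok (canon νtop μtop κnoMok).IshimotoGeneric (canon νtop μtop κnoMok).ChenZou (canon₂₇ νtop μtop κnoMok).PengFS (canon₂₅ νtop μtop κnoMok).DvHKZ (canon₂₇ νtop μtop κnoMok).BMHN True) ∧ (∀ N, ¬ κnoMok.Scope N) ∧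
      ¬ (canon₈₃W νtop μtop κnoMok (canon νtop μtop κnoMok).IshimotoGeneric (canon νtop μtop κnoMok).ChenZou (canon₂₇ νtop μtop κnoMok).PengFS (canon₂₅ νtop μtop κnoMok).DvHKZ (canon₂₇ νtop μtop κnoMok).BMHN True).HMwellUnderstood ∧ ¬ (canon₈₃W νtop μtop κnoMok (canon νtop μtop κnoMok).IshimotoGeneric (canon νtop μtop κnoMok).ChenZou (canon₂₇ νtop μtop κnoMok).PengFS (canon₂₅ νtop μtop κnoMok).DvHKZ (canon₂₇ νtop μtop κnoMok).BMHN True).HMcompact ∧ (canon₈₃W νtop μtop κnoMok (canon νtop μtop κnoMok).IshimotoGeneric (canon νtop μtop κnoMok).ChenZou (canon₂₇ νtop μtop κnoMok).PengFS (canon₂₅ νtop μtop κnoMok).DvHKZ (canon₂₇ νtop μtop κnoMok).BMHN True).SunoharaHyp ∧ (canon₈₃W νtop μtop κnoMok (canon νtop μtop κnoMok).IshimotoGeneric (canon νtop μtop κnoMok).ChenZou (canon₂₇ νtop μtop κnoMok).PengFS (canon₂₅ νtop μtop κnoMok).DvHKZ (canon₂₇ νtop μtop κnoMok).BMHN True).SunoharaTransfer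 ∧ (canon₈₃W νtop μtop κnoMok (canon νtop μtop κnoMok).IshimotoGeneric (canon νtop μtop κnoMok).ChenZou (canon₂₇ νtop μtop κnoMok).PengFS (canon₂₅ νtop μtop κnoMok).DvHKZ (canon₂₇ νtop μtop κnoMok).BMHN True).CTdescent ∧
      ¬ (canon₈₃W νtop μtop κnoMok (canon νtop μtop κnoMok).IshimotoGeneric (canon νtop μtop κnoMok).ChenZou (canon₂₇ νtop μtop κnoMok).PengFS (canon₂₅ νtop μtop κnoMok).DvHKZ (canon₂₇ νtop μtop κnoMok).BMHN True).DZpadicL ∧ ¬ (canon₈₃W νtop μtop κnoMok (canon νtop μtop κnoMok).IshimotoGeneric (canon νtop μtop κnoMok).ChenZou (canon₂₇ νtop μtop κnoMok).PengFS (canon₂₅ νtop μtop κnoMok).DvHKZ (canon₂₇ νtop μtop κnoMok).BMHN True).DZcycles :=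
  have b : ∀ N, νtop.Everything N := bookInputs_top.everything
  have m : ∀ N, μtop.Everything N := mokInputs_top.everything
  have ns : ∀ N, ¬ κnoMok.Scope N := κnoMok_facts.2.2.2.2.2.1
  have nS : ¬ ∀ N, κnoMok.Scope N := fun h => ns 0 (h 0)
  ⟨canon_implications₈₃W _ _ _ _ _ _ _, ns, fun h => nS h.2.2.2.1, fun h => nS h.2.2.2.1, ⟨b, m⟩, ⟨b, m⟩, m, fun h => nS h.2, fun h => nS h.1.2⟩

/-- THE EIGHTY-THIRD TRANCHE REGRADED, in one statement: (i) at the top all eight hold; (ii) C211's node denied at the top: Theorems C / D fail, A / B hold; (iii) in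
the book countermodel of any leaf B121 and B122 fail, C210 and C211 hold; (iv) for every Mok countermodel (KMSW without Mok, book at the top) every row's theorems
fail; (v) with KMSW's Mok import denied (book, Mok at the top) B121 and C211 fail, B122 and C210 hold. [cite: HansenMann2026CategoricalLLC, Thm 6.12; Sunohara2025StableTransfer, Thms 1.1, 1.2; ClozelThorne2014LevelRaisingI, Prop. 2.9 (3); DisegniZhang2024GGPcycles, Thms A–D (bookkeeping proved here)] [claim: KalethaMinguezShinWhite2014, under-review] -/
theorem c83_regraded :
    ((canon₈₃W νtop μtop κtop (canon νtop μtop κtop).IshimotoGeneric (canon νtop μtop κtop).ChenZou (canon₂₇ νtop μtop κtop).PengFS (canon₂₅ νtop μtop κtop).DvHKZ (canon₂₇ νtop μtop κtop).BMHN True).HMwellUnderstood ∧ (canon₈₃W νtop μtop κtop (canon νtop μtop κtop).IshimotoGeneric (canon νtop μtop κtop).ChenZou (canon₂₇ νtop μtop κtop).PengFS (canon₂₅ νtop μtop κtop).DvHKZ (canon₂₇ νtop μtop κtop).BMHN True).HMcompact ∧ (canon₈₃W νtop μtop κtop (canon νtop μtop κtop).IshimotoGeneric (canon νtop μtop κtop).ChenZou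 (canon₂₇ νtop μtop κtop).PengFS (canon₂₅ νtop μtop κtop).DvHKZ (canon₂₇ νtop μtop κtop).BMHN True).SunoharaHyp ∧ (canon₈₃W νtop μtop κtop (canon νtop μtop κtop).IshimotoGeneric (canon νtop μtop κtop).ChenZou (canon₂₇ νtop μtop κtop).PengFS (canon₂₅ νtop μtop κtop).DvHKZ (canon₂₇ νtop μtop κtop).BMHN True).SunoharaTransfer ∧ (canon₈₃W νtop μtop κtop (canon νtop μtop κtop).IshimotoGeneric (canon νtop μtop κtop).ChenZou (canon₂₇ νtop μtop κtop).PengFS (canon₂₅ νtop μtop κtop).DvHKZ (canon₂₇ νtop μtop κtop).BMHN True).CTdescent ∧ (canon₈₃W νtop μtop κtop (canon νtop μtop κtop).IshimotoGeneric (canon νtop μtop κtop).ChenZou (canon₂₇ νtop μtop κtop).PengFS (canon₂₅ νtop μtop κtop).DvHKZ (canon₂₇ νtop μtop κtop).BMHN True).DZhypCoh ∧ (canon₈₃W νtop μtop κtop (canon νtop μtop κtop).IshimotoGeneric (canon νtop μtop κtop).ChenZou (canon₂₇ νtop μtop κtop).PengFS (canon₂₅ νtop μtop κtop).DvHKZ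 (canon₂₇ νtop μtop κtop).BMHN True).DZpadicL ∧ (canon₈₃W νtop μtop κtop (canon νtop μtop κtop).IshimotoGeneric (canon νtop μtop κtop).ChenZou (canon₂₇ νtop μtop κtop).PengFS (canon₂₅ νtop μtop κtop).DvHKZ (canon₂₇ νtop μtop κtop).BMHN True).DZcycles) ∧
      ((canon₈₃W νtop μtop κtop (canon νtop μtop κtop).IshimotoGeneric (canon νtop μtop κtop).ChenZou (canon₂₇ νtop μtop κtop).PengFS (canon₂₅ νtop μtop κtop).DvHKZ (canon₂₇ νtop μtop κtop).BMHN False).DZpadicL ∧ ¬ (canon₈₃W νtop μtop κtop (canon νtop μtop κtop).IshimotoGeneric (canon νtop μtop κtop).ChenZou (canon₂₇ νtop μtop κtop).PengFS (canon₂₅ νtop μtop κtop).DvHKZ (canon₂₇ νtop μtop κtop).BMHN False).DZcycles) ∧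
      (∀ l : LeafSupport.Leaf, (¬ (LeafSupport.mkN (LeafSupport.cm l)).leaf l) ∧ ¬ (canon₈₃W (LeafSupport.mkN (LeafSupport.cm l)) μtop κtop (canon (LeafSupport.mkN (LeafSupport.cm l)) μtop κtop).IshimotoGeneric (canon (LeafSupport.mkN (LeafSupport.cm l)) μtop κtop).ChenZou (canon₂₇ (LeafSupport.mkN (LeafSupport.cm l)) μtop κtop).PengFS (canon₂₅ (LeafSupport.mkN (LeafSupport.cm l)) μtop κtop).DvHKZ (canon₂₇ (LeafSupport.mkN (LeafSupport.cm l)) μtop κtop).BMHN True).HMcompact ∧ ¬ (canon₈₃W (LeafSupport.mkN (LeafSupport.cm l)) μtop κtop (canon (LeafSupport.mkN (LeafSupport.cm l)) μtop κtop).IshimotoGeneric (canon (LeafSupport.mkN (LeafSupport.cm l)) μtop κtop).ChenZou (canon₂₇ (LeafSupport.mkN (LeafSupport.cm l)) μtop κtop).PengFS (canon₂₅ (LeafSupport.mkN (LeafSupport.cm l)) μtop κtop).DvHKZ (canon₂₇ (LeafSupport.mkN (LeafSupport.cm l)) μtop κtop).BMHN True).SunoharaTransfer ∧ (canon₈₃W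 (LeafSupport.mkN (LeafSupport.cm l)) μtop κtop (canon (LeafSupport.mkN (LeafSupport.cm l)) μtop κtop).IshimotoGeneric (canon (LeafSupport.mkN (LeafSupport.cm l)) μtop κtop).ChenZou (canon₂₇ (LeafSupport.mkN (LeafSupport.cm l)) μtop κtop).PengFS (canon₂₅ (LeafSupport.mkN (LeafSupport.cm l)) μtop κtop).DvHKZ (canon₂₇ (LeafSupport.mkN (LeafSupport.cm l)) μtop κtop).BMHN True).CTdescent ∧ (canon₈₃W (LeafSupport.mkN (LeafSupport.cm l)) μtop κtop (canon (LeafSupport.mkN (LeafSupport.cm l)) μtop κtop).IshimotoGeneric (canon (LeafSupport.mkN (LeafSupport.cm l)) μtop κtop).ChenZou (canon₂₇ (LeafSupport.mkN (LeafSupport.cm l)) μtop κtop).PengFS (canon₂₅ (LeafSupport.mkN (LeafSupport.cm l)) μtop κtop).DvHKZ (canon₂₇ (LeafSupport.mkN (LeafSupport.cm l)) μtop κtop).BMHN True).DZcycles) ∧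
      (∀ l : Mok2015.LeafSupport.Leaf, (¬ (Mok2015.LeafSupport.mkN (Mok2015.LeafSupport.cm l)).leaf l) ∧ ¬ (canon₈₃W νtop (Mok2015.LeafSupport.mkN (Mok2015.LeafSupport.cm l)) κnoMok (canon νtop (Mok2015.LeafSupport.mkN (Mok2015.LeafSupport.cm l)) κnoMok).IshimotoGeneric (canon νtop (Mok2015.LeafSupport.mkN (Mok2015.LeafSupport.cm l)) κnoMok).ChenZou (canon₂₇ νtop (Mok2015.LeafSupport.mkN (Mok2015.LeafSupport.cm l)) κnoMok).PengFS (canon₂₅ νtop (Mok2015.LeafSupport.mkN (Mok2015.LeafSupport.cm l)) κnoMok).DvHKZ (canon₂₇ νtop (Mok2015.LeafSupport.mkN (Mok2015.LeafSupport.cm l)) κnoMok).BMHN True).HMcompact ∧ ¬ (canon₈₃W νtop (Mok2015.LeafSupport.mkN (Mok2015.LeafSupport.cm l)) κnoMok (canon νtop (Mok2015.LeafSupport.mkN (Mok2015.LeafSupport.cm l)) κnoMok).IshimotoGeneric (canon νtop (Mok2015.LeafSupport.mkN (Mok2015.LeafSupport.cm l)) κnoMok).ChenZou (canon₂₇ νtop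 (Mok2015.LeafSupport.mkN (Mok2015.LeafSupport.cm l)) κnoMok).PengFS (canon₂₅ νtop (Mok2015.LeafSupport.mkN (Mok2015.LeafSupport.cm l)) κnoMok).DvHKZ (canon₂₇ νtop (Mok2015.LeafSupport.mkN (Mok2015.LeafSupport.cm l)) κnoMok).BMHN True).SunoharaTransfer ∧ ¬ (canon₈₃W νtop (Mok2015.LeafSupport.mkN (Mok2015.LeafSupport.cm l)) κnoMok (canon νtop (Mok2015.LeafSupport.mkN (Mok2015.LeafSupport.cm l)) κnoMok).IshimotoGeneric (canon νtop (Mok2015.LeafSupport.mkN (Mok2015.LeafSupport.cm l)) κnoMok).ChenZou (canon₂₇ νtop (Mok2015.LeafSupport.mkN (Mok2015.LeafSupport.cm l)) κnoMok).PengFS (canon₂₅ νtop (Mok2015.LeafSupport.mkN (Mok2015.LeafSupport.cm l)) κnoMok).DvHKZ (canon₂₇ νtop (Mok2015.LeafSupport.mkN (Mok2015.LeafSupport.cm l)) κnoMok).BMHN True).CTdescent ∧ ¬ (canon₈₃W νtop (Mok2015.LeafSupport.mkN (Mok2015.LeafSupport.cm l)) κnoMok (canon νtop (Mok2015.LeafSupport.mkN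 (Mok2015.LeafSupport.cm l)) κnoMok).IshimotoGeneric (canon νtop (Mok2015.LeafSupport.mkN (Mok2015.LeafSupport.cm l)) κnoMok).ChenZou (canon₂₇ νtop (Mok2015.LeafSupport.mkN (Mok2015.LeafSupport.cm l)) κnoMok).PengFS (canon₂₅ νtop (Mok2015.LeafSupport.mkN (Mok2015.LeafSupport.cm l)) κnoMok).DvHKZ (canon₂₇ νtop (Mok2015.LeafSupport.mkN (Mok2015.LeafSupport.cm l)) κnoMok).BMHN True).DZcycles) ∧
      (¬ (canon₈₃W νtop μtop κnoMok (canon νtop μtop κnoMok).IshimotoGeneric (canon νtop μtop κnoMok).ChenZou (canon₂₇ νtop μtop κnoMok).PengFS (canon₂₅ νtop μtop κnoMok).DvHKZ (canon₂₇ νtop μtop κnoMok).BMHN True).HMcompact ∧ (canon₈₃W νtop μtop κnoMok (canon νtop μtop κnoMok).IshimotoGeneric (canon νtop μtop κnoMok).ChenZou (canon₂₇ νtop μtop κnoMok).PengFS (canon₂₅ νtop μtop κnoMok).DvHKZ (canon₂₇ νtop μtop κnoMok).BMHN True).SunoharaTransfer ∧ (canon₈₃W νtop μtop κnoMok (canon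 νtop μtop κnoMok).IshimotoGeneric (canon νtop μtop κnoMok).ChenZou (canon₂₇ νtop μtop κnoMok).PengFS (canon₂₅ νtop μtop κnoMok).DvHKZ (canon₂₇ νtop μtop κnoMok).BMHN True).CTdescent ∧ ¬ (canon₈₃W νtop μtop κnoMok (canon νtop μtop κnoMok).IshimotoGeneric (canon νtop μtop κnoMok).ChenZou (canon₂₇ νtop μtop κnoMok).PengFS (canon₂₅ νtop μtop κnoMok).DvHKZ (canon₂₇ νtop μtop κnoMok).BMHN True).DZpadicL) :=
  ⟨eightythird_holds_top, ⟨dz83_need_node_top.2.2.2.2.1, dz83_need_node_top.2.2.2.2.2.2⟩,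
    fun l => have h := c83_book_cm l
      ⟨h.2.2.1, h.2.2.2.2.1, h.2.2.2.2.2.2.1, h.2.2.2.2.2.2.2.1, h.2.2.2.2.2.2.2.2.2⟩,
    fun l => have h := c83_mok_cm l
      ⟨h.1, h.2.2.1, h.2.2.2.1, h.2.2.2.2.1, h.2.2.2.2.2.2⟩,
    ⟨c83_kmsw_importDenied.2.2.2.1, c83_kmsw_importDenied.2.2.2.2.2.1, c83_kmsw_importDenied.2.2.2.2.2.2.1, c83_kmsw_importDenied.2.2.2.2.2.2.2.1⟩⟩

/-! ## 87. Eighty-fourth tranche (v2 of this file, after `Downstream23.lean` v2; unit `pub-arthur-down-g34`): supports of THE BOOK'S SERIES LINE — NEW rows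
B123 `KalethaWhittaker` / `KalethaContragredient`, C212 `PPSRunipotent` / `PPSRgenuine`, C213 `JLresidualFC`, C214 `BMassumptions` (node, supplied) /
`BMaveraging`, C215 `MokCuspidalDecomposition` / `MokRStable`, C216 `CLMspherical`; see the module docstring for the summary. -/

section Canon84

variable (ν : Nodes)

/-- The parametrised canonical reading of the eighty-fourth tranche: `jlz`, `sp`, `scap`, `bmn` := the values of rows C179 / C180 / C182 / A13 (the row premises of the tranche's edges); B123, C212, C215 := book; C213 := book ∧ jlz; C214 := bmn (node and theorem); C216 := book ∧ sp ∧ scap. [cite: Kaletha2013Genericity, §3; PantanoPaulSalamancaRiba2014, §7; JiangLiu2016ResidualFourier, §1.1; BertoloniMeli2021Averaging, §1; Mok2018WeakBeyondEndoscopy, §2; ComtatLesesvreMan2025Kuznetsov, Prop. 2.1 (canonical model; bookkeeping)] -/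
abbrev canon₈₄W (jlz sp scap bmn : Prop) : Consumers84 where
  KalethaWhittaker := ∀ N, ν.Everything N
  KalethaContragredient := ∀ N, ν.Everything N
  PPSRunipotent := ∀ N, ν.Everything N
  PPSRgenuine := ∀ N, ν.Everything N
  JLresidualFC := (∀ N, ν.Everything N) ∧ jlz
  BMassumptions := bmn
  BMaveraging := bmn
  MokCuspidalDecomposition := ∀ N, ν.Everything N
  MokRStable := (∀ N, ν.Everything N) ∧ (∀ N, ν.Everything N)
  CLMspherical := (∀ N, ν.Everything N) ∧ sp ∧ scap

/-- Every eighty-fourth-tranche edge holds in the parametrised reading, for arbitrary ν and EVERY assignment of the nineteenth, twentieth, twenty-seventh and seventy-sixth tranches' fields. [cite: Kaletha2013Genericity, Thms 4.3, 5.9; PantanoPaulSalamancaRiba2014, Thms 29, 6; JiangLiu2016ResidualFourier, Thm 2.1; BertoloniMeli2021Averaging, Thm 1.1; Mok2018WeakBeyondEndoscopy, Thms 3.6, 4.4; ComtatLesesvreMan2025Kuznetsov, Prop. 2.1 (bookkeeping proved here)] -/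
theorem canon_implications₈₄W (c₁₉ : Consumers19) (c₂₀ : Consumers20) (c₂₇ : Consumers27) (c₇₆ : Consumers76) :
    Implications84 ν c₁₉ c₂₀ c₂₇ c₇₆ (canon₈₄W ν c₇₆.JLZResidualPoles c₁₉.SchmidtParamodular c₂₀.SchmidtCAP c₂₇.BMN) where
  kalethaW := fun a => a
  kalethaC := fun a => a
  ppsrU := fun a => a
  ppsrG := fun h => h
  jl := fun a b => ⟨a, b⟩
  bmNode := fun h => h
  bmThm := fun h => h
  mok36 := fun a => a
  mok4 := fun h a => ⟨h, a⟩
  clm := fun a b d => ⟨a, b, d⟩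

/-- In the parametrised reading all ten statements hold as soon as the book's outputs hold at all ranks and the four row premises hold — through the tranche's own
bookkeeping theorems `bookRows84_of_book`, `jl_of_book_and_row`, `bm_of_row`, `clm_of_book_and_rows`. [cite: Kaletha2013Genericity, Thms 4.3, 5.9; PantanoPaulSalamancaRiba2014, Thm 6; JiangLiu2016ResidualFourier, Thm 2.1; BertoloniMeli2021Averaging, Thm 1.1; Mok2018WeakBeyondEndoscopy, Thm 4.4; ComtatLesesvreMan2025Kuznetsov, Prop. 2.1 (bookkeeping proved here)] -/
theorem c84_all_of (c₁₉ : Consumers19) (c₂₀ : Consumers20) (c₂₇ : Consumers27) (c₇₆ : Consumers76) (hν : ∀ N, ν.Everything N) (hZ : c₇₆.JLZResidualPoles)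
    (hP : c₁₉.SchmidtParamodular) (hC : c₂₀.SchmidtCAP) (hA : c₂₇.BMN) :
    ((canon₈₄W ν c₇₆.JLZResidualPoles c₁₉.SchmidtParamodular c₂₀.SchmidtCAP c₂₇.BMN).KalethaWhittaker ∧ (canon₈₄W ν c₇₆.JLZResidualPoles c₁₉.SchmidtParamodular c₂₀.SchmidtCAP c₂₇.BMN).KalethaContragredient ∧ (canon₈₄W ν c₇₆.JLZResidualPoles c₁₉.SchmidtParamodular c₂₀.SchmidtCAP c₂₇.BMN).PPSRunipotent ∧ (canon₈₄W ν c₇₆.JLZResidualPoles c₁₉.SchmidtParamodular c₂₀.SchmidtCAP c₂₇.BMN).PPSRgenuine ∧ (canon₈₄W ν c₇₆.JLZResidualPoles c₁₉.SchmidtParamodular c₂₀.SchmidtCAP c₂₇.BMN).JLresidualFC ∧ (canon₈₄W ν c₇₆.JLZResidualPoles c₁₉.SchmidtParamodular c₂₀.SchmidtCAP c₂₇.BMN).BMassumptions ∧ (canon₈₄W ν c₇₆.JLZResidualPoles c₁₉.SchmidtParamodular c₂₀.SchmidtCAP c₂₇.BMN).BMaveraging ∧ (canon₈₄W ν c₇₆.JLZResidualPoles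 c₁₉.SchmidtParamodular c₂₀.SchmidtCAP c₂₇.BMN).MokCuspidalDecomposition ∧ (canon₈₄W ν c₇₆.JLZResidualPoles c₁₉.SchmidtParamodular c₂₀.SchmidtCAP c₂₇.BMN).MokRStable ∧ (canon₈₄W ν c₇₆.JLZResidualPoles c₁₉.SchmidtParamodular c₂₀.SchmidtCAP c₂₇.BMN).CLMspherical) :=
  have X := canon_implications₈₄W ν c₁₉ c₂₀ c₂₇ c₇₆
  have h := bookRows84_of_book X hν
  have hB := bm_of_row X hA
  ⟨h.1, h.2.1, h.2.2.1, h.2.2.2.1, jl_of_book_and_row X hν hZ, hB.1, hB.2, h.2.2.2.2.1, h.2.2.2.2.2, clm_of_book_and_rows X hν hP hC⟩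

end Canon84

/-- At the top (every input of the three DAGs; tranches 19, 20, 27, 76 read canonically) all ten statements of the tranche hold. [cite: Kaletha2013Genericity, Thms 4.3, 5.9; PantanoPaulSalamancaRiba2014, Thm 6; JiangLiu2016ResidualFourier, Thm 2.1; BertoloniMeli2021Averaging, Thm 1.1; Mok2018WeakBeyondEndoscopy, Thm 4.4; ComtatLesesvreMan2025Kuznetsov, Prop. 2.1 (bookkeeping proved here)] [claim: KalethaMinguezShinWhite2014, under-review] -/
theorem eightyfourth_holds_top : ((canon₈₄W νtop (canon₇₆ νtop μtop κtop).JLZResidualPoles (canon₁₉ νtop μtop κtop).SchmidtParamodular (canon₂₀ νtop μtop κtop).SchmidtCAP (canon₂₇ νtop μtop κtop).BMN).KalethaWhittaker ∧ (canon₈₄W νtop (canon₇₆ νtop μtop κtop).JLZResidualPoles (canon₁₉ νtop μtop κtop).SchmidtParamodular (canon₂₀ νtop μtop κtop).SchmidtCAP (canon₂₇ νtop μtop κtop).BMN).KalethaContragredient ∧ (canon₈₄W νtop (canon₇₆ νtop μtop κtop).JLZResidualPoles (canon₁₉ νtop μtop κtop).SchmidtParamodular (canon₂₀ νtop μtop κtop).SchmidtCAP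 (canon₂₇ νtop μtop κtop).BMN).PPSRunipotent ∧ (canon₈₄W νtop (canon₇₆ νtop μtop κtop).JLZResidualPoles (canon₁₉ νtop μtop κtop).SchmidtParamodular (canon₂₀ νtop μtop κtop).SchmidtCAP (canon₂₇ νtop μtop κtop).BMN).PPSRgenuine ∧ (canon₈₄W νtop (canon₇₆ νtop μtop κtop).JLZResidualPoles (canon₁₉ νtop μtop κtop).SchmidtParamodular (canon₂₀ νtop μtop κtop).SchmidtCAP (canon₂₇ νtop μtop κtop).BMN).JLresidualFC ∧ (canon₈₄W νtop (canon₇₆ νtop μtop κtop).JLZResidualPoles (canon₁₉ νtop μtop κtop).SchmidtParamodular (canon₂₀ νtop μtop κtop).SchmidtCAP (canon₂₇ νtop μtop κtop).BMN).BMassumptions ∧ (canon₈₄W νtop (canon₇₆ νtop μtop κtop).JLZResidualPoles (canon₁₉ νtop μtop κtop).SchmidtParamodular (canon₂₀ νtop μtop κtop).SchmidtCAP (canon₂₇ νtop μtop κtop).BMN).BMaveraging ∧ (canon₈₄W νtop (canon₇₆ νtop μtop κtop).JLZResidualPoles (canon₁₉ νtop μtop κtop).SchmidtParamodular (canon₂₀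 νtop μtop κtop).SchmidtCAP (canon₂₇ νtop μtop κtop).BMN).MokCuspidalDecomposition ∧ (canon₈₄W νtop (canon₇₆ νtop μtop κtop).JLZResidualPoles (canon₁₉ νtop μtop κtop).SchmidtParamodular (canon₂₀ νtop μtop κtop).SchmidtCAP (canon₂₇ νtop μtop κtop).BMN).MokRStable ∧ (canon₈₄W νtop (canon₇₆ νtop μtop κtop).JLZResidualPoles (canon₁₉ νtop μtop κtop).SchmidtParamodular (canon₂₀ νtop μtop κtop).SchmidtCAP (canon₂₇ νtop μtop κtop).BMN).CLMspherical) :=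
  have b : ∀ N, νtop.Everything N := bookInputs_top.everything
  c84_all_of νtop (canon₁₉ νtop μtop κtop) (canon₂₀ νtop μtop κtop) (canon₂₇ νtop μtop κtop) (canon₇₆ νtop μtop κtop) b
    seventysixth_holds_top.2.1 nineteenth_holds_top.1 twentieth_holds_top.1 twentyseventh_holds_top.1

/-- The seventy-sixth-tranche consumer with EVERY field denied (row C179 := False in particular) — an arbitrary assignment, used to deny C213's row premise at the top. [cite: JiangLiuZhang2013Poles, Thm 1.2 (separating model; bookkeeping)] -/
abbrev c₇₆none : Consumers76 where
  MoeglinPairesL := False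
  JLZResidualPoles := False
  TakanashiParity := False
  DSHermitianParameters := False

/-- THE THREE BOOK-SIDE ROW PREMISES ARE LOAD-BEARING AS TYPED: at the top, with rows C179 (`c₇₆none`), C180 (`c₁₉noConduit`) and C182 (`canon₂₀no`) DENIED and
A13 canonical, every edge holds, C213 and C216 FAIL, the eight other statements HOLD. [cite: JiangLiu2016ResidualFourier, §2.1 (« Following [JLZ13] »); ComtatLesesvreMan2025Kuznetsov, proof of Prop. 2.1 (« [schmidt_packet_2017] », « [schmidt_paramodular_2020] ») (separating model; bookkeeping proved here)] [claim: KalethaMinguezShinWhite2014, under-review] -/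
theorem c84_rows_denied_top :
    Implications84 νtop (c₁₉noConduit μtop κtop) canon₂₀no (canon₂₇ νtop μtop κtop) c₇₆none (canon₈₄W νtop False False False (canon₂₇ νtop μtop κtop).BMN) ∧
      (canon₈₄W νtop False False False (canon₂₇ νtop μtop κtop).BMN).KalethaWhittaker ∧ (canon₈₄W νtop False False False (canon₂₇ νtop μtop κtop).BMN).KalethaContragredient ∧ (canon₈₄W νtop False False False (canon₂₇ νtop μtop κtop).BMN).PPSRunipotent ∧ (canon₈₄W νtop False False False (canon₂₇ νtop μtop κtop).BMN).PPSRgenuine ∧ ¬ (canon₈₄W νtop False False False (canon₂₇ νtop μtop κtop).BMN).JLresidualFC ∧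
      (canon₈₄W νtop False False False (canon₂₇ νtop μtop κtop).BMN).BMassumptions ∧ (canon₈₄W νtop False False False (canon₂₇ νtop μtop κtop).BMN).BMaveraging ∧ (canon₈₄W νtop False False False (canon₂₇ νtop μtop κtop).BMN).MokCuspidalDecomposition ∧ (canon₈₄W νtop False False False (canon₂₇ νtop μtop κtop).BMN).MokRStable ∧ ¬ (canon₈₄W νtop False False False (canon₂₇ νtop μtop κtop).BMN).CLMspherical :=
  have b : ∀ N, νtop.Everything N := bookInputs_top.everything
  have a : (canon₂₇ νtop μtop κtop).BMN := twentyseventh_holds_top.1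
  ⟨canon_implications₈₄W νtop (c₁₉noConduit μtop κtop) canon₂₀no (canon₂₇ νtop μtop κtop) c₇₆none,
    b, b, b, b, fun h => h.2, a, a, b, ⟨b, b⟩, fun h => h.2.1⟩

/-- BOOK SIDE, EXACT SUPPORT AS TYPED: in the book countermodel of ANY leaf `l` (Mok and KMSW at the top; tranches 19, 20, 27, 76 read canonically over the
countermodel; every edge valid) the eight book-side statements — Kaletha's two theorems, Pantano – Paul – Salamanca-Riba's Theorem 29 and Theorem 6, Jiang – Liu's
theorems, Mok's Theorems 3.6 / 4.1 / 4.4, Comtat – Lesesvre – Man's Proposition 2.1 — FAIL, while Bertoloni Meli's node and theorem HOLD (Mok / KMSW only). [cite: Kaletha2013Genericity, §3 (« Arthur's recent results [2013, Section 2] »); PantanoPaulSalamancaRiba2014, §7 (« Arthur [2013] … proves »); JiangLiu2016ResidualFourier, §1.1; Mok2018WeakBeyondEndoscopy, §2 (« [A1] »); ComtatLesesvreMan2025Kuznetsov, proof of Prop. 2.1; BertoloniMeli2021Averaging, §1 p0004:L29 (bookkeeping proved here)] [claim: KalethaMinguezShinWhite2014, under-review] -/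
theorem c84_book_cm (l : LeafSupport.Leaf) :
    Implications84 (LeafSupport.mkN (LeafSupport.cm l)) (canon₁₉ (LeafSupport.mkN (LeafSupport.cm l)) μtop κtop) (canon₂₀ (LeafSupport.mkN (LeafSupport.cm l)) μtop κtop) (canon₂₇ (LeafSupport.mkN (LeafSupport.cm l)) μtop κtop) (canon₇₆ (LeafSupport.mkN (LeafSupport.cm l)) μtop κtop) (canon₈₄W (LeafSupport.mkN (LeafSupport.cm l)) (canon₇₆ (LeafSupport.mkN (LeafSupport.cm l)) μtop κtop).JLZResidualPoles (canon₁₉ (LeafSupport.mkN (LeafSupport.cm l)) μtop κtop).SchmidtParamodular (canon₂₀ (LeafSupport.mkN (LeafSupport.cm l)) μtop κtop).SchmidtCAP (canon₂₇ (LeafSupport.mkN (LeafSupport.cm l)) μtop κtop).BMN) ∧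
      (∀ l', l' ≠ l → (LeafSupport.mkN (LeafSupport.cm l)).leaf l') ∧ ¬ (LeafSupport.mkN (LeafSupport.cm l)).leaf l ∧
      (¬ (canon₈₄W (LeafSupport.mkN (LeafSupport.cm l)) (canon₇₆ (LeafSupport.mkN (LeafSupport.cm l)) μtop κtop).JLZResidualPoles (canon₁₉ (LeafSupport.mkN (LeafSupport.cm l)) μtop κtop).SchmidtParamodular (canon₂₀ (LeafSupport.mkN (LeafSupport.cm l)) μtop κtop).SchmidtCAP (canon₂₇ (LeafSupport.mkN (LeafSupport.cm l)) μtop κtop).BMN).KalethaWhittaker ∧ ¬ (canon₈₄W (LeafSupport.mkN (LeafSupport.cm l)) (canon₇₆ (LeafSupport.mkN (LeafSupport.cm l)) μtop κtop).JLZResidualPoles (canon₁₉ (LeafSupport.mkN (LeafSupport.cm l)) μtop κtop).SchmidtParamodular (canon₂₀ (LeafSupport.mkN (LeafSupport.cm l)) μtop κtop).SchmidtCAP (canon₂₇ (LeafSupport.mkN (LeafSupport.cm l)) μtop κtop).BMN).KalethaContragredient ∧ ¬ (canon₈₄W (LeafSupport.mkN (LeafSupport.cm l)) (canon₇₆ (LeafSupport.mkN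 (LeafSupport.cm l)) μtop κtop).JLZResidualPoles (canon₁₉ (LeafSupport.mkN (LeafSupport.cm l)) μtop κtop).SchmidtParamodular (canon₂₀ (LeafSupport.mkN (LeafSupport.cm l)) μtop κtop).SchmidtCAP (canon₂₇ (LeafSupport.mkN (LeafSupport.cm l)) μtop κtop).BMN).PPSRunipotent ∧ ¬ (canon₈₄W (LeafSupport.mkN (LeafSupport.cm l)) (canon₇₆ (LeafSupport.mkN (LeafSupport.cm l)) μtop κtop).JLZResidualPoles (canon₁₉ (LeafSupport.mkN (LeafSupport.cm l)) μtop κtop).SchmidtParamodular (canon₂₀ (LeafSupport.mkN (LeafSupport.cm l)) μtop κtop).SchmidtCAP (canon₂₇ (LeafSupport.mkN (LeafSupport.cm l)) μtop κtop).BMN).PPSRgenuine ∧ ¬ (canon₈₄W (LeafSupport.mkN (LeafSupport.cm l)) (canon₇₆ (LeafSupport.mkN (LeafSupport.cm l)) μtop κtop).JLZResidualPoles (canon₁₉ (LeafSupport.mkN (LeafSupport.cm l)) μtop κtop).SchmidtParamodular (canon₂₀ (LeafSupport.mkN (LeafSupport.cm l)) μtop κtop).SchmidtCAP (canon₂₇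 (LeafSupport.mkN (LeafSupport.cm l)) μtop κtop).BMN).JLresidualFC ∧ ¬ (canon₈₄W (LeafSupport.mkN (LeafSupport.cm l)) (canon₇₆ (LeafSupport.mkN (LeafSupport.cm l)) μtop κtop).JLZResidualPoles (canon₁₉ (LeafSupport.mkN (LeafSupport.cm l)) μtop κtop).SchmidtParamodular (canon₂₀ (LeafSupport.mkN (LeafSupport.cm l)) μtop κtop).SchmidtCAP (canon₂₇ (LeafSupport.mkN (LeafSupport.cm l)) μtop κtop).BMN).MokCuspidalDecomposition ∧ ¬ (canon₈₄W (LeafSupport.mkN (LeafSupport.cm l)) (canon₇₆ (LeafSupport.mkN (LeafSupport.cm l)) μtop κtop).JLZResidualPoles (canon₁₉ (LeafSupport.mkN (LeafSupport.cm l)) μtop κtop).SchmidtParamodular (canon₂₀ (LeafSupport.mkN (LeafSupport.cm l)) μtop κtop).SchmidtCAP (canon₂₇ (LeafSupport.mkN (LeafSupport.cm l)) μtop κtop).BMN).MokRStable ∧ ¬ (canon₈₄W (LeafSupport.mkN (LeafSupport.cm l)) (canon₇₆ (LeafSupport.mkN (LeafSupport.cm l)) μtop κtop).JLZResidualPoles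 (canon₁₉ (LeafSupport.mkN (LeafSupport.cm l)) μtop κtop).SchmidtParamodular (canon₂₀ (LeafSupport.mkN (LeafSupport.cm l)) μtop κtop).SchmidtCAP (canon₂₇ (LeafSupport.mkN (LeafSupport.cm l)) μtop κtop).BMN).CLMspherical) ∧
      (canon₈₄W (LeafSupport.mkN (LeafSupport.cm l)) (canon₇₆ (LeafSupport.mkN (LeafSupport.cm l)) μtop κtop).JLZResidualPoles (canon₁₉ (LeafSupport.mkN (LeafSupport.cm l)) μtop κtop).SchmidtParamodular (canon₂₀ (LeafSupport.mkN (LeafSupport.cm l)) μtop κtop).SchmidtCAP (canon₂₇ (LeafSupport.mkN (LeafSupport.cm l)) μtop κtop).BMN).BMassumptions ∧ (canon₈₄W (LeafSupport.mkN (LeafSupport.cm l)) (canon₇₆ (LeafSupport.mkN (LeafSupport.cm l)) μtop κtop).JLZResidualPoles (canon₁₉ (LeafSupport.mkN (LeafSupport.cm l)) μtop κtop).SchmidtParamodular (canon₂₀ (LeafSupport.mkN (LeafSupport.cm l)) μtop κtop).SchmidtCAP (canon₂₇ (LeafSupport.mkN (LeafSupport.cm l)) μtop κtop).BMN).BMaveraging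 :=
  have cmod := LeafSupport.countermodel l
  have nb := not_B_cm l
  have m : ∀ N, μtop.Everything N := mokInputs_top.everything
  have s : ∀ N, κtop.Scope N := (kmswInputs_top μtop).1.scope mokInputs_top
  ⟨canon_implications₈₄W _ _ _ _ _, cmod.2.1, cmod.2.2.1,
    ⟨nb, nb, nb, nb, fun h => nb h.1, nb, fun h => nb h.1, fun h => nb h.1⟩, ⟨m, s⟩, ⟨m, s⟩⟩

/-- MOK SIDE, EXACT SUPPORT AS TYPED: with the book at the top, Mok read by the countermodel of ANY of its leaves and KMSW WITHOUT its Mok import (`κnoMok`),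
tranches 19, 20, 27, 76 read canonically over these, every edge valid: Bertoloni Meli's node and theorem FAIL (row A13 ⇐ Mok is load-bearing), the eight
book-side statements HOLD. [cite: BertoloniMeli2021Averaging, §1 p0004:L29 (« [BMN1] »); MeliNguyen2021, Thms 1.2–1.3 (« [KMSW] », Mok) (bookkeeping proved here)] [claim: KalethaMinguezShinWhite2014, under-review] -/
theorem c84_mok_cm (l : Mok2015.LeafSupport.Leaf) :
    ¬ (Mok2015.LeafSupport.mkN (Mok2015.LeafSupport.cm l)).leaf l ∧ Implications84 νtop (canon₁₉ νtop (Mok2015.LeafSupport.mkN (Mok2015.LeafSupport.cm l)) κnoMok) (canon₂₀ νtop (Mok2015.LeafSupport.mkN (Mok2015.LeafSupport.cm l)) κnoMok) (canon₂₇ νtop (Mok2015.LeafSupport.mkN (Mok2015.LeafSupport.cm l)) κnoMok) (canon₇₆ νtop (Mok2015.LeafSupport.mkN (Mok2015.LeafSupport.cm l)) κnoMok) (canon₈₄W νtop (canon₇₆ νtop (Mok2015.LeafSupport.mkN (Mok2015.LeafSupport.cm l)) κnoMok).JLZResidualPoles (canon₁₉ νtop (Mok2015.LeafSupport.mkN (Mok2015.LeafSupport.cm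 l)) κnoMok).SchmidtParamodular (canon₂₀ νtop (Mok2015.LeafSupport.mkN (Mok2015.LeafSupport.cm l)) κnoMok).SchmidtCAP (canon₂₇ νtop (Mok2015.LeafSupport.mkN (Mok2015.LeafSupport.cm l)) κnoMok).BMN) ∧
      ¬ (canon₈₄W νtop (canon₇₆ νtop (Mok2015.LeafSupport.mkN (Mok2015.LeafSupport.cm l)) κnoMok).JLZResidualPoles (canon₁₉ νtop (Mok2015.LeafSupport.mkN (Mok2015.LeafSupport.cm l)) κnoMok).SchmidtParamodular (canon₂₀ νtop (Mok2015.LeafSupport.mkN (Mok2015.LeafSupport.cm l)) κnoMok).SchmidtCAP (canon₂₇ νtop (Mok2015.LeafSupport.mkN (Mok2015.LeafSupport.cm l)) κnoMok).BMN).BMassumptions ∧ ¬ (canon₈₄W νtop (canon₇₆ νtop (Mok2015.LeafSupport.mkN (Mok2015.LeafSupport.cm l)) κnoMok).JLZResidualPoles (canon₁₉ νtop (Mok2015.LeafSupport.mkN (Mok2015.LeafSupport.cm l)) κnoMok).SchmidtParamodular (canon₂₀ νtop (Mok2015.LeafSupport.mkN (Mok2015.LeafSupport.cm l)) κnoMok).SchmidtCAP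 (canon₂₇ νtop (Mok2015.LeafSupport.mkN (Mok2015.LeafSupport.cm l)) κnoMok).BMN).BMaveraging ∧
      ((canon₈₄W νtop (canon₇₆ νtop (Mok2015.LeafSupport.mkN (Mok2015.LeafSupport.cm l)) κnoMok).JLZResidualPoles (canon₁₉ νtop (Mok2015.LeafSupport.mkN (Mok2015.LeafSupport.cm l)) κnoMok).SchmidtParamodular (canon₂₀ νtop (Mok2015.LeafSupport.mkN (Mok2015.LeafSupport.cm l)) κnoMok).SchmidtCAP (canon₂₇ νtop (Mok2015.LeafSupport.mkN (Mok2015.LeafSupport.cm l)) κnoMok).BMN).KalethaWhittaker ∧ (canon₈₄W νtop (canon₇₆ νtop (Mok2015.LeafSupport.mkN (Mok2015.LeafSupport.cm l)) κnoMok).JLZResidualPoles (canon₁₉ νtop (Mok2015.LeafSupport.mkN (Mok2015.LeafSupport.cm l)) κnoMok).SchmidtParamodular (canon₂₀ νtop (Mok2015.LeafSupport.mkN (Mok2015.LeafSupport.cm l)) κnoMok).SchmidtCAP (canon₂₇ νtop (Mok2015.LeafSupport.mkN (Mok2015.LeafSupport.cm l)) κnoMok).BMN).KalethaContragredient ∧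 (canon₈₄W νtop (canon₇₆ νtop (Mok2015.LeafSupport.mkN (Mok2015.LeafSupport.cm l)) κnoMok).JLZResidualPoles (canon₁₉ νtop (Mok2015.LeafSupport.mkN (Mok2015.LeafSupport.cm l)) κnoMok).SchmidtParamodular (canon₂₀ νtop (Mok2015.LeafSupport.mkN (Mok2015.LeafSupport.cm l)) κnoMok).SchmidtCAP (canon₂₇ νtop (Mok2015.LeafSupport.mkN (Mok2015.LeafSupport.cm l)) κnoMok).BMN).PPSRunipotent ∧ (canon₈₄W νtop (canon₇₆ νtop (Mok2015.LeafSupport.mkN (Mok2015.LeafSupport.cm l)) κnoMok).JLZResidualPoles (canon₁₉ νtop (Mok2015.LeafSupport.mkN (Mok2015.LeafSupport.cm l)) κnoMok).SchmidtParamodular (canon₂₀ νtop (Mok2015.LeafSupport.mkN (Mok2015.LeafSupport.cm l)) κnoMok).SchmidtCAP (canon₂₇ νtop (Mok2015.LeafSupport.mkN (Mok2015.LeafSupport.cm l)) κnoMok).BMN).PPSRgenuine ∧ (canon₈₄W νtop (canon₇₆ νtop (Mok2015.LeafSupport.mkN (Mok2015.LeafSupport.cm l)) κnoMok).JLZResidualPoles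 (canon₁₉ νtop (Mok2015.LeafSupport.mkN (Mok2015.LeafSupport.cm l)) κnoMok).SchmidtParamodular (canon₂₀ νtop (Mok2015.LeafSupport.mkN (Mok2015.LeafSupport.cm l)) κnoMok).SchmidtCAP (canon₂₇ νtop (Mok2015.LeafSupport.mkN (Mok2015.LeafSupport.cm l)) κnoMok).BMN).JLresidualFC ∧ (canon₈₄W νtop (canon₇₆ νtop (Mok2015.LeafSupport.mkN (Mok2015.LeafSupport.cm l)) κnoMok).JLZResidualPoles (canon₁₉ νtop (Mok2015.LeafSupport.mkN (Mok2015.LeafSupport.cm l)) κnoMok).SchmidtParamodular (canon₂₀ νtop (Mok2015.LeafSupport.mkN (Mok2015.LeafSupport.cm l)) κnoMok).SchmidtCAP (canon₂₇ νtop (Mok2015.LeafSupport.mkN (Mok2015.LeafSupport.cm l)) κnoMok).BMN).MokCuspidalDecomposition ∧ (canon₈₄W νtop (canon₇₆ νtop (Mok2015.LeafSupport.mkN (Mok2015.LeafSupport.cm l)) κnoMok).JLZResidualPoles (canon₁₉ νtop (Mok2015.LeafSupport.mkN (Mok2015.LeafSupport.cm l)) κnoMok).SchmidtParamodular (canon₂₀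 νtop (Mok2015.LeafSupport.mkN (Mok2015.LeafSupport.cm l)) κnoMok).SchmidtCAP (canon₂₇ νtop (Mok2015.LeafSupport.mkN (Mok2015.LeafSupport.cm l)) κnoMok).BMN).MokRStable ∧ (canon₈₄W νtop (canon₇₆ νtop (Mok2015.LeafSupport.mkN (Mok2015.LeafSupport.cm l)) κnoMok).JLZResidualPoles (canon₁₉ νtop (Mok2015.LeafSupport.mkN (Mok2015.LeafSupport.cm l)) κnoMok).SchmidtParamodular (canon₂₀ νtop (Mok2015.LeafSupport.mkN (Mok2015.LeafSupport.cm l)) κnoMok).SchmidtCAP (canon₂₇ νtop (Mok2015.LeafSupport.mkN (Mok2015.LeafSupport.cm l)) κnoMok).BMN).CLMspherical) :=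
  have cmod := Mok2015.LeafSupport.countermodel l
  have nm := not_M_cm l
  have b : ∀ N, νtop.Everything N := bookInputs_top.everything
  ⟨cmod.2.2.1, canon_implications₈₄W _ _ _ _ _, fun h => nm h.1, fun h => nm h.1,
    ⟨b, b, b, b, ⟨b, b⟩, b, ⟨b, b⟩, ⟨b, b, b, b⟩⟩⟩

/-- KMSW SIDE, AS TYPED: with the book AND Mok at the top but KMSW WITHOUT its Mok import (`κnoMok`: KMSW's edges, published leaves, weighted FL and both sequels
hold, its proved scope fails at every rank — `κnoMok_facts`), tranches 19, 20, 27, 76 read canonically, every edge valid: Bertoloni Meli's node and theorem FAIL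
(row A13 ⇐ KMSW's scope: « satisfies the properties of [KMSW] »), the eight book-side statements HOLD. [cite: BertoloniMeli2021Averaging, §1 p0004:L29; MeliNguyen2021, Thm 1.2 (separating model; bookkeeping proved here)] [claim: KalethaMinguezShinWhite2014, under-review] -/
theorem c84_kmsw_importDenied :
    Implications84 νtop (canon₁₉ νtop μtop κnoMok) (canon₂₀ νtop μtop κnoMok) (canon₂₇ νtop μtop κnoMok) (canon₇₆ νtop μtop κnoMok) (canon₈₄W νtop (canon₇₆ νtop μtop κnoMok).JLZResidualPoles (canon₁₉ νtop μtop κnoMok).SchmidtParamodular (canon₂₀ νtop μtop κnoMok).SchmidtCAP (canon₂₇ νtop μtop κnoMok).BMN) ∧ (∀ N, ¬ κnoMok.Scope N) ∧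
      ¬ (canon₈₄W νtop (canon₇₆ νtop μtop κnoMok).JLZResidualPoles (canon₁₉ νtop μtop κnoMok).SchmidtParamodular (canon₂₀ νtop μtop κnoMok).SchmidtCAP (canon₂₇ νtop μtop κnoMok).BMN).BMassumptions ∧ ¬ (canon₈₄W νtop (canon₇₆ νtop μtop κnoMok).JLZResidualPoles (canon₁₉ νtop μtop κnoMok).SchmidtParamodular (canon₂₀ νtop μtop κnoMok).SchmidtCAP (canon₂₇ νtop μtop κnoMok).BMN).BMaveraging ∧
      ((canon₈₄W νtop (canon₇₆ νtop μtop κnoMok).JLZResidualPoles (canon₁₉ νtop μtop κnoMok).SchmidtParamodular (canon₂₀ νtop μtop κnoMok).SchmidtCAP (canon₂₇ νtop μtop κnoMok).BMN).KalethaWhittaker ∧ (canon₈₄W νtop (canon₇₆ νtop μtop κnoMok).JLZResidualPoles (canon₁₉ νtop μtop κnoMok).SchmidtParamodular (canon₂₀ νtop μtop κnoMok).SchmidtCAP (canon₂₇ νtop μtop κnoMok).BMN).KalethaContragredient ∧ (canon₈₄W νtop (canon₇₆ νtop μtop κnoMok).JLZResidualPoles (canon₁₉ νtop μtop κnoMok).SchmidtParamodular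 (canon₂₀ νtop μtop κnoMok).SchmidtCAP (canon₂₇ νtop μtop κnoMok).BMN).PPSRunipotent ∧ (canon₈₄W νtop (canon₇₆ νtop μtop κnoMok).JLZResidualPoles (canon₁₉ νtop μtop κnoMok).SchmidtParamodular (canon₂₀ νtop μtop κnoMok).SchmidtCAP (canon₂₇ νtop μtop κnoMok).BMN).PPSRgenuine ∧ (canon₈₄W νtop (canon₇₆ νtop μtop κnoMok).JLZResidualPoles (canon₁₉ νtop μtop κnoMok).SchmidtParamodular (canon₂₀ νtop μtop κnoMok).SchmidtCAP (canon₂₇ νtop μtop κnoMok).BMN).JLresidualFC ∧ (canon₈₄W νtop (canon₇₆ νtop μtop κnoMok).JLZResidualPoles (canon₁₉ νtop μtop κnoMok).SchmidtParamodular (canon₂₀ νtop μtop κnoMok).SchmidtCAP (canon₂₇ νtop μtop κnoMok).BMN).MokCuspidalDecomposition ∧ (canon₈₄W νtop (canon₇₆ νtop μtop κnoMok).JLZResidualPoles (canon₁₉ νtop μtop κnoMok).SchmidtParamodular (canon₂₀ νtop μtop κnoMok).SchmidtCAP (canon₂₇ νtop μtop κnoMok).BMN).MokRStable ∧ (canon₈₄W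 νtop (canon₇₆ νtop μtop κnoMok).JLZResidualPoles (canon₁₉ νtop μtop κnoMok).SchmidtParamodular (canon₂₀ νtop μtop κnoMok).SchmidtCAP (canon₂₇ νtop μtop κnoMok).BMN).CLMspherical) :=
  have b : ∀ N, νtop.Everything N := bookInputs_top.everything
  have ns : ∀ N, ¬ κnoMok.Scope N := κnoMok_facts.2.2.2.2.2.1
  have nS : ¬ ∀ N, κnoMok.Scope N := fun h => ns 0 (h 0)
  ⟨canon_implications₈₄W _ _ _ _ _, ns, fun h => nS h.2, fun h => nS h.2,
    ⟨b, b, b, b, ⟨b, b⟩, b, ⟨b, b⟩, ⟨b, b, b, b⟩⟩⟩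

/-- THE EIGHTY-FOURTH TRANCHE REGRADED, in one statement: (i) at the top all ten hold; (ii) at the top with the row premises C179 / C180 / C182 denied, C213 and
C216 fail and the rest hold; (iii) in the book countermodel of any leaf the eight book-side statements fail and C214 holds; (iv) for every Mok countermodel (KMSW
without Mok, book at the top) C214 fails and the eight book-side statements hold; (v) with KMSW's Mok import denied (book, Mok at the top) C214 fails, the
rest hold. [cite: Kaletha2013Genericity, Thms 4.3, 5.9; PantanoPaulSalamancaRiba2014, Thm 6; JiangLiu2016ResidualFourier, Thm 2.1; BertoloniMeli2021Averaging, Thm 1.1; Mok2018WeakBeyondEndoscopy, Thm 4.4; ComtatLesesvreMan2025Kuznetsov, Prop. 2.1 (bookkeeping proved here)] [claim: KalethaMinguezShinWhite2014, under-review] -/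
theorem c84_regraded :
    ((canon₈₄W νtop (canon₇₆ νtop μtop κtop).JLZResidualPoles (canon₁₉ νtop μtop κtop).SchmidtParamodular (canon₂₀ νtop μtop κtop).SchmidtCAP (canon₂₇ νtop μtop κtop).BMN).KalethaWhittaker ∧ (canon₈₄W νtop (canon₇₆ νtop μtop κtop).JLZResidualPoles (canon₁₉ νtop μtop κtop).SchmidtParamodular (canon₂₀ νtop μtop κtop).SchmidtCAP (canon₂₇ νtop μtop κtop).BMN).KalethaContragredient ∧ (canon₈₄W νtop (canon₇₆ νtop μtop κtop).JLZResidualPoles (canon₁₉ νtop μtop κtop).SchmidtParamodular (canon₂₀ νtop μtop κtop).SchmidtCAP (canon₂₇ νtop μtop κtop).BMN).PPSRunipotent ∧ (canon₈₄W νtop (canon₇₆ νtop μtop κtop).JLZResidualPoles (canon₁₉ νtop μtop κtop).SchmidtParamodular (canon₂₀ νtop μtop κtop).SchmidtCAP (canon₂₇ νtop μtop κtop).BMN).PPSRgenuine ∧ (canon₈₄W νtop (canon₇₆ νtop μtop κtop).JLZResidualPoles (canon₁₉ νtop μtop κtop).SchmidtParamodular (canon₂₀ νtop μtop κtop).SchmidtCAP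 (canon₂₇ νtop μtop κtop).BMN).JLresidualFC ∧ (canon₈₄W νtop (canon₇₆ νtop μtop κtop).JLZResidualPoles (canon₁₉ νtop μtop κtop).SchmidtParamodular (canon₂₀ νtop μtop κtop).SchmidtCAP (canon₂₇ νtop μtop κtop).BMN).BMassumptions ∧ (canon₈₄W νtop (canon₇₆ νtop μtop κtop).JLZResidualPoles (canon₁₉ νtop μtop κtop).SchmidtParamodular (canon₂₀ νtop μtop κtop).SchmidtCAP (canon₂₇ νtop μtop κtop).BMN).BMaveraging ∧ (canon₈₄W νtop (canon₇₆ νtop μtop κtop).JLZResidualPoles (canon₁₉ νtop μtop κtop).SchmidtParamodular (canon₂₀ νtop μtop κtop).SchmidtCAP (canon₂₇ νtop μtop κtop).BMN).MokCuspidalDecomposition ∧ (canon₈₄W νtop (canon₇₆ νtop μtop κtop).JLZResidualPoles (canon₁₉ νtop μtop κtop).SchmidtParamodular (canon₂₀ νtop μtop κtop).SchmidtCAP (canon₂₇ νtop μtop κtop).BMN).MokRStable ∧ (canon₈₄W νtop (canon₇₆ νtop μtop κtop).JLZResidualPoles (canon₁₉ νtop μtop κtop).SchmidtParamodular (canon₂₀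 νtop μtop κtop).SchmidtCAP (canon₂₇ νtop μtop κtop).BMN).CLMspherical) ∧
      (¬ (canon₈₄W νtop False False False (canon₂₇ νtop μtop κtop).BMN).JLresidualFC ∧ ¬ (canon₈₄W νtop False False False (canon₂₇ νtop μtop κtop).BMN).CLMspherical ∧ (canon₈₄W νtop False False False (canon₂₇ νtop μtop κtop).BMN).KalethaWhittaker ∧ (canon₈₄W νtop False False False (canon₂₇ νtop μtop κtop).BMN).BMaveraging) ∧
      (∀ l : LeafSupport.Leaf, (¬ (LeafSupport.mkN (LeafSupport.cm l)).leaf l) ∧ ¬ (canon₈₄W (LeafSupport.mkN (LeafSupport.cm l)) (canon₇₆ (LeafSupport.mkN (LeafSupport.cm l)) μtop κtop).JLZResidualPoles (canon₁₉ (LeafSupport.mkN (LeafSupport.cm l)) μtop κtop).SchmidtParamodular (canon₂₀ (LeafSupport.mkN (LeafSupport.cm l)) μtop κtop).SchmidtCAP (canon₂₇ (LeafSupport.mkN (LeafSupport.cm l)) μtop κtop).BMN).KalethaContragredient ∧ ¬ (canon₈₄W (LeafSupport.mkN (LeafSupport.cm l)) (canon₇₆ (LeafSupport.mkN (LeafSupport.cm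 l)) μtop κtop).JLZResidualPoles (canon₁₉ (LeafSupport.mkN (LeafSupport.cm l)) μtop κtop).SchmidtParamodular (canon₂₀ (LeafSupport.mkN (LeafSupport.cm l)) μtop κtop).SchmidtCAP (canon₂₇ (LeafSupport.mkN (LeafSupport.cm l)) μtop κtop).BMN).PPSRgenuine ∧ ¬ (canon₈₄W (LeafSupport.mkN (LeafSupport.cm l)) (canon₇₆ (LeafSupport.mkN (LeafSupport.cm l)) μtop κtop).JLZResidualPoles (canon₁₉ (LeafSupport.mkN (LeafSupport.cm l)) μtop κtop).SchmidtParamodular (canon₂₀ (LeafSupport.mkN (LeafSupport.cm l)) μtop κtop).SchmidtCAP (canon₂₇ (LeafSupport.mkN (LeafSupport.cm l)) μtop κtop).BMN).JLresidualFC ∧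
        ¬ (canon₈₄W (LeafSupport.mkN (LeafSupport.cm l)) (canon₇₆ (LeafSupport.mkN (LeafSupport.cm l)) μtop κtop).JLZResidualPoles (canon₁₉ (LeafSupport.mkN (LeafSupport.cm l)) μtop κtop).SchmidtParamodular (canon₂₀ (LeafSupport.mkN (LeafSupport.cm l)) μtop κtop).SchmidtCAP (canon₂₇ (LeafSupport.mkN (LeafSupport.cm l)) μtop κtop).BMN).MokRStable ∧ ¬ (canon₈₄W (LeafSupport.mkN (LeafSupport.cm l)) (canon₇₆ (LeafSupport.mkN (LeafSupport.cm l)) μtop κtop).JLZResidualPoles (canon₁₉ (LeafSupport.mkN (LeafSupport.cm l)) μtop κtop).SchmidtParamodular (canon₂₀ (LeafSupport.mkN (LeafSupport.cm l)) μtop κtop).SchmidtCAP (canon₂₇ (LeafSupport.mkN (LeafSupport.cm l)) μtop κtop).BMN).CLMspherical ∧ (canon₈₄W (LeafSupport.mkN (LeafSupport.cm l)) (canon₇₆ (LeafSupport.mkN (LeafSupport.cm l)) μtop κtop).JLZResidualPoles (canon₁₉ (LeafSupport.mkN (LeafSupport.cm l)) μtop κtop).SchmidtParamodular (canon₂₀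 (LeafSupport.mkN (LeafSupport.cm l)) μtop κtop).SchmidtCAP (canon₂₇ (LeafSupport.mkN (LeafSupport.cm l)) μtop κtop).BMN).BMaveraging) ∧
      (∀ l : Mok2015.LeafSupport.Leaf, (¬ (Mok2015.LeafSupport.mkN (Mok2015.LeafSupport.cm l)).leaf l) ∧ ¬ (canon₈₄W νtop (canon₇₆ νtop (Mok2015.LeafSupport.mkN (Mok2015.LeafSupport.cm l)) κnoMok).JLZResidualPoles (canon₁₉ νtop (Mok2015.LeafSupport.mkN (Mok2015.LeafSupport.cm l)) κnoMok).SchmidtParamodular (canon₂₀ νtop (Mok2015.LeafSupport.mkN (Mok2015.LeafSupport.cm l)) κnoMok).SchmidtCAP (canon₂₇ νtop (Mok2015.LeafSupport.mkN (Mok2015.LeafSupport.cm l)) κnoMok).BMN).BMaveraging ∧ (canon₈₄W νtop (canon₇₆ νtop (Mok2015.LeafSupport.mkN (Mok2015.LeafSupport.cm l)) κnoMok).JLZResidualPoles (canon₁₉ νtop (Mok2015.LeafSupport.mkN (Mok2015.LeafSupport.cm l)) κnoMok).SchmidtParamodular (canon₂₀ νtop (Mok2015.LeafSupport.mkN (Mok2015.LeafSupport.cm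 l)) κnoMok).SchmidtCAP (canon₂₇ νtop (Mok2015.LeafSupport.mkN (Mok2015.LeafSupport.cm l)) κnoMok).BMN).KalethaContragredient ∧ (canon₈₄W νtop (canon₇₆ νtop (Mok2015.LeafSupport.mkN (Mok2015.LeafSupport.cm l)) κnoMok).JLZResidualPoles (canon₁₉ νtop (Mok2015.LeafSupport.mkN (Mok2015.LeafSupport.cm l)) κnoMok).SchmidtParamodular (canon₂₀ νtop (Mok2015.LeafSupport.mkN (Mok2015.LeafSupport.cm l)) κnoMok).SchmidtCAP (canon₂₇ νtop (Mok2015.LeafSupport.mkN (Mok2015.LeafSupport.cm l)) κnoMok).BMN).PPSRgenuine ∧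
        (canon₈₄W νtop (canon₇₆ νtop (Mok2015.LeafSupport.mkN (Mok2015.LeafSupport.cm l)) κnoMok).JLZResidualPoles (canon₁₉ νtop (Mok2015.LeafSupport.mkN (Mok2015.LeafSupport.cm l)) κnoMok).SchmidtParamodular (canon₂₀ νtop (Mok2015.LeafSupport.mkN (Mok2015.LeafSupport.cm l)) κnoMok).SchmidtCAP (canon₂₇ νtop (Mok2015.LeafSupport.mkN (Mok2015.LeafSupport.cm l)) κnoMok).BMN).JLresidualFC ∧ (canon₈₄W νtop (canon₇₆ νtop (Mok2015.LeafSupport.mkN (Mok2015.LeafSupport.cm l)) κnoMok).JLZResidualPoles (canon₁₉ νtop (Mok2015.LeafSupport.mkN (Mok2015.LeafSupport.cm l)) κnoMok).SchmidtParamodular (canon₂₀ νtop (Mok2015.LeafSupport.mkN (Mok2015.LeafSupport.cm l)) κnoMok).SchmidtCAP (canon₂₇ νtop (Mok2015.LeafSupport.mkN (Mok2015.LeafSupport.cm l)) κnoMok).BMN).MokRStable ∧ (canon₈₄W νtop (canon₇₆ νtop (Mok2015.LeafSupport.mkN (Mok2015.LeafSupport.cm l)) κnoMok).JLZResidualPoles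 (canon₁₉ νtop (Mok2015.LeafSupport.mkN (Mok2015.LeafSupport.cm l)) κnoMok).SchmidtParamodular (canon₂₀ νtop (Mok2015.LeafSupport.mkN (Mok2015.LeafSupport.cm l)) κnoMok).SchmidtCAP (canon₂₇ νtop (Mok2015.LeafSupport.mkN (Mok2015.LeafSupport.cm l)) κnoMok).BMN).CLMspherical) ∧
      (¬ (canon₈₄W νtop (canon₇₆ νtop μtop κnoMok).JLZResidualPoles (canon₁₉ νtop μtop κnoMok).SchmidtParamodular (canon₂₀ νtop μtop κnoMok).SchmidtCAP (canon₂₇ νtop μtop κnoMok).BMN).BMaveraging ∧ (canon₈₄W νtop (canon₇₆ νtop μtop κnoMok).JLZResidualPoles (canon₁₉ νtop μtop κnoMok).SchmidtParamodular (canon₂₀ νtop μtop κnoMok).SchmidtCAP (canon₂₇ νtop μtop κnoMok).BMN).PPSRgenuine ∧ (canon₈₄W νtop (canon₇₆ νtop μtop κnoMok).JLZResidualPoles (canon₁₉ νtop μtop κnoMok).SchmidtParamodular (canon₂₀ νtop μtop κnoMok).SchmidtCAP (canon₂₇ νtop μtop κnoMok).BMN).CLMspherical) :=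
  ⟨eightyfourth_holds_top,
    ⟨c84_rows_denied_top.2.2.2.2.2.1, c84_rows_denied_top.2.2.2.2.2.2.2.2.2.2, c84_rows_denied_top.2.1, c84_rows_denied_top.2.2.2.2.2.2.2.1⟩,
    fun l => have h := c84_book_cm l
      ⟨h.2.2.1, h.2.2.2.1.2.1, h.2.2.2.1.2.2.2.1, h.2.2.2.1.2.2.2.2.1, h.2.2.2.1.2.2.2.2.2.2.1, h.2.2.2.1.2.2.2.2.2.2.2, h.2.2.2.2.2⟩,
    fun l => have h := c84_mok_cm l
      ⟨h.1, h.2.2.2.1, h.2.2.2.2.2.1, h.2.2.2.2.2.2.2.1, h.2.2.2.2.2.2.2.2.1, h.2.2.2.2.2.2.2.2.2.2.1, h.2.2.2.2.2.2.2.2.2.2.2⟩,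
    ⟨c84_kmsw_importDenied.2.2.2.1, c84_kmsw_importDenied.2.2.2.2.2.2.2.1, c84_kmsw_importDenied.2.2.2.2.2.2.2.2.2.2.2⟩⟩

/-! ## 88. Eighty-fifth tranche (v2 of this file, after `Downstream24.lean` v1; unit `pub-arthur-down-g34`): supports of THE BOOK'S SERIES LINE, II — NEW rows
C217 `JLpartitionBound`, C218 `KretHypGSp` / `KretNewtonC` / `KretGSpin`, B124 `LeTwistedGGP`; see the module docstring for the summary. -/

section Canon85

variable (ν : Nodes) (μ : Mok2015.Nodes) (κ : KMSW2014.Nodes)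

/-- The parametrised canonical reading of the eighty-fifth tranche: `mr`, `cz` := the values of rows A8-p / A10 (the row premises of B124's edge); C217, C218 (three fields) := book; B124 := Mok ∧ KMSW's scope ∧ mr ∧ cz. [cite: JiangLiu2016AIF, §1; Kret2012PELNewton, Chapters 4–5; Le2025TwistedGGP, §2 (canonical model; bookkeeping)] [claim: KalethaMinguezShinWhite2014, under-review] -/
abbrev canon₈₅W (mr cz : Prop) : Consumers85 where
  JLpartitionBound := ∀ N, ν.Everything N
  KretHypGSp := ∀ N, ν.Everything N
  KretNewtonC := ∀ N, ν.Everything N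
  KretGSpin := ∀ N, ν.Everything N
  LeTwistedGGP := (∀ N, μ.Everything N) ∧ (∀ N, κ.Scope N) ∧ mr ∧ cz

/-- Row A10 DENIED (`ChenZouLLCU := False`; the two cases as in `canon₄₆`): a reading of `Consumers46` used only to deny B124's second row premise at the top; no forty-sixth-tranche edge is claimed for it. [cite: ChenZou2021LLCUnitary, Thm 2.5.1 (separating model; bookkeeping)] -/
abbrev c₄₆noA10 : Consumers46 := { canon₄₆ ν μ with ChenZouLLCU := False }

/-- Every eighty-fifth-tranche edge holds in the parametrised reading, for arbitrary ν, μ, κ and EVERY assignment of the thirteenth and forty-sixth tranches' fields. [cite: JiangLiu2016AIF, Thm 1.3; Kret2012PELNewton, Thms 32, 33, 35; Le2025TwistedGGP, Thm 1.2 (bookkeeping proved here)] [claim: KalethaMinguezShinWhite2014, under-review] -/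
theorem canon_implications₈₅W (c₁₃ : Consumers13) (c₄₆ : Consumers46) :
    Implications85 ν μ κ c₁₃ c₄₆ (canon₈₅W ν μ κ c₁₃.MRpadic c₄₆.ChenZouLLCU) where
  jlAIF := fun a => a
  kretHyp := fun a => a
  kretC := fun h => h
  kretSpin := fun a => a
  le := fun m s h8 h10 => ⟨m, s, h8, h10⟩

/-- In the parametrised reading all five statements hold as soon as the book's outputs hold at all ranks, Mok's outputs hold at all ranks, KMSW's scope holds at all
ranks and the two row premises hold — through the tranche's own bookkeeping theorems `bookRows85_of_book`, `le_of_rows`. [cite: JiangLiu2016AIF, Thm 1.3; Kret2012PELNewton, Thms 32, 33, 35; Le2025TwistedGGP, Thm 1.2 (bookkeeping proved here)] [claim: KalethaMinguezShinWhite2014, under-review] -/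
theorem c85_all_of (c₁₃ : Consumers13) (c₄₆ : Consumers46) (hν : ∀ N, ν.Everything N) (hμ : ∀ N, μ.Everything N) (hκ : ∀ N, κ.Scope N) (h8 : c₁₃.MRpadic)
    (h10 : c₄₆.ChenZouLLCU) : ((canon₈₅W ν μ κ c₁₃.MRpadic c₄₆.ChenZouLLCU).JLpartitionBound ∧ (canon₈₅W ν μ κ c₁₃.MRpadic c₄₆.ChenZouLLCU).KretHypGSp ∧ (canon₈₅W ν μ κ c₁₃.MRpadic c₄₆.ChenZouLLCU).KretNewtonC ∧ (canon₈₅W ν μ κ c₁₃.MRpadic c₄₆.ChenZouLLCU).KretGSpin ∧ (canon₈₅W ν μ κ c₁₃.MRpadic c₄₆.ChenZouLLCU).LeTwistedGGP) :=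
  have X := canon_implications₈₅W ν μ κ c₁₃ c₄₆
  have h := bookRows85_of_book X hν
  ⟨h.1, h.2.1, h.2.2.1, h.2.2.2, le_of_rows X hμ hκ h8 h10⟩

end Canon85

/-- At the top (every input of the three DAGs; tranches 13, 46 read canonically) all five statements of the tranche hold. [cite: JiangLiu2016AIF, Thm 1.3; Kret2012PELNewton, Thms 32, 33, 35; Le2025TwistedGGP, Thm 1.2 (bookkeeping proved here)] [claim: KalethaMinguezShinWhite2014, under-review] -/
theorem eightyfifth_holds_top : ((canon₈₅W νtop μtop κtop (canon₁₃ νtop κtop).MRpadic (canon₄₆ νtop μtop).ChenZouLLCU).JLpartitionBound ∧ (canon₈₅W νtop μtop κtop (canon₁₃ νtop κtop).MRpadic (canon₄₆ νtop μtop).ChenZouLLCU).KretHypGSp ∧ (canon₈₅W νtop μtop κtop (canon₁₃ νtop κtop).MRpadic (canon₄₆ νtop μtop).ChenZouLLCU).KretNewtonC ∧ (canon₈₅W νtop μtop κtop (canon₁₃ νtop κtop).MRpadic (canon₄₆ νtop μtop).ChenZouLLCU).KretGSpin ∧ (canon₈₅W νtop μtop κtop (canon₁₃ νtop κtop).MRpadic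 (canon₄₆ νtop μtop).ChenZouLLCU).LeTwistedGGP) :=
  have b : ∀ N, νtop.Everything N := bookInputs_top.everything
  have m : ∀ N, μtop.Everything N := mokInputs_top.everything
  have s : ∀ N, κtop.Scope N := (kmswInputs_top μtop).1.scope mokInputs_top
  c85_all_of νtop μtop κtop (canon₁₃ νtop κtop) (canon₄₆ νtop μtop) b m s thirteenth_holds_top.1.1 fortysixth_holds_top.2.2.1

/-- B124's TWO ROW PREMISES ARE LOAD-BEARING AS TYPED, JOINTLY AND EACH ALONE: at the top, (a) with rows A8-p (`c₁₃noA8p`) and A10 (`c₄₆noA10`) both DENIED every edge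
holds, B124 FAILS and the four book-side statements HOLD; (b) with A8-p alone denied (A10 canonical) every edge holds and B124 FAILS; (c) with A10 alone denied (A8-p
canonical) every edge holds and B124 FAILS. [cite: Le2025TwistedGGP, §2 p0021:L54 (« obtained in [Mok15,KMSW14,MR18,CZ21] ») (separating models; bookkeeping proved here)] [claim: KalethaMinguezShinWhite2014, under-review] -/
theorem c85_rows_denied_top :
    (Implications85 νtop μtop κtop c₁₃noA8p (c₄₆noA10 νtop μtop) (canon₈₅W νtop μtop κtop False False) ∧ ¬ (canon₈₅W νtop μtop κtop False False).LeTwistedGGP ∧ ((canon₈₅W νtop μtop κtop False False).JLpartitionBound ∧ (canon₈₅W νtop μtop κtop False False).KretHypGSp ∧ (canon₈₅W νtop μtop κtop False False).KretNewtonC ∧ (canon₈₅W νtop μtop κtop False False).KretGSpin)) ∧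
      (Implications85 νtop μtop κtop c₁₃noA8p (canon₄₆ νtop μtop) (canon₈₅W νtop μtop κtop False (canon₄₆ νtop μtop).ChenZouLLCU) ∧ ¬ (canon₈₅W νtop μtop κtop False (canon₄₆ νtop μtop).ChenZouLLCU).LeTwistedGGP) ∧
      (Implications85 νtop μtop κtop (canon₁₃ νtop κtop) (c₄₆noA10 νtop μtop) (canon₈₅W νtop μtop κtop (canon₁₃ νtop κtop).MRpadic False) ∧ ¬ (canon₈₅W νtop μtop κtop (canon₁₃ νtop κtop).MRpadic False).LeTwistedGGP) :=
  have b : ∀ N, νtop.Everything N := bookInputs_top.everything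
  ⟨⟨canon_implications₈₅W νtop μtop κtop c₁₃noA8p (c₄₆noA10 νtop μtop), fun h => h.2.2.1, ⟨b, b, b, b⟩⟩,
    ⟨canon_implications₈₅W νtop μtop κtop c₁₃noA8p (canon₄₆ νtop μtop), fun h => h.2.2.1⟩,
    ⟨canon_implications₈₅W νtop μtop κtop (canon₁₃ νtop κtop) (c₄₆noA10 νtop μtop), fun h => h.2.2.2⟩⟩

/-- BOOK SIDE, EXACT SUPPORT AS TYPED: in the book countermodel of ANY leaf `l` (Mok and KMSW at the top; tranches 13, 46 read canonically over the countermodel; every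
edge valid) ALL FIVE statements FAIL — Jiang – Liu's Theorem 1.3 and Kret's three statements directly, Le's Theorem 1.2 THROUGH ROW A8-p (the canonical `MRpadic`
carries the book at all ranks). [cite: JiangLiu2016AIF, §1 (« [Ar13] »); Kret2012PELNewton, Chapter 4 (« [arthurbook] »); Le2025TwistedGGP, §2 (« [MR18] »); MoeglinRenard2018, §3.1 (bookkeeping proved here)] [claim: KalethaMinguezShinWhite2014, under-review] -/
theorem c85_book_cm (l : LeafSupport.Leaf) :
    Implications85 (LeafSupport.mkN (LeafSupport.cm l)) μtop κtop (canon₁₃ (LeafSupport.mkN (LeafSupport.cm l)) κtop) (canon₄₆ (LeafSupport.mkN (LeafSupport.cm l)) μtop) (canon₈₅W (LeafSupport.mkN (LeafSupport.cm l)) μtop κtop (canon₁₃ (LeafSupport.mkN (LeafSupport.cm l)) κtop).MRpadic (canon₄₆ (LeafSupport.mkN (LeafSupport.cm l)) μtop).ChenZouLLCU) ∧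
      (∀ l', l' ≠ l → (LeafSupport.mkN (LeafSupport.cm l)).leaf l') ∧ ¬ (LeafSupport.mkN (LeafSupport.cm l)).leaf l ∧
      (¬ (canon₈₅W (LeafSupport.mkN (LeafSupport.cm l)) μtop κtop (canon₁₃ (LeafSupport.mkN (LeafSupport.cm l)) κtop).MRpadic (canon₄₆ (LeafSupport.mkN (LeafSupport.cm l)) μtop).ChenZouLLCU).JLpartitionBound ∧ ¬ (canon₈₅W (LeafSupport.mkN (LeafSupport.cm l)) μtop κtop (canon₁₃ (LeafSupport.mkN (LeafSupport.cm l)) κtop).MRpadic (canon₄₆ (LeafSupport.mkN (LeafSupport.cm l)) μtop).ChenZouLLCU).KretHypGSp ∧ ¬ (canon₈₅W (LeafSupport.mkN (LeafSupport.cm l)) μtop κtop (canon₁₃ (LeafSupport.mkN (LeafSupport.cm l)) κtop).MRpadic (canon₄₆ (LeafSupport.mkN (LeafSupport.cm l)) μtop).ChenZouLLCU).KretNewtonC ∧ ¬ (canon₈₅W (LeafSupport.mkN (LeafSupport.cm l)) μtop κtop (canon₁₃ (LeafSupport.mkN (LeafSupport.cm l)) κtop).MRpadic (canon₄₆ (LeafSupport.mkN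 (LeafSupport.cm l)) μtop).ChenZouLLCU).KretGSpin) ∧ ¬ (canon₈₅W (LeafSupport.mkN (LeafSupport.cm l)) μtop κtop (canon₁₃ (LeafSupport.mkN (LeafSupport.cm l)) κtop).MRpadic (canon₄₆ (LeafSupport.mkN (LeafSupport.cm l)) μtop).ChenZouLLCU).LeTwistedGGP :=
  have cmod := LeafSupport.countermodel l
  have nb := not_B_cm l
  ⟨canon_implications₈₅W _ _ _ _ _, cmod.2.1, cmod.2.2.1, ⟨nb, nb, nb, nb⟩, fun h => nb h.2.2.1.1⟩

/-- MOK SIDE, EXACT SUPPORT AS TYPED: with the book at the top, Mok read by the countermodel of ANY of its leaves and KMSW WITHOUT its Mok import (`κnoMok`), tranches 13,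
46 read canonically over these, every edge valid: Le's Theorem 1.2 FAILS (« [Mok15] » is load-bearing), the four book-side statements HOLD. [cite: Le2025TwistedGGP, §2 p0021:L54; Mok2012, Thm 2.5.1 (bookkeeping proved here)] [claim: KalethaMinguezShinWhite2014, under-review] -/
theorem c85_mok_cm (l : Mok2015.LeafSupport.Leaf) :
    ¬ (Mok2015.LeafSupport.mkN (Mok2015.LeafSupport.cm l)).leaf l ∧ Implications85 νtop (Mok2015.LeafSupport.mkN (Mok2015.LeafSupport.cm l)) κnoMok (canon₁₃ νtop κnoMok) (canon₄₆ νtop (Mok2015.LeafSupport.mkN (Mok2015.LeafSupport.cm l))) (canon₈₅W νtop (Mok2015.LeafSupport.mkN (Mok2015.LeafSupport.cm l)) κnoMok (canon₁₃ νtop κnoMok).MRpadic (canon₄₆ νtop (Mok2015.LeafSupport.mkN (Mok2015.LeafSupport.cm l))).ChenZouLLCU) ∧ ¬ (canon₈₅W νtop (Mok2015.LeafSupport.mkN (Mok2015.LeafSupport.cm l)) κnoMok (canon₁₃ νtop κnoMok).MRpadic (canon₄₆ νtop (Mok2015.LeafSupport.mkN (Mok2015.LeafSupport.cm l))).ChenZouLLCU).LeTwistedGGP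 ∧ ((canon₈₅W νtop (Mok2015.LeafSupport.mkN (Mok2015.LeafSupport.cm l)) κnoMok (canon₁₃ νtop κnoMok).MRpadic (canon₄₆ νtop (Mok2015.LeafSupport.mkN (Mok2015.LeafSupport.cm l))).ChenZouLLCU).JLpartitionBound ∧ (canon₈₅W νtop (Mok2015.LeafSupport.mkN (Mok2015.LeafSupport.cm l)) κnoMok (canon₁₃ νtop κnoMok).MRpadic (canon₄₆ νtop (Mok2015.LeafSupport.mkN (Mok2015.LeafSupport.cm l))).ChenZouLLCU).KretHypGSp ∧ (canon₈₅W νtop (Mok2015.LeafSupport.mkN (Mok2015.LeafSupport.cm l)) κnoMok (canon₁₃ νtop κnoMok).MRpadic (canon₄₆ νtop (Mok2015.LeafSupport.mkN (Mok2015.LeafSupport.cm l))).ChenZouLLCU).KretNewtonC ∧ (canon₈₅W νtop (Mok2015.LeafSupport.mkN (Mok2015.LeafSupport.cm l)) κnoMok (canon₁₃ νtop κnoMok).MRpadic (canon₄₆ νtop (Mok2015.LeafSupport.mkN (Mok2015.LeafSupport.cm l))).ChenZouLLCU).KretGSpin) :=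
  have cmod := Mok2015.LeafSupport.countermodel l
  have nm := not_M_cm l
  have b : ∀ N, νtop.Everything N := bookInputs_top.everything
  ⟨cmod.2.2.1, canon_implications₈₅W _ _ _ _ _, fun h => nm h.1, ⟨b, b, b, b⟩⟩

/-- KMSW SIDE, AS TYPED: with the book AND Mok at the top but KMSW WITHOUT its Mok import (`κnoMok`: KMSW's edges, published leaves, weighted FL and both sequels hold, its
proved scope fails at every rank — `κnoMok_facts`), tranches 13, 46 read canonically, every edge valid: Le's Theorem 1.2 FAILS (« [KMSW14] », the non-quasi-split U(V)),
the four book-side statements HOLD. [cite: Le2025TwistedGGP, §2 p0021:L54 (separating model; bookkeeping proved here)] [claim: KalethaMinguezShinWhite2014, under-review] -/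
theorem c85_kmsw_importDenied :
    Implications85 νtop μtop κnoMok (canon₁₃ νtop κnoMok) (canon₄₆ νtop μtop) (canon₈₅W νtop μtop κnoMok (canon₁₃ νtop κnoMok).MRpadic (canon₄₆ νtop μtop).ChenZouLLCU) ∧ (∀ N, ¬ κnoMok.Scope N) ∧ ¬ (canon₈₅W νtop μtop κnoMok (canon₁₃ νtop κnoMok).MRpadic (canon₄₆ νtop μtop).ChenZouLLCU).LeTwistedGGP ∧ ((canon₈₅W νtop μtop κnoMok (canon₁₃ νtop κnoMok).MRpadic (canon₄₆ νtop μtop).ChenZouLLCU).JLpartitionBound ∧ (canon₈₅W νtop μtop κnoMok (canon₁₃ νtop κnoMok).MRpadic (canon₄₆ νtop μtop).ChenZouLLCU).KretHypGSp ∧ (canon₈₅W νtop μtop κnoMok (canon₁₃ νtop κnoMok).MRpadic (canon₄₆ νtop μtop).ChenZouLLCU).KretNewtonC ∧ (canon₈₅W νtop μtop κnoMok (canon₁₃ νtop κnoMok).MRpadic (canon₄₆ νtop μtop).ChenZouLLCU).KretGSpin) :=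
  have b : ∀ N, νtop.Everything N := bookInputs_top.everything
  have ns : ∀ N, ¬ κnoMok.Scope N := κnoMok_facts.2.2.2.2.2.1
  ⟨canon_implications₈₅W _ _ _ _ _, ns, fun h => ns 0 (h.2.1 0), ⟨b, b, b, b⟩⟩

/-- THE EIGHTY-FIFTH TRANCHE REGRADED, in one statement: (i) at the top all five hold; (ii) at the top with B124's row premises denied (both, A8-p alone, A10 alone)
B124 fails while C217 and C218 hold; (iii) in the book countermodel of any leaf all five fail (B124 through A8-p); (iv) for every Mok countermodel (KMSW without Mok, book
at the top) B124 fails and the four book-side statements hold; (v) with KMSW's Mok import denied (book, Mok at the top) B124 fails, the rest hold. [cite: JiangLiu2016AIF, Thm 1.3; Kret2012PELNewton, Thms 32, 33, 35; Le2025TwistedGGP, Thm 1.2 (bookkeeping proved here)] [claim: KalethaMinguezShinWhite2014, under-review] -/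
theorem c85_regraded :
    ((canon₈₅W νtop μtop κtop (canon₁₃ νtop κtop).MRpadic (canon₄₆ νtop μtop).ChenZouLLCU).JLpartitionBound ∧ (canon₈₅W νtop μtop κtop (canon₁₃ νtop κtop).MRpadic (canon₄₆ νtop μtop).ChenZouLLCU).KretHypGSp ∧ (canon₈₅W νtop μtop κtop (canon₁₃ νtop κtop).MRpadic (canon₄₆ νtop μtop).ChenZouLLCU).KretNewtonC ∧ (canon₈₅W νtop μtop κtop (canon₁₃ νtop κtop).MRpadic (canon₄₆ νtop μtop).ChenZouLLCU).KretGSpin ∧ (canon₈₅W νtop μtop κtop (canon₁₃ νtop κtop).MRpadic (canon₄₆ νtop μtop).ChenZouLLCU).LeTwistedGGP) ∧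
      (¬ (canon₈₅W νtop μtop κtop False False).LeTwistedGGP ∧ ¬ (canon₈₅W νtop μtop κtop False (canon₄₆ νtop μtop).ChenZouLLCU).LeTwistedGGP ∧ ¬ (canon₈₅W νtop μtop κtop (canon₁₃ νtop κtop).MRpadic False).LeTwistedGGP ∧ (canon₈₅W νtop μtop κtop False False).JLpartitionBound ∧ (canon₈₅W νtop μtop κtop False False).KretNewtonC) ∧
      (∀ l : LeafSupport.Leaf, (¬ (LeafSupport.mkN (LeafSupport.cm l)).leaf l) ∧ ¬ (canon₈₅W (LeafSupport.mkN (LeafSupport.cm l)) μtop κtop (canon₁₃ (LeafSupport.mkN (LeafSupport.cm l)) κtop).MRpadic (canon₄₆ (LeafSupport.mkN (LeafSupport.cm l)) μtop).ChenZouLLCU).JLpartitionBound ∧ ¬ (canon₈₅W (LeafSupport.mkN (LeafSupport.cm l)) μtop κtop (canon₁₃ (LeafSupport.mkN (LeafSupport.cm l)) κtop).MRpadic (canon₄₆ (LeafSupport.mkN (LeafSupport.cm l)) μtop).ChenZouLLCU).KretHypGSp ∧ ¬ (canon₈₅W (LeafSupport.mkN (LeafSupport.cm l)) μtop κtop (canon₁₃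 (LeafSupport.mkN (LeafSupport.cm l)) κtop).MRpadic (canon₄₆ (LeafSupport.mkN (LeafSupport.cm l)) μtop).ChenZouLLCU).KretNewtonC ∧
        ¬ (canon₈₅W (LeafSupport.mkN (LeafSupport.cm l)) μtop κtop (canon₁₃ (LeafSupport.mkN (LeafSupport.cm l)) κtop).MRpadic (canon₄₆ (LeafSupport.mkN (LeafSupport.cm l)) μtop).ChenZouLLCU).KretGSpin ∧ ¬ (canon₈₅W (LeafSupport.mkN (LeafSupport.cm l)) μtop κtop (canon₁₃ (LeafSupport.mkN (LeafSupport.cm l)) κtop).MRpadic (canon₄₆ (LeafSupport.mkN (LeafSupport.cm l)) μtop).ChenZouLLCU).LeTwistedGGP) ∧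
      (∀ l : Mok2015.LeafSupport.Leaf, (¬ (Mok2015.LeafSupport.mkN (Mok2015.LeafSupport.cm l)).leaf l) ∧ ¬ (canon₈₅W νtop (Mok2015.LeafSupport.mkN (Mok2015.LeafSupport.cm l)) κnoMok (canon₁₃ νtop κnoMok).MRpadic (canon₄₆ νtop (Mok2015.LeafSupport.mkN (Mok2015.LeafSupport.cm l))).ChenZouLLCU).LeTwistedGGP ∧ (canon₈₅W νtop (Mok2015.LeafSupport.mkN (Mok2015.LeafSupport.cm l)) κnoMok (canon₁₃ νtop κnoMok).MRpadic (canon₄₆ νtop (Mok2015.LeafSupport.mkN (Mok2015.LeafSupport.cm l))).ChenZouLLCU).JLpartitionBound ∧ (canon₈₅W νtop (Mok2015.LeafSupport.mkN (Mok2015.LeafSupport.cm l)) κnoMok (canon₁₃ νtop κnoMok).MRpadic (canon₄₆ νtop (Mok2015.LeafSupport.mkN (Mok2015.LeafSupport.cm l))).ChenZouLLCU).KretNewtonC ∧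
        (canon₈₅W νtop (Mok2015.LeafSupport.mkN (Mok2015.LeafSupport.cm l)) κnoMok (canon₁₃ νtop κnoMok).MRpadic (canon₄₆ νtop (Mok2015.LeafSupport.mkN (Mok2015.LeafSupport.cm l))).ChenZouLLCU).KretGSpin) ∧
      (¬ (canon₈₅W νtop μtop κnoMok (canon₁₃ νtop κnoMok).MRpadic (canon₄₆ νtop μtop).ChenZouLLCU).LeTwistedGGP ∧ (canon₈₅W νtop μtop κnoMok (canon₁₃ νtop κnoMok).MRpadic (canon₄₆ νtop μtop).ChenZouLLCU).JLpartitionBound ∧ (canon₈₅W νtop μtop κnoMok (canon₁₃ νtop κnoMok).MRpadic (canon₄₆ νtop μtop).ChenZouLLCU).KretGSpin) :=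
  ⟨eightyfifth_holds_top,
    ⟨c85_rows_denied_top.1.2.1, c85_rows_denied_top.2.1.2, c85_rows_denied_top.2.2.2, c85_rows_denied_top.1.2.2.1, c85_rows_denied_top.1.2.2.2.2.1⟩,
    fun l => have h := c85_book_cm l
      ⟨h.2.2.1, h.2.2.2.1.1, h.2.2.2.1.2.1, h.2.2.2.1.2.2.1, h.2.2.2.1.2.2.2, h.2.2.2.2⟩,
    fun l => have h := c85_mok_cm l
      ⟨h.1, h.2.2.1, h.2.2.2.1, h.2.2.2.2.2.1, h.2.2.2.2.2.2⟩,
    ⟨c85_kmsw_importDenied.2.2.1, c85_kmsw_importDenied.2.2.2.1, c85_kmsw_importDenied.2.2.2.2.2.2⟩⟩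

/-! ## 89. Eighty-sixth tranche (v2 of this file, after `Downstream24.lean` v2; unit `pub-arthur-down-g34`): supports of THE BOOK'S SERIES LINE, III — NEW rows C219
`CohenStableDensity` (node, unsupplied) / `CohenOrbitalSpectral`, B125 `ShiMultiplicityOne` (node) / `ShiRegulator`; see the module docstring for the summary. -/

section Canon86

variable (ν : Nodes) (μ : Mok2015.Nodes) (κ : KMSW2014.Nodes)

/-- The parametrised canonical reading of the eighty-sixth tranche: `w` := the value of Cohen's unsupplied node, `lsz` := the value of row C110; C219's theorem := book ∧ w; B125's node and theorem := Mok ∧ lsz. [cite: Cohen2014OrbitalSpectral, §7; Shi2025PicardRegulators, §3 (canonical model; bookkeeping)] -/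
abbrev canon₈₆W (w lsz : Prop) : Consumers86 where
  CohenStableDensity := w
  CohenOrbitalSpectral := (∀ N, ν.Everything N) ∧ w
  ShiMultiplicityOne := (∀ N, μ.Everything N) ∧ lsz
  ShiRegulator := (∀ N, μ.Everything N) ∧ lsz

/-- Row C110 DENIED (`LSZEuler := False`; the four other twenty-fourth-tranche fields as in `canon₂₄`): a reading of `Consumers24` used only to deny B125's row premise at the top; no twenty-fourth-tranche edge is claimed for it. [cite: LoefflerSkinnerZerbes2021, Thm B (separating model; bookkeeping)] -/
abbrev c₂₄noC110 : Consumers24 := { canon₂₄ ν μ κ with LSZEuler := False }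

/-- Every eighty-sixth-tranche edge holds in the parametrised reading, for arbitrary ν, μ, EVERY assignment of the twenty-fourth tranche's fields and EVERY value of the node. [cite: Cohen2014OrbitalSpectral, Thm 7.9; Shi2025PicardRegulators, Thms 3.30, 4.16 (bookkeeping proved here)] -/
theorem canon_implications₈₆W (c₂₄ : Consumers24) (w : Prop) : Implications86 ν μ c₂₄ (canon₈₆W ν μ w c₂₄.LSZEuler) where
  cohen := fun a h => ⟨a, h⟩
  shiNode := fun m l => ⟨m, l⟩
  shi := fun h => h

/-- In the parametrised reading all four statements hold as soon as the book's and Mok's outputs hold at all ranks, the node holds and row C110 holds — through the tranche's own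
bookkeeping theorems `cohen_of_book_and_node`, `shi_of_mok_and_row`. [cite: Cohen2014OrbitalSpectral, Thm 7.9; Shi2025PicardRegulators, Thm 4.16 (bookkeeping proved here)] -/
theorem c86_all_of (c₂₄ : Consumers24) (w : Prop) (hν : ∀ N, ν.Everything N) (hμ : ∀ N, μ.Everything N) (hw : w) (hL : c₂₄.LSZEuler) :
    ((canon₈₆W ν μ w c₂₄.LSZEuler).CohenStableDensity ∧ (canon₈₆W ν μ w c₂₄.LSZEuler).CohenOrbitalSpectral ∧ (canon₈₆W ν μ w c₂₄.LSZEuler).ShiMultiplicityOne ∧ (canon₈₆W ν μ w c₂₄.LSZEuler).ShiRegulator) :=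
  have X := canon_implications₈₆W ν μ c₂₄ w
  have hS := shi_of_mok_and_row X hμ hL
  ⟨hw, cohen_of_book_and_node X hν hw, hS.1, hS.2⟩

end Canon86

/-- At the top (every input of the three DAGs; tranche 24 read canonically) WITH COHEN's NODE GRANTED all four statements of the tranche hold. [cite: Cohen2014OrbitalSpectral, Thm 7.9; Shi2025PicardRegulators, Thm 4.16 (bookkeeping proved here)] -/
theorem eightysixth_holds_top : ((canon₈₆W νtop μtop True (canon₂₄ νtop μtop κtop).LSZEuler).CohenStableDensity ∧ (canon₈₆W νtop μtop True (canon₂₄ νtop μtop κtop).LSZEuler).CohenOrbitalSpectral ∧ (canon₈₆W νtop μtop True (canon₂₄ νtop μtop κtop).LSZEuler).ShiMultiplicityOne ∧ (canon₈₆W νtop μtop True (canon₂₄ νtop μtop κtop).LSZEuler).ShiRegulator) :=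
  have b : ∀ N, νtop.Everything N := bookInputs_top.everything
  have m : ∀ N, μtop.Everything N := mokInputs_top.everything
  c86_all_of νtop μtop (canon₂₄ νtop μtop κtop) True b m True.intro twentyfourth_holds_top.2.2.2.1

/-- COHEN's UNSUPPLIED NODE IS LOAD-BEARING: at the top with the node DENIED every edge holds, Théorème 7.9 FAILS, Shi's node and theorem HOLD. [cite: Cohen2014OrbitalSpectral, §7 p0015:L46 (« communiqué par J.-L. Waldspurger ») (separating model; bookkeeping proved here)] -/
theorem c86_node_denied_top :
    Implications86 νtop μtop (canon₂₄ νtop μtop κtop) (canon₈₆W νtop μtop False (canon₂₄ νtop μtop κtop).LSZEuler) ∧ ¬ (canon₈₆W νtop μtop False (canon₂₄ νtop μtop κtop).LSZEuler).CohenStableDensity ∧ ¬ (canon₈₆W νtop μtop False (canon₂₄ νtop μtop κtop).LSZEuler).CohenOrbitalSpectral ∧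
      (canon₈₆W νtop μtop False (canon₂₄ νtop μtop κtop).LSZEuler).ShiMultiplicityOne ∧ (canon₈₆W νtop μtop False (canon₂₄ νtop μtop κtop).LSZEuler).ShiRegulator :=
  have m : ∀ N, μtop.Everything N := mokInputs_top.everything
  have l : (canon₂₄ νtop μtop κtop).LSZEuler := twentyfourth_holds_top.2.2.2.1
  ⟨canon_implications₈₆W νtop μtop (canon₂₄ νtop μtop κtop) False, fun h => h, fun h => h.2, ⟨m, l⟩, ⟨m, l⟩⟩

/-- ROW C110 IS LOAD-BEARING FOR B125 AS TYPED: at the top with row C110 DENIED (`c₂₄noC110`; node granted) every edge holds, Shi's node and theorem FAIL, Cohen's statements HOLD. [cite: Shi2025PicardRegulators, Thm 3.30 (« [LSZ22] ») (separating model; bookkeeping proved here)] -/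
theorem c86_row_denied_top :
    Implications86 νtop μtop (c₂₄noC110 νtop μtop κtop) (canon₈₆W νtop μtop True False) ∧ ¬ (canon₈₆W νtop μtop True False).ShiMultiplicityOne ∧ ¬ (canon₈₆W νtop μtop True False).ShiRegulator ∧
      (canon₈₆W νtop μtop True False).CohenStableDensity ∧ (canon₈₆W νtop μtop True False).CohenOrbitalSpectral :=
  have b : ∀ N, νtop.Everything N := bookInputs_top.everything
  ⟨canon_implications₈₆W νtop μtop (c₂₄noC110 νtop μtop κtop) True, fun h => h.2, fun h => h.2, True.intro, ⟨b, True.intro⟩⟩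

/-- BOOK SIDE, EXACT SUPPORT AS TYPED: in the book countermodel of ANY leaf `l` (node granted; Mok and KMSW at the top; tranche 24 read canonically over the countermodel; every edge valid)
Cohen's Théorème 7.9 FAILS while Shi's node and theorem HOLD (Mok only). [cite: Cohen2014OrbitalSpectral, §7 p0015:L27 (« Dans [Arthur] »); Shi2025PicardRegulators, Thm 3.30 (bookkeeping proved here)] -/
theorem c86_book_cm (l : LeafSupport.Leaf) :
    Implications86 (LeafSupport.mkN (LeafSupport.cm l)) μtop (canon₂₄ (LeafSupport.mkN (LeafSupport.cm l)) μtop κtop) (canon₈₆W (LeafSupport.mkN (LeafSupport.cm l)) μtop True (canon₂₄ (LeafSupport.mkN (LeafSupport.cm l)) μtop κtop).LSZEuler) ∧ (∀ l', l' ≠ l → (LeafSupport.mkN (LeafSupport.cm l)).leaf l') ∧ ¬ (LeafSupport.mkN (LeafSupport.cm l)).leaf l ∧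
      ¬ (canon₈₆W (LeafSupport.mkN (LeafSupport.cm l)) μtop True (canon₂₄ (LeafSupport.mkN (LeafSupport.cm l)) μtop κtop).LSZEuler).CohenOrbitalSpectral ∧ (canon₈₆W (LeafSupport.mkN (LeafSupport.cm l)) μtop True (canon₂₄ (LeafSupport.mkN (LeafSupport.cm l)) μtop κtop).LSZEuler).ShiMultiplicityOne ∧ (canon₈₆W (LeafSupport.mkN (LeafSupport.cm l)) μtop True (canon₂₄ (LeafSupport.mkN (LeafSupport.cm l)) μtop κtop).LSZEuler).ShiRegulator :=
  have cmod := LeafSupport.countermodel l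
  have nb := not_B_cm l
  have m : ∀ N, μtop.Everything N := mokInputs_top.everything
  ⟨canon_implications₈₆W _ _ _ _, cmod.2.1, cmod.2.2.1, fun h => nb h.1, ⟨m, m⟩, ⟨m, m⟩⟩

/-- MOK SIDE, EXACT SUPPORT AS TYPED: with the book at the top, Mok read by the countermodel of ANY of its leaves and KMSW WITHOUT its Mok import (`κnoMok`), node granted, tranche 24
read canonically, every edge valid: Shi's node and theorem FAIL (« [Mok15] » — directly and through C110), Cohen's theorem HOLDS. [cite: Shi2025PicardRegulators, Thm 3.30; Mok2012, Thm 2.5.2 (bookkeeping proved here)] -/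
theorem c86_mok_cm (l : Mok2015.LeafSupport.Leaf) :
    ¬ (Mok2015.LeafSupport.mkN (Mok2015.LeafSupport.cm l)).leaf l ∧ Implications86 νtop (Mok2015.LeafSupport.mkN (Mok2015.LeafSupport.cm l)) (canon₂₄ νtop (Mok2015.LeafSupport.mkN (Mok2015.LeafSupport.cm l)) κnoMok) (canon₈₆W νtop (Mok2015.LeafSupport.mkN (Mok2015.LeafSupport.cm l)) True (canon₂₄ νtop (Mok2015.LeafSupport.mkN (Mok2015.LeafSupport.cm l)) κnoMok).LSZEuler) ∧ ¬ (canon₈₆W νtop (Mok2015.LeafSupport.mkN (Mok2015.LeafSupport.cm l)) True (canon₂₄ νtop (Mok2015.LeafSupport.mkN (Mok2015.LeafSupport.cm l)) κnoMok).LSZEuler).ShiMultiplicityOne ∧ ¬ (canon₈₆W νtop (Mok2015.LeafSupport.mkN (Mok2015.LeafSupport.cm l)) True (canon₂₄ νtop (Mok2015.LeafSupport.mkN (Mok2015.LeafSupport.cm l)) κnoMok).LSZEuler).ShiRegulator ∧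
      (canon₈₆W νtop (Mok2015.LeafSupport.mkN (Mok2015.LeafSupport.cm l)) True (canon₂₄ νtop (Mok2015.LeafSupport.mkN (Mok2015.LeafSupport.cm l)) κnoMok).LSZEuler).CohenOrbitalSpectral :=
  have cmod := Mok2015.LeafSupport.countermodel l
  have nm := not_M_cm l
  have b : ∀ N, νtop.Everything N := bookInputs_top.everything
  ⟨cmod.2.2.1, canon_implications₈₆W _ _ _ _, fun h => nm h.1, fun h => nm h.1, ⟨b, True.intro⟩⟩

/-- KMSW SIDE: with the book AND Mok at the top but KMSW WITHOUT its Mok import (`κnoMok`), node granted, every edge valid: ALL FOUR statements HOLD — neither row's typed support meets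
KMSW. [cite: Cohen2014OrbitalSpectral, Thm 7.9; Shi2025PicardRegulators, Thm 4.16 (bookkeeping proved here)] -/
theorem c86_kmsw_importDenied : Implications86 νtop μtop (canon₂₄ νtop μtop κnoMok) (canon₈₆W νtop μtop True (canon₂₄ νtop μtop κnoMok).LSZEuler) ∧ ((canon₈₆W νtop μtop True (canon₂₄ νtop μtop κnoMok).LSZEuler).CohenStableDensity ∧ (canon₈₆W νtop μtop True (canon₂₄ νtop μtop κnoMok).LSZEuler).CohenOrbitalSpectral ∧ (canon₈₆W νtop μtop True (canon₂₄ νtop μtop κnoMok).LSZEuler).ShiMultiplicityOne ∧ (canon₈₆W νtop μtop True (canon₂₄ νtop μtop κnoMok).LSZEuler).ShiRegulator) :=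
  have b : ∀ N, νtop.Everything N := bookInputs_top.everything
  have m : ∀ N, μtop.Everything N := mokInputs_top.everything
  ⟨canon_implications₈₆W _ _ _ _, c86_all_of νtop μtop (canon₂₄ νtop μtop κnoMok) True b m True.intro m⟩

/-- THE EIGHTY-SIXTH TRANCHE REGRADED, in one statement: (i) at the top with the node granted all four hold; (ii) node denied: Cohen's theorem fails, Shi's hold; (iii) row C110 denied:
Shi's fail, Cohen's hold; (iv) in the book countermodel of any leaf Cohen's theorem fails and Shi's hold; (v) for every Mok countermodel Shi's fail and Cohen's theorem holds; (vi) with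
KMSW's Mok import denied all four hold. [cite: Cohen2014OrbitalSpectral, Thm 7.9; Shi2025PicardRegulators, Thms 3.30, 4.16 (bookkeeping proved here)] -/
theorem c86_regraded :
    ((canon₈₆W νtop μtop True (canon₂₄ νtop μtop κtop).LSZEuler).CohenStableDensity ∧ (canon₈₆W νtop μtop True (canon₂₄ νtop μtop κtop).LSZEuler).CohenOrbitalSpectral ∧ (canon₈₆W νtop μtop True (canon₂₄ νtop μtop κtop).LSZEuler).ShiMultiplicityOne ∧ (canon₈₆W νtop μtop True (canon₂₄ νtop μtop κtop).LSZEuler).ShiRegulator) ∧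
      (¬ (canon₈₆W νtop μtop False (canon₂₄ νtop μtop κtop).LSZEuler).CohenOrbitalSpectral ∧ (canon₈₆W νtop μtop False (canon₂₄ νtop μtop κtop).LSZEuler).ShiRegulator) ∧
      (¬ (canon₈₆W νtop μtop True False).ShiRegulator ∧ (canon₈₆W νtop μtop True False).CohenOrbitalSpectral) ∧
      (∀ l : LeafSupport.Leaf, (¬ (LeafSupport.mkN (LeafSupport.cm l)).leaf l) ∧ ¬ (canon₈₆W (LeafSupport.mkN (LeafSupport.cm l)) μtop True (canon₂₄ (LeafSupport.mkN (LeafSupport.cm l)) μtop κtop).LSZEuler).CohenOrbitalSpectral ∧ (canon₈₆W (LeafSupport.mkN (LeafSupport.cm l)) μtop True (canon₂₄ (LeafSupport.mkN (LeafSupport.cm l)) μtop κtop).LSZEuler).ShiRegulator) ∧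
      (∀ l : Mok2015.LeafSupport.Leaf, (¬ (Mok2015.LeafSupport.mkN (Mok2015.LeafSupport.cm l)).leaf l) ∧ ¬ (canon₈₆W νtop (Mok2015.LeafSupport.mkN (Mok2015.LeafSupport.cm l)) True (canon₂₄ νtop (Mok2015.LeafSupport.mkN (Mok2015.LeafSupport.cm l)) κnoMok).LSZEuler).ShiRegulator ∧ (canon₈₆W νtop (Mok2015.LeafSupport.mkN (Mok2015.LeafSupport.cm l)) True (canon₂₄ νtop (Mok2015.LeafSupport.mkN (Mok2015.LeafSupport.cm l)) κnoMok).LSZEuler).CohenOrbitalSpectral) ∧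
      ((canon₈₆W νtop μtop True (canon₂₄ νtop μtop κnoMok).LSZEuler).CohenStableDensity ∧ (canon₈₆W νtop μtop True (canon₂₄ νtop μtop κnoMok).LSZEuler).CohenOrbitalSpectral ∧ (canon₈₆W νtop μtop True (canon₂₄ νtop μtop κnoMok).LSZEuler).ShiMultiplicityOne ∧ (canon₈₆W νtop μtop True (canon₂₄ νtop μtop κnoMok).LSZEuler).ShiRegulator) :=
  ⟨eightysixth_holds_top,
    ⟨c86_node_denied_top.2.2.1, c86_node_denied_top.2.2.2.2⟩,
    ⟨c86_row_denied_top.2.2.1, c86_row_denied_top.2.2.2.2⟩,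
    fun l => have h := c86_book_cm l
      ⟨h.2.2.1, h.2.2.2.1, h.2.2.2.2.2⟩,
    fun l => have h := c86_mok_cm l
      ⟨h.1, h.2.2.2.1, h.2.2.2.2⟩,
    c86_kmsw_importDenied.2⟩

/-! ## 90. Eighty-seventh tranche (v3 of this file, after `Downstream24.lean` v3; unit `pub-arthur-down-g35`): supports of THE CITATION GRAPH, I — NEW rows C220
`STfiniteness` / `STgrowth` / `STunitaryGrowth` (premise-free), C221 `ChenRSGL2` / `ChenBlasius` / `ChenDeligneSym`, C222 `ChenSelfDualExistence` / `ChenBWduality` / `ChenBWratios`;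
see the module docstring for the summary. -/

section Canon87

variable (ν : Nodes) (μ : Mok2015.Nodes) (κ : KMSW2014.Nodes)

/-- The parametrised canonical reading of the eighty-seventh tranche: `hll` := the value of row B101 (the row premise of C222's first edge); C220's two classical theorems := book ∧ Mok, its control := True; C221's Theorems 5.5 / B := KMSW's scope, its Theorem A := book; C222's three statements := book ∧ hll. [cite: ShinTemplier2014Fields, §§5–6; Chen2026RatiosDeligne, §5; Chen2024BettiWhittaker, §4 (canonical model; bookkeeping)] [claim: KalethaMinguezShinWhite2014, under-review] -/
abbrev canon₈₇W (hll : Prop) : Consumers87 where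
  STfiniteness := (∀ N, ν.Everything N) ∧ (∀ N, μ.Everything N)
  STgrowth := (∀ N, ν.Everything N) ∧ (∀ N, μ.Everything N)
  STunitaryGrowth := True
  ChenRSGL2 := ∀ N, κ.Scope N
  ChenBlasius := ∀ N, κ.Scope N
  ChenDeligneSym := ∀ N, ν.Everything N
  ChenSelfDualExistence := (∀ N, ν.Everything N) ∧ hll
  ChenBWduality := (∀ N, ν.Everything N) ∧ hll
  ChenBWratios := (∀ N, ν.Everything N) ∧ hll

/-- Every eighty-seventh-tranche edge holds in the parametrised reading, for arbitrary ν, μ, κ and EVERY assignment of the twenty-sixth tranche's fields (the parameter read off its `HLL`). [cite: ShinTemplier2014Fields, Thms 5.19, 6.1, 6.6, 6.17; Chen2026RatiosDeligne, Thms 5.5, 5.7, 5.9; Chen2024BettiWhittaker, Lemma 4.5, Thms 4.7, 4.10 (bookkeeping proved here)] [claim: KalethaMinguezShinWhite2014, under-review] -/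
theorem canon_implications₈₇W (c₂₆ : Consumers26) : Implications87 ν μ κ c₂₆ (canon₈₇W ν μ κ c₂₆.HLL) where
  stFin := fun a m => ⟨a, m⟩
  stGrowth := fun a m => ⟨a, m⟩
  stUnitary := True.intro
  chenRS := fun s => s
  chenBlasius := fun h => h
  chenSym := fun a => a
  chenSelfDual := fun a h => ⟨a, h⟩
  chenBW := fun h => h
  chenRatios := fun h => h

/-- In the parametrised reading all nine statements hold as soon as the book's and Mok's outputs hold at all ranks, KMSW's scope holds at all ranks and row B101 holds —
through the tranche's own bookkeeping theorems `st_of_book_and_mok`, `stUnitary_inherits_nothing`, `chenRS_of_kmsw`, `chenSym_of_book`, `chenBW_of_book_and_row`. [cite: ShinTemplier2014Fields, Thm 5.19; Chen2026RatiosDeligne, Thms 5.5, 5.9; Chen2024BettiWhittaker, Thm 4.10 (bookkeeping proved here)] [claim: KalethaMinguezShinWhite2014, under-review] -/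
theorem c87_all_of (c₂₆ : Consumers26) (hν : ∀ N, ν.Everything N) (hμ : ∀ N, μ.Everything N) (hκ : ∀ N, κ.Scope N) (hH : c₂₆.HLL) :
    ((canon₈₇W ν μ κ c₂₆.HLL).STfiniteness ∧ (canon₈₇W ν μ κ c₂₆.HLL).STgrowth ∧ (canon₈₇W ν μ κ c₂₆.HLL).STunitaryGrowth ∧ (canon₈₇W ν μ κ c₂₆.HLL).ChenRSGL2 ∧ (canon₈₇W ν μ κ c₂₆.HLL).ChenBlasius ∧ (canon₈₇W ν μ κ c₂₆.HLL).ChenDeligneSym ∧ (canon₈₇W ν μ κ c₂₆.HLL).ChenSelfDualExistence ∧ (canon₈₇W ν μ κ c₂₆.HLL).ChenBWduality ∧ (canon₈₇W ν μ κ c₂₆.HLL).ChenBWratios) :=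
  have X := canon_implications₈₇W ν μ κ c₂₆
  have hS := st_of_book_and_mok X hν hμ
  have hR := chenRS_of_kmsw X hκ
  have hB := chenBW_of_book_and_row X hν hH
  ⟨hS.1, hS.2, stUnitary_inherits_nothing X, hR.1, hR.2, chenSym_of_book X hν, hB.1, hB.2.1, hB.2.2⟩

end Canon87

/-- At the top (every input of the three DAGs; tranche 26 read canonically, `canon₂₆` of §29) all nine statements of the tranche hold. [cite: ShinTemplier2014Fields, Thms 5.19, 6.6, 6.17; Chen2026RatiosDeligne, Thms 5.5, 5.7, 5.9; Chen2024BettiWhittaker, Thms 4.7, 4.10 (bookkeeping proved here)] [claim: KalethaMinguezShinWhite2014, under-review] -/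
theorem eightyseventh_holds_top : ((canon₈₇W νtop μtop κtop (canon₂₆ νtop μtop κtop).HLL).STfiniteness ∧ (canon₈₇W νtop μtop κtop (canon₂₆ νtop μtop κtop).HLL).STgrowth ∧ (canon₈₇W νtop μtop κtop (canon₂₆ νtop μtop κtop).HLL).STunitaryGrowth ∧ (canon₈₇W νtop μtop κtop (canon₂₆ νtop μtop κtop).HLL).ChenRSGL2 ∧ (canon₈₇W νtop μtop κtop (canon₂₆ νtop μtop κtop).HLL).ChenBlasius ∧ (canon₈₇W νtop μtop κtop (canon₂₆ νtop μtop κtop).HLL).ChenDeligneSym ∧ (canon₈₇W νtop μtop κtop (canon₂₆ νtop μtop κtop).HLL).ChenSelfDualExistence ∧ (canon₈₇W νtop μtop κtop (canon₂₆ νtop μtop κtop).HLL).ChenBWduality ∧ (canon₈₇W νtop μtop κtop (canon₂₆ νtop μtop κtop).HLL).ChenBWratios) :=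
  have b : ∀ N, νtop.Everything N := bookInputs_top.everything
  have m : ∀ N, μtop.Everything N := mokInputs_top.everything
  have s : ∀ N, κtop.Scope N := (kmswInputs_top μtop).1.scope mokInputs_top
  c87_all_of νtop μtop κtop (canon₂₆ νtop μtop κtop) b m s twentysixth_holds_top.1.2.1

/-- ROW B101 IS LOAD-BEARING FOR C222 AS TYPED: at the top with row B101 DENIED (§29's `canon₂₆noB101`: `HLL := False`) every edge holds, Chen's Lemma 4.5 and Theorems 1.1 / 1.5
FAIL, the six statements of C220 / C221 HOLD. [cite: Chen2024BettiWhittaker, Lemma 4.5, proof p0016:L37 (« [HLL2022] ») (separating model; bookkeeping proved here)] [claim: KalethaMinguezShinWhite2014, under-review] -/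
theorem c87_row_denied_top :
    Implications87 νtop μtop κtop (canon₂₆noB101 νtop μtop κtop) (canon₈₇W νtop μtop κtop False) ∧ (¬ (canon₈₇W νtop μtop κtop False).ChenSelfDualExistence ∧ ¬ (canon₈₇W νtop μtop κtop False).ChenBWduality ∧ ¬ (canon₈₇W νtop μtop κtop False).ChenBWratios) ∧
      ((canon₈₇W νtop μtop κtop False).STfiniteness ∧ (canon₈₇W νtop μtop κtop False).STgrowth ∧ (canon₈₇W νtop μtop κtop False).STunitaryGrowth ∧ (canon₈₇W νtop μtop κtop False).ChenRSGL2 ∧ (canon₈₇W νtop μtop κtop False).ChenBlasius ∧ (canon₈₇W νtop μtop κtop False).ChenDeligneSym) :=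
  have b : ∀ N, νtop.Everything N := bookInputs_top.everything
  have m : ∀ N, μtop.Everything N := mokInputs_top.everything
  have s : ∀ N, κtop.Scope N := (kmswInputs_top μtop).1.scope mokInputs_top
  ⟨canon_implications₈₇W νtop μtop κtop (canon₂₆noB101 νtop μtop κtop), ⟨fun h => h.2, fun h => h.2, fun h => h.2⟩, ⟨⟨b, m⟩, ⟨b, m⟩, True.intro, s, s, b⟩⟩

/-- BOOK SIDE, EXACT SUPPORT AS TYPED: in the book countermodel of ANY leaf `l` (Mok and KMSW at the top; tranche 26 read canonically over the countermodel; every edge valid)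
Shin – Templier's Theorems 5.19 / 6.1 / 6.6, Chen's Theorem A and Chen's Lemma 4.5 / Theorems 1.1 / 1.5 FAIL, while Shin – Templier's Theorem 6.17 (the control) and Chen's
Theorems 5.5 / B (KMSW's scope) HOLD. [cite: ShinTemplier2014Fields, Hyp. 4.8 (« [Arthur] »); Chen2026RatiosDeligne, Lemma 5.18 (« [Arthur2013] »); Chen2024BettiWhittaker, Lemma 4.5 (« [Arthur2013] ») (bookkeeping proved here)] [claim: KalethaMinguezShinWhite2014, under-review] -/
theorem c87_book_cm (l : LeafSupport.Leaf) :
    Implications87 (LeafSupport.mkN (LeafSupport.cm l)) μtop κtop (canon₂₆ (LeafSupport.mkN (LeafSupport.cm l)) μtop κtop) (canon₈₇W (LeafSupport.mkN (LeafSupport.cm l)) μtop κtop (canon₂₆ (LeafSupport.mkN (LeafSupport.cm l)) μtop κtop).HLL) ∧ (∀ l', l' ≠ l → (LeafSupport.mkN (LeafSupport.cm l)).leaf l') ∧ ¬ (LeafSupport.mkN (LeafSupport.cm l)).leaf l ∧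
      (¬ (canon₈₇W (LeafSupport.mkN (LeafSupport.cm l)) μtop κtop (canon₂₆ (LeafSupport.mkN (LeafSupport.cm l)) μtop κtop).HLL).STfiniteness ∧ ¬ (canon₈₇W (LeafSupport.mkN (LeafSupport.cm l)) μtop κtop (canon₂₆ (LeafSupport.mkN (LeafSupport.cm l)) μtop κtop).HLL).STgrowth ∧ ¬ (canon₈₇W (LeafSupport.mkN (LeafSupport.cm l)) μtop κtop (canon₂₆ (LeafSupport.mkN (LeafSupport.cm l)) μtop κtop).HLL).ChenDeligneSym ∧ ¬ (canon₈₇W (LeafSupport.mkN (LeafSupport.cm l)) μtop κtop (canon₂₆ (LeafSupport.mkN (LeafSupport.cm l)) μtop κtop).HLL).ChenSelfDualExistence ∧ ¬ (canon₈₇W (LeafSupport.mkN (LeafSupport.cm l)) μtop κtop (canon₂₆ (LeafSupport.mkN (LeafSupport.cm l)) μtop κtop).HLL).ChenBWduality ∧ ¬ (canon₈₇W (LeafSupport.mkN (LeafSupport.cm l)) μtop κtop (canon₂₆ (LeafSupport.mkN (LeafSupport.cm l)) μtop κtop).HLL).ChenBWratios) ∧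
      ((canon₈₇W (LeafSupport.mkN (LeafSupport.cm l)) μtop κtop (canon₂₆ (LeafSupport.mkN (LeafSupport.cm l)) μtop κtop).HLL).STunitaryGrowth ∧ (canon₈₇W (LeafSupport.mkN (LeafSupport.cm l)) μtop κtop (canon₂₆ (LeafSupport.mkN (LeafSupport.cm l)) μtop κtop).HLL).ChenRSGL2 ∧ (canon₈₇W (LeafSupport.mkN (LeafSupport.cm l)) μtop κtop (canon₂₆ (LeafSupport.mkN (LeafSupport.cm l)) μtop κtop).HLL).ChenBlasius) :=
  have cmod := LeafSupport.countermodel l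
  have nb := not_B_cm l
  have s : ∀ N, κtop.Scope N := (kmswInputs_top μtop).1.scope mokInputs_top
  ⟨canon_implications₈₇W _ _ _ _, cmod.2.1, cmod.2.2.1,
    ⟨fun h => nb h.1, fun h => nb h.1, nb, fun h => nb h.1, fun h => nb h.1, fun h => nb h.1⟩, ⟨True.intro, s, s⟩⟩

/-- MOK SIDE, EXACT SUPPORT AS TYPED: with the book at the top, Mok read by the countermodel of ANY of its leaves and KMSW WITHOUT its Mok import (`κnoMok`), tranche 26 read
canonically over these, every edge valid: Shin – Templier's two classical theorems FAIL (« [Mok] », case (iii)) and Chen's Theorems 5.5 / B FAIL (KMSW's scope is read without the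
imported Mok theorems), while the control, Chen's Theorem A and C222's three statements HOLD (book only). [cite: ShinTemplier2014Fields, Hyp. 4.8 (« cf. [Mok] »); Chen2026RatiosDeligne, Rem. 5.3; Mok2012, Thms 2.5.1, 3.2.1 (bookkeeping proved here)] [claim: KalethaMinguezShinWhite2014, under-review] -/
theorem c87_mok_cm (l : Mok2015.LeafSupport.Leaf) :
    ¬ (Mok2015.LeafSupport.mkN (Mok2015.LeafSupport.cm l)).leaf l ∧ Implications87 νtop (Mok2015.LeafSupport.mkN (Mok2015.LeafSupport.cm l)) κnoMok (canon₂₆ νtop (Mok2015.LeafSupport.mkN (Mok2015.LeafSupport.cm l)) κnoMok) (canon₈₇W νtop (Mok2015.LeafSupport.mkN (Mok2015.LeafSupport.cm l)) κnoMok (canon₂₆ νtop (Mok2015.LeafSupport.mkN (Mok2015.LeafSupport.cm l)) κnoMok).HLL) ∧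
      (¬ (canon₈₇W νtop (Mok2015.LeafSupport.mkN (Mok2015.LeafSupport.cm l)) κnoMok (canon₂₆ νtop (Mok2015.LeafSupport.mkN (Mok2015.LeafSupport.cm l)) κnoMok).HLL).STfiniteness ∧ ¬ (canon₈₇W νtop (Mok2015.LeafSupport.mkN (Mok2015.LeafSupport.cm l)) κnoMok (canon₂₆ νtop (Mok2015.LeafSupport.mkN (Mok2015.LeafSupport.cm l)) κnoMok).HLL).STgrowth ∧ ¬ (canon₈₇W νtop (Mok2015.LeafSupport.mkN (Mok2015.LeafSupport.cm l)) κnoMok (canon₂₆ νtop (Mok2015.LeafSupport.mkN (Mok2015.LeafSupport.cm l)) κnoMok).HLL).ChenRSGL2 ∧ ¬ (canon₈₇W νtop (Mok2015.LeafSupport.mkN (Mok2015.LeafSupport.cm l)) κnoMok (canon₂₆ νtop (Mok2015.LeafSupport.mkN (Mok2015.LeafSupport.cm l)) κnoMok).HLL).ChenBlasius) ∧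
      ((canon₈₇W νtop (Mok2015.LeafSupport.mkN (Mok2015.LeafSupport.cm l)) κnoMok (canon₂₆ νtop (Mok2015.LeafSupport.mkN (Mok2015.LeafSupport.cm l)) κnoMok).HLL).STunitaryGrowth ∧ (canon₈₇W νtop (Mok2015.LeafSupport.mkN (Mok2015.LeafSupport.cm l)) κnoMok (canon₂₆ νtop (Mok2015.LeafSupport.mkN (Mok2015.LeafSupport.cm l)) κnoMok).HLL).ChenDeligneSym ∧ (canon₈₇W νtop (Mok2015.LeafSupport.mkN (Mok2015.LeafSupport.cm l)) κnoMok (canon₂₆ νtop (Mok2015.LeafSupport.mkN (Mok2015.LeafSupport.cm l)) κnoMok).HLL).ChenSelfDualExistence ∧ (canon₈₇W νtop (Mok2015.LeafSupport.mkN (Mok2015.LeafSupport.cm l)) κnoMok (canon₂₆ νtop (Mok2015.LeafSupport.mkN (Mok2015.LeafSupport.cm l)) κnoMok).HLL).ChenBWduality ∧ (canon₈₇W νtop (Mok2015.LeafSupport.mkN (Mok2015.LeafSupport.cm l)) κnoMok (canon₂₆ νtop (Mok2015.LeafSupport.mkN (Mok2015.LeafSupport.cm l)) κnoMok).HLL).ChenBWratios)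 :=
  have cmod := Mok2015.LeafSupport.countermodel l
  have nm := not_M_cm l
  have ns : ∀ N, ¬ κnoMok.Scope N := κnoMok_facts.2.2.2.2.2.1
  have b : ∀ N, νtop.Everything N := bookInputs_top.everything
  ⟨cmod.2.2.1, canon_implications₈₇W _ _ _ _,
    ⟨fun h => nm h.2, fun h => nm h.2, fun h => ns 0 (h 0), fun h => ns 0 (h 0)⟩,
    ⟨True.intro, b, ⟨b, ⟨b, b⟩⟩, ⟨b, ⟨b, b⟩⟩, ⟨b, ⟨b, b⟩⟩⟩⟩

/-- KMSW SIDE, AS TYPED: with the book AND Mok at the top but KMSW WITHOUT its Mok import (`κnoMok`: its proved scope fails at every rank — `κnoMok_facts`), tranche 26 read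
canonically, every edge valid: Chen's Theorems 5.5 / B FAIL (« announced by Kaletha–Mínguez–Shin–White », the definite U(V)); the seven other statements HOLD. [cite: Chen2026RatiosDeligne, Rem. 5.3 (p0031:L64) (separating model; bookkeeping proved here)] [claim: KalethaMinguezShinWhite2014, under-review] -/
theorem c87_kmsw_importDenied :
    Implications87 νtop μtop κnoMok (canon₂₆ νtop μtop κnoMok) (canon₈₇W νtop μtop κnoMok (canon₂₆ νtop μtop κnoMok).HLL) ∧ (∀ N, ¬ κnoMok.Scope N) ∧ (¬ (canon₈₇W νtop μtop κnoMok (canon₂₆ νtop μtop κnoMok).HLL).ChenRSGL2 ∧ ¬ (canon₈₇W νtop μtop κnoMok (canon₂₆ νtop μtop κnoMok).HLL).ChenBlasius) ∧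
      ((canon₈₇W νtop μtop κnoMok (canon₂₆ νtop μtop κnoMok).HLL).STfiniteness ∧ (canon₈₇W νtop μtop κnoMok (canon₂₆ νtop μtop κnoMok).HLL).STgrowth ∧ (canon₈₇W νtop μtop κnoMok (canon₂₆ νtop μtop κnoMok).HLL).STunitaryGrowth ∧ (canon₈₇W νtop μtop κnoMok (canon₂₆ νtop μtop κnoMok).HLL).ChenDeligneSym ∧ (canon₈₇W νtop μtop κnoMok (canon₂₆ νtop μtop κnoMok).HLL).ChenSelfDualExistence ∧ (canon₈₇W νtop μtop κnoMok (canon₂₆ νtop μtop κnoMok).HLL).ChenBWduality ∧ (canon₈₇W νtop μtop κnoMok (canon₂₆ νtop μtop κnoMok).HLL).ChenBWratios) :=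
  have b : ∀ N, νtop.Everything N := bookInputs_top.everything
  have m : ∀ N, μtop.Everything N := mokInputs_top.everything
  have ns : ∀ N, ¬ κnoMok.Scope N := κnoMok_facts.2.2.2.2.2.1
  ⟨canon_implications₈₇W _ _ _ _, ns, ⟨fun h => ns 0 (h 0), fun h => ns 0 (h 0)⟩,
    ⟨⟨b, m⟩, ⟨b, m⟩, True.intro, b, ⟨b, ⟨b, b⟩⟩, ⟨b, ⟨b, b⟩⟩, ⟨b, ⟨b, b⟩⟩⟩⟩

/-- THE EIGHTY-SEVENTH TRANCHE REGRADED, in one statement: (i) at the top all nine hold; (ii) row B101 denied: C222's three fail, the six others hold; (iii) in the book countermodel of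
any leaf C220's two classical theorems, C221's Theorem A and C222's three statements fail while C220's control and C221's Theorems 5.5 / B hold; (iv) for every Mok countermodel
(KMSW without Mok, book at the top) C220's two theorems and C221's Theorems 5.5 / B fail while the control, Theorem A and C222 hold; (v) with KMSW's Mok import denied (book, Mok at
the top) C221's Theorems 5.5 / B fail and the seven others hold — C220's Theorem 6.17 holds in every reading. [cite: ShinTemplier2014Fields, Thms 5.19, 6.6, 6.17; Chen2026RatiosDeligne, Thms 5.5, 5.7, 5.9; Chen2024BettiWhittaker, Thms 4.7, 4.10 (bookkeeping proved here)] [claim: KalethaMinguezShinWhite2014, under-review] -/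
theorem c87_regraded :
    ((canon₈₇W νtop μtop κtop (canon₂₆ νtop μtop κtop).HLL).STfiniteness ∧ (canon₈₇W νtop μtop κtop (canon₂₆ νtop μtop κtop).HLL).STgrowth ∧ (canon₈₇W νtop μtop κtop (canon₂₆ νtop μtop κtop).HLL).STunitaryGrowth ∧ (canon₈₇W νtop μtop κtop (canon₂₆ νtop μtop κtop).HLL).ChenRSGL2 ∧ (canon₈₇W νtop μtop κtop (canon₂₆ νtop μtop κtop).HLL).ChenBlasius ∧ (canon₈₇W νtop μtop κtop (canon₂₆ νtop μtop κtop).HLL).ChenDeligneSym ∧ (canon₈₇W νtop μtop κtop (canon₂₆ νtop μtop κtop).HLL).ChenSelfDualExistence ∧ (canon₈₇W νtop μtop κtop (canon₂₆ νtop μtop κtop).HLL).ChenBWduality ∧ (canon₈₇W νtop μtop κtop (canon₂₆ νtop μtop κtop).HLL).ChenBWratios) ∧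
      (¬ (canon₈₇W νtop μtop κtop False).ChenSelfDualExistence ∧ ¬ (canon₈₇W νtop μtop κtop False).ChenBWduality ∧ ¬ (canon₈₇W νtop μtop κtop False).ChenBWratios ∧ (canon₈₇W νtop μtop κtop False).STfiniteness ∧ (canon₈₇W νtop μtop κtop False).ChenBlasius ∧ (canon₈₇W νtop μtop κtop False).ChenDeligneSym) ∧
      (∀ l : LeafSupport.Leaf, (¬ (LeafSupport.mkN (LeafSupport.cm l)).leaf l) ∧ ¬ (canon₈₇W (LeafSupport.mkN (LeafSupport.cm l)) μtop κtop (canon₂₆ (LeafSupport.mkN (LeafSupport.cm l)) μtop κtop).HLL).STfiniteness ∧ ¬ (canon₈₇W (LeafSupport.mkN (LeafSupport.cm l)) μtop κtop (canon₂₆ (LeafSupport.mkN (LeafSupport.cm l)) μtop κtop).HLL).STgrowth ∧ ¬ (canon₈₇W (LeafSupport.mkN (LeafSupport.cm l)) μtop κtop (canon₂₆ (LeafSupport.mkN (LeafSupport.cm l)) μtop κtop).HLL).ChenDeligneSym ∧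
        ¬ (canon₈₇W (LeafSupport.mkN (LeafSupport.cm l)) μtop κtop (canon₂₆ (LeafSupport.mkN (LeafSupport.cm l)) μtop κtop).HLL).ChenBWratios ∧ (canon₈₇W (LeafSupport.mkN (LeafSupport.cm l)) μtop κtop (canon₂₆ (LeafSupport.mkN (LeafSupport.cm l)) μtop κtop).HLL).STunitaryGrowth ∧ (canon₈₇W (LeafSupport.mkN (LeafSupport.cm l)) μtop κtop (canon₂₆ (LeafSupport.mkN (LeafSupport.cm l)) μtop κtop).HLL).ChenBlasius) ∧
      (∀ l : Mok2015.LeafSupport.Leaf, (¬ (Mok2015.LeafSupport.mkN (Mok2015.LeafSupport.cm l)).leaf l) ∧ ¬ (canon₈₇W νtop (Mok2015.LeafSupport.mkN (Mok2015.LeafSupport.cm l)) κnoMok (canon₂₆ νtop (Mok2015.LeafSupport.mkN (Mok2015.LeafSupport.cm l)) κnoMok).HLL).STfiniteness ∧ ¬ (canon₈₇W νtop (Mok2015.LeafSupport.mkN (Mok2015.LeafSupport.cm l)) κnoMok (canon₂₆ νtop (Mok2015.LeafSupport.mkN (Mok2015.LeafSupport.cm l)) κnoMok).HLL).ChenBlasius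 ∧ (canon₈₇W νtop (Mok2015.LeafSupport.mkN (Mok2015.LeafSupport.cm l)) κnoMok (canon₂₆ νtop (Mok2015.LeafSupport.mkN (Mok2015.LeafSupport.cm l)) κnoMok).HLL).STunitaryGrowth ∧
        (canon₈₇W νtop (Mok2015.LeafSupport.mkN (Mok2015.LeafSupport.cm l)) κnoMok (canon₂₆ νtop (Mok2015.LeafSupport.mkN (Mok2015.LeafSupport.cm l)) κnoMok).HLL).ChenDeligneSym ∧ (canon₈₇W νtop (Mok2015.LeafSupport.mkN (Mok2015.LeafSupport.cm l)) κnoMok (canon₂₆ νtop (Mok2015.LeafSupport.mkN (Mok2015.LeafSupport.cm l)) κnoMok).HLL).ChenBWratios) ∧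
      (¬ (canon₈₇W νtop μtop κnoMok (canon₂₆ νtop μtop κnoMok).HLL).ChenRSGL2 ∧ ¬ (canon₈₇W νtop μtop κnoMok (canon₂₆ νtop μtop κnoMok).HLL).ChenBlasius ∧ (canon₈₇W νtop μtop κnoMok (canon₂₆ νtop μtop κnoMok).HLL).STfiniteness ∧ (canon₈₇W νtop μtop κnoMok (canon₂₆ νtop μtop κnoMok).HLL).ChenDeligneSym ∧ (canon₈₇W νtop μtop κnoMok (canon₂₆ νtop μtop κnoMok).HLL).ChenBWratios) :=
  ⟨eightyseventh_holds_top,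
    ⟨c87_row_denied_top.2.1.1, c87_row_denied_top.2.1.2.1, c87_row_denied_top.2.1.2.2, c87_row_denied_top.2.2.1, c87_row_denied_top.2.2.2.2.2.2.1,
      c87_row_denied_top.2.2.2.2.2.2.2⟩,
    fun l => have h := c87_book_cm l
      ⟨h.2.2.1, h.2.2.2.1.1, h.2.2.2.1.2.1, h.2.2.2.1.2.2.1, h.2.2.2.1.2.2.2.2.2, h.2.2.2.2.1, h.2.2.2.2.2.2⟩,
    fun l => have h := c87_mok_cm l
      ⟨h.1, h.2.2.1.1, h.2.2.1.2.2.2, h.2.2.2.1, h.2.2.2.2.1, h.2.2.2.2.2.2.2⟩,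
    ⟨c87_kmsw_importDenied.2.2.1.1, c87_kmsw_importDenied.2.2.1.2, c87_kmsw_importDenied.2.2.2.1, c87_kmsw_importDenied.2.2.2.2.2.2.1,
      c87_kmsw_importDenied.2.2.2.2.2.2.2.2.2⟩⟩

/-! ## 91. Eighty-eighth tranche (v4 of this file, after `Downstream25.lean` v1; unit `pub-arthur-down-g35`): supports of THE CITATION GRAPH, II — rows C223
`KYGGarchimedean` / `KYGGassump` / `KYGGFourier`, C224 `HKggp`, C225 `KYArtinHyps` (node) / `KYArtin` / `KYSym3` (premise-free); see the module docstring for the summary. -/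

section Canon88

variable (ν : Nodes)

/-- The parametrised canonical reading of the eighty-eighth tranche: the tranche-1 / 6 / 10 / 11 assignments `c`, `c₆`, `c₁₀`, `c₁₁` and the node's value `hyps` are the parameters; C223's three statements := book ∧ c.AMR; C224 := book ∧ the five row fields; the node := hyps; C225's theorem := c₁₀.ArthurGSp4 ∧ hyps; the control := True. [cite: KimYamauchi2024GanGurevichG2, Appendix A; HaanKwon2026SpecialPeriods, §8; KimYamauchi2016ConditionalArtin, §§1, 5, 10 (canonical model; bookkeeping)] -/
abbrev canon₈₈W (c : Consumers) (c₆ : Consumers6) (c₁₀ : Consumers10) (c₁₁ : Consumers11) (hyps : Prop) : Consumers88 where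
  KYGGarchimedean := (∀ N, ν.Everything N) ∧ c.AMR
  KYGGassump := (∀ N, ν.Everything N) ∧ c.AMR
  KYGGFourier := (∀ N, ν.Everything N) ∧ c.AMR
  HKggp := (∀ N, ν.Everything N) ∧ c₆.AtobeGanEvenQS ∧ c.GanIchino11 ∧ c.GanIchino14 ∧ c.IshimotoGeneric ∧ c₁₁.LiMpApackets
  KYArtinHyps := hyps
  KYArtin := c₁₀.ArthurGSp4 ∧ hyps
  KYSym3 := True

/-- Every eighty-eighth-tranche edge holds in the parametrised reading, for arbitrary ν and EVERY assignment of tranches 1 / 6 / 10 / 11 and of the node. [cite: KimYamauchi2024GanGurevichG2, Thms 1.1, 1.4; HaanKwon2026SpecialPeriods, Thm 1.1; KimYamauchi2016ConditionalArtin, Thms 1.1, 10.1 (bookkeeping proved here)] -/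
theorem canon_implications₈₈W (c : Consumers) (c₆ : Consumers6) (c₁₀ : Consumers10) (c₁₁ : Consumers11) (hyps : Prop) :
    Implications88 ν c c₆ c₁₀ c₁₁ (canon₈₈W ν c c₆ c₁₀ c₁₁ hyps) where
  kyGGarch := fun a r => ⟨a, r⟩
  kyGGassump := fun h => h
  kyGGFourier := fun h => h
  hk := fun a b g h i l => ⟨a, b, g, h, i, l⟩
  kyArtin := fun t h => ⟨t, h⟩
  kySym3 := True.intro

/-- In the parametrised reading all seven statements hold as soon as the book's outputs hold at all ranks, the six row fields hold, D17's node holds and the tranche's own node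
holds — through the tranche's bookkeeping theorems `kyGG_of_book_and_row`, `hk_of_book_and_rows`, `kyArtin_of_nodes`, `kySym3_inherits_nothing`. [cite: KimYamauchi2024GanGurevichG2, Appendix A; HaanKwon2026SpecialPeriods, Thm 1.1; KimYamauchi2016ConditionalArtin, Thm 1.1 (bookkeeping proved here)] -/
theorem c88_all_of (c : Consumers) (c₆ : Consumers6) (c₁₀ : Consumers10) (c₁₁ : Consumers11) (hyps : Prop) (hν : ∀ N, ν.Everything N) (hA : c.AMR)
    (h3 : c₆.AtobeGanEvenQS) (h11 : c.GanIchino11) (h14 : c.GanIchino14) (h5 : c.IshimotoGeneric) (h28 : c₁₁.LiMpApackets) (hT : c₁₀.ArthurGSp4) (hH : hyps) :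
    ((canon₈₈W ν c c₆ c₁₀ c₁₁ hyps).KYGGarchimedean ∧ (canon₈₈W ν c c₆ c₁₀ c₁₁ hyps).KYGGassump ∧ (canon₈₈W ν c c₆ c₁₀ c₁₁ hyps).KYGGFourier ∧ (canon₈₈W ν c c₆ c₁₀ c₁₁ hyps).HKggp ∧ (canon₈₈W ν c c₆ c₁₀ c₁₁ hyps).KYArtinHyps ∧ (canon₈₈W ν c c₆ c₁₀ c₁₁ hyps).KYArtin ∧ (canon₈₈W ν c c₆ c₁₀ c₁₁ hyps).KYSym3) :=
  have X := canon_implications₈₈W ν c c₆ c₁₀ c₁₁ hyps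
  have hK := kyGG_of_book_and_row X hν hA
  ⟨hK.1, hK.2.1, hK.2.2, hk_of_book_and_rows X hν h3 h11 h14 h5 h28, hH, kyArtin_of_nodes X hT hH, kySym3_inherits_nothing X⟩

end Canon88

/-- Row B1 DENIED (`AMR := False`; the other tranche-1 fields as in `canon` at the top): a reading of `Consumers` used only to deny C223's row premise; no first-tranche edge is claimed for it. [cite: ArancibiaMoeglinRenard2015, Thm 1.1 (separating model; bookkeeping)] -/
abbrev c₁noB1 : Consumers := { canon νtop μtop κtop with AMR := False }

/-- Row D17's node DENIED (`ArthurGSp4 := False`; the other tenth-tranche fields as in `canon₁₀` at the top): used only to deny C225's (TR); no tenth-tranche edge is claimed for it. [cite: KimWakatsukiYamauchi2019, §2.4 (separating model; bookkeeping)] -/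
abbrev c₁₀noGSp4 : Consumers10 := { canon₁₀ νtop μtop κtop with ArthurGSp4 := False }

/-- At the top (every input of the three DAGs; tranches 1 / 6 / 10 / 11 read canonically; C225's node granted) all seven statements of the tranche hold. [cite: KimYamauchi2024GanGurevichG2, Thms 1.1, 1.4; HaanKwon2026SpecialPeriods, Thm 1.1; KimYamauchi2016ConditionalArtin, Thms 1.1, 10.1 (bookkeeping proved here)] -/
theorem eightyeighth_holds_top : ((canon₈₈W νtop (canon νtop μtop κtop) (canon₆ νtop μtop) (canon₁₀ νtop μtop κtop) (canon₁₁ νtop) True).KYGGarchimedean ∧ (canon₈₈W νtop (canon νtop μtop κtop) (canon₆ νtop μtop) (canon₁₀ νtop μtop κtop) (canon₁₁ νtop) True).KYGGassump ∧ (canon₈₈W νtop (canon νtop μtop κtop) (canon₆ νtop μtop) (canon₁₀ νtop μtop κtop) (canon₁₁ νtop) True).KYGGFourier ∧ (canon₈₈W νtop (canon νtop μtop κtop) (canon₆ νtop μtop) (canon₁₀ νtop μtop κtop) (canon₁₁ νtop) True).HKggp ∧ (canon₈₈W νtop (canon νtop μtop κtop) (canon₆ νtop μtop) (canon₁₀ νtop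 μtop κtop) (canon₁₁ νtop) True).KYArtinHyps ∧ (canon₈₈W νtop (canon νtop μtop κtop) (canon₆ νtop μtop) (canon₁₀ νtop μtop κtop) (canon₁₁ νtop) True).KYArtin ∧ (canon₈₈W νtop (canon νtop μtop κtop) (canon₆ νtop μtop) (canon₁₀ νtop μtop κtop) (canon₁₁ νtop) True).KYSym3) :=
  have b : ∀ N, νtop.Everything N := bookInputs_top.everything
  c88_all_of νtop (canon νtop μtop κtop) (canon₆ νtop μtop) (canon₁₀ νtop μtop κtop) (canon₁₁ νtop) True b b b b b b b b True.intro

/-- C225's OWN HYPOTHESES ARE LOAD-BEARING AS TYPED: at the top with the node (Gal) ∧ (Rat) ∧ (Int) DENIED every edge holds, Kim – Yamauchi's Theorem 1.1 FAILS, the five other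
statements and the control HOLD. [cite: KimYamauchi2016ConditionalArtin, Thm 1.1 (« assume (TR), (Gal), (Rat), and (Int) ») (separating model; bookkeeping proved here)] -/
theorem c88_node_denied_top :
    Implications88 νtop (canon νtop μtop κtop) (canon₆ νtop μtop) (canon₁₀ νtop μtop κtop) (canon₁₁ νtop) (canon₈₈W νtop (canon νtop μtop κtop) (canon₆ νtop μtop) (canon₁₀ νtop μtop κtop) (canon₁₁ νtop) False) ∧ ¬ (canon₈₈W νtop (canon νtop μtop κtop) (canon₆ νtop μtop) (canon₁₀ νtop μtop κtop) (canon₁₁ νtop) False).KYArtinHyps ∧ ¬ (canon₈₈W νtop (canon νtop μtop κtop) (canon₆ νtop μtop) (canon₁₀ νtop μtop κtop) (canon₁₁ νtop) False).KYArtin ∧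
      ((canon₈₈W νtop (canon νtop μtop κtop) (canon₆ νtop μtop) (canon₁₀ νtop μtop κtop) (canon₁₁ νtop) False).KYGGarchimedean ∧ (canon₈₈W νtop (canon νtop μtop κtop) (canon₆ νtop μtop) (canon₁₀ νtop μtop κtop) (canon₁₁ νtop) False).KYGGassump ∧ (canon₈₈W νtop (canon νtop μtop κtop) (canon₆ νtop μtop) (canon₁₀ νtop μtop κtop) (canon₁₁ νtop) False).KYGGFourier ∧ (canon₈₈W νtop (canon νtop μtop κtop) (canon₆ νtop μtop) (canon₁₀ νtop μtop κtop) (canon₁₁ νtop) False).HKggp ∧ (canon₈₈W νtop (canon νtop μtop κtop) (canon₆ νtop μtop) (canon₁₀ νtop μtop κtop) (canon₁₁ νtop) False).KYSym3) :=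
  have b : ∀ N, νtop.Everything N := bookInputs_top.everything
  ⟨canon_implications₈₈W _ _ _ _ _ _, fun h => h, fun h => h.2, ⟨⟨b, b⟩, ⟨b, b⟩, ⟨b, b⟩, ⟨b, b, b, b, b, b⟩, True.intro⟩⟩

/-- EVERY TYPED CONDUIT IS LOAD-BEARING: at the top (node granted), (a) with row B1 DENIED (`c₁noB1`) every edge holds and C223's three statements FAIL while C224 and C225 hold;
(b) with row C28 DENIED (§29's `canon₁₁noC28`) every edge holds and C224's Theorem 1.1 FAILS while C223 and C225 hold; (c) with D17's node `ArthurGSp4` DENIED (`c₁₀noGSp4`) every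
edge holds and C225's Theorem 1.1 FAILS while C223 and C224 hold. [cite: KimYamauchi2024GanGurevichG2, Appendix A (« Adams-Johnson packet »); HaanKwon2026SpecialPeriods, §8.1.3 (« [Li24] »); KimYamauchi2016ConditionalArtin, §1 (« (TR) ») (separating models; bookkeeping proved here)] -/
theorem c88_rows_denied_top :
    (Implications88 νtop c₁noB1 (canon₆ νtop μtop) (canon₁₀ νtop μtop κtop) (canon₁₁ νtop) (canon₈₈W νtop c₁noB1 (canon₆ νtop μtop) (canon₁₀ νtop μtop κtop) (canon₁₁ νtop) True) ∧ (¬ (canon₈₈W νtop c₁noB1 (canon₆ νtop μtop) (canon₁₀ νtop μtop κtop) (canon₁₁ νtop) True).KYGGarchimedean ∧ ¬ (canon₈₈W νtop c₁noB1 (canon₆ νtop μtop) (canon₁₀ νtop μtop κtop) (canon₁₁ νtop) True).KYGGassump ∧ ¬ (canon₈₈W νtop c₁noB1 (canon₆ νtop μtop) (canon₁₀ νtop μtop κtop) (canon₁₁ νtop) True).KYGGFourier) ∧ (canon₈₈W νtop c₁noB1 (canon₆ νtop μtop) (canon₁₀ νtop μtop κtop) (canon₁₁ νtop) True).HKggp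 ∧ (canon₈₈W νtop c₁noB1 (canon₆ νtop μtop) (canon₁₀ νtop μtop κtop) (canon₁₁ νtop) True).KYArtin) ∧
      (Implications88 νtop (canon νtop μtop κtop) (canon₆ νtop μtop) (canon₁₀ νtop μtop κtop) (canon₁₁noC28 νtop) (canon₈₈W νtop (canon νtop μtop κtop) (canon₆ νtop μtop) (canon₁₀ νtop μtop κtop) (canon₁₁noC28 νtop) True) ∧ ¬ (canon₈₈W νtop (canon νtop μtop κtop) (canon₆ νtop μtop) (canon₁₀ νtop μtop κtop) (canon₁₁noC28 νtop) True).HKggp ∧ (canon₈₈W νtop (canon νtop μtop κtop) (canon₆ νtop μtop) (canon₁₀ νtop μtop κtop) (canon₁₁noC28 νtop) True).KYGGFourier ∧ (canon₈₈W νtop (canon νtop μtop κtop) (canon₆ νtop μtop) (canon₁₀ νtop μtop κtop) (canon₁₁noC28 νtop) True).KYArtin) ∧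
      (Implications88 νtop (canon νtop μtop κtop) (canon₆ νtop μtop) c₁₀noGSp4 (canon₁₁ νtop) (canon₈₈W νtop (canon νtop μtop κtop) (canon₆ νtop μtop) c₁₀noGSp4 (canon₁₁ νtop) True) ∧ ¬ (canon₈₈W νtop (canon νtop μtop κtop) (canon₆ νtop μtop) c₁₀noGSp4 (canon₁₁ νtop) True).KYArtin ∧ (canon₈₈W νtop (canon νtop μtop κtop) (canon₆ νtop μtop) c₁₀noGSp4 (canon₁₁ νtop) True).KYGGFourier ∧ (canon₈₈W νtop (canon νtop μtop κtop) (canon₆ νtop μtop) c₁₀noGSp4 (canon₁₁ νtop) True).HKggp) :=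
  have b : ∀ N, νtop.Everything N := bookInputs_top.everything
  ⟨⟨canon_implications₈₈W _ _ _ _ _ _, ⟨fun h => h.2, fun h => h.2, fun h => h.2⟩, ⟨b, b, b, b, b, b⟩, ⟨b, True.intro⟩⟩,
    ⟨canon_implications₈₈W _ _ _ _ _ _, fun h => h.2.2.2.2.2, ⟨b, b⟩, ⟨b, True.intro⟩⟩,
    ⟨canon_implications₈₈W _ _ _ _ _ _, fun h => h.1, ⟨b, b⟩, ⟨b, b, b, b, b, b⟩⟩⟩

/-- BOOK SIDE, EXACT SUPPORT AS TYPED: in the book countermodel of ANY leaf `l` (Mok and KMSW at the top; tranches 1 / 6 / 10 / 11 read canonically over the countermodel; node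
granted; every edge valid) ALL SIX book-side statements FAIL — C223 and C224 directly and through their rows, C225's Theorem 1.1 through `ArthurGSp4` ⇐ `GeeTaibi` ⇐ book — while
the control and the node hold. [cite: KimYamauchi2024GanGurevichG2, Appendix A (« Arthur's classification [A] »); HaanKwon2026SpecialPeriods, §8.1.3 (« [Art13, … ] »); KimYamauchi2016ConditionalArtin, §5 (« We assume his result. ») (bookkeeping proved here)] -/
theorem c88_book_cm (l : LeafSupport.Leaf) :
    Implications88 (LeafSupport.mkN (LeafSupport.cm l)) (canon (LeafSupport.mkN (LeafSupport.cm l)) μtop κtop) (canon₆ (LeafSupport.mkN (LeafSupport.cm l)) μtop) (canon₁₀ (LeafSupport.mkN (LeafSupport.cm l)) μtop κtop) (canon₁₁ (LeafSupport.mkN (LeafSupport.cm l))) (canon₈₈W (LeafSupport.mkN (LeafSupport.cm l)) (canon (LeafSupport.mkN (LeafSupport.cm l)) μtop κtop) (canon₆ (LeafSupport.mkN (LeafSupport.cm l)) μtop) (canon₁₀ (LeafSupport.mkN (LeafSupport.cm l)) μtop κtop) (canon₁₁ (LeafSupport.mkN (LeafSupport.cm l))) True) ∧ (∀ l', l' ≠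 l → (LeafSupport.mkN (LeafSupport.cm l)).leaf l') ∧ ¬ (LeafSupport.mkN (LeafSupport.cm l)).leaf l ∧
      (¬ (canon₈₈W (LeafSupport.mkN (LeafSupport.cm l)) (canon (LeafSupport.mkN (LeafSupport.cm l)) μtop κtop) (canon₆ (LeafSupport.mkN (LeafSupport.cm l)) μtop) (canon₁₀ (LeafSupport.mkN (LeafSupport.cm l)) μtop κtop) (canon₁₁ (LeafSupport.mkN (LeafSupport.cm l))) True).KYGGarchimedean ∧ ¬ (canon₈₈W (LeafSupport.mkN (LeafSupport.cm l)) (canon (LeafSupport.mkN (LeafSupport.cm l)) μtop κtop) (canon₆ (LeafSupport.mkN (LeafSupport.cm l)) μtop) (canon₁₀ (LeafSupport.mkN (LeafSupport.cm l)) μtop κtop) (canon₁₁ (LeafSupport.mkN (LeafSupport.cm l))) True).KYGGassump ∧ ¬ (canon₈₈W (LeafSupport.mkN (LeafSupport.cm l)) (canon (LeafSupport.mkN (LeafSupport.cm l)) μtop κtop) (canon₆ (LeafSupport.mkN (LeafSupport.cm l)) μtop) (canon₁₀ (LeafSupport.mkN (LeafSupport.cm l)) μtop κtop) (canon₁₁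 (LeafSupport.mkN (LeafSupport.cm l))) True).KYGGFourier ∧ ¬ (canon₈₈W (LeafSupport.mkN (LeafSupport.cm l)) (canon (LeafSupport.mkN (LeafSupport.cm l)) μtop κtop) (canon₆ (LeafSupport.mkN (LeafSupport.cm l)) μtop) (canon₁₀ (LeafSupport.mkN (LeafSupport.cm l)) μtop κtop) (canon₁₁ (LeafSupport.mkN (LeafSupport.cm l))) True).HKggp ∧ ¬ (canon₈₈W (LeafSupport.mkN (LeafSupport.cm l)) (canon (LeafSupport.mkN (LeafSupport.cm l)) μtop κtop) (canon₆ (LeafSupport.mkN (LeafSupport.cm l)) μtop) (canon₁₀ (LeafSupport.mkN (LeafSupport.cm l)) μtop κtop) (canon₁₁ (LeafSupport.mkN (LeafSupport.cm l))) True).KYArtin) ∧ (canon₈₈W (LeafSupport.mkN (LeafSupport.cm l)) (canon (LeafSupport.mkN (LeafSupport.cm l)) μtop κtop) (canon₆ (LeafSupport.mkN (LeafSupport.cm l)) μtop) (canon₁₀ (LeafSupport.mkN (LeafSupport.cm l)) μtop κtop) (canon₁₁ (LeafSupport.mkN (LeafSupport.cm l))) True).KYArtinHyps ∧ (canon₈₈W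 (LeafSupport.mkN (LeafSupport.cm l)) (canon (LeafSupport.mkN (LeafSupport.cm l)) μtop κtop) (canon₆ (LeafSupport.mkN (LeafSupport.cm l)) μtop) (canon₁₀ (LeafSupport.mkN (LeafSupport.cm l)) μtop κtop) (canon₁₁ (LeafSupport.mkN (LeafSupport.cm l))) True).KYSym3 :=
  have cmod := LeafSupport.countermodel l
  have nb := not_B_cm l
  ⟨canon_implications₈₈W _ _ _ _ _ _, cmod.2.1, cmod.2.2.1,
    ⟨fun h => nb h.1, fun h => nb h.1, fun h => nb h.1, fun h => nb h.1, fun h => nb h.1⟩, True.intro, True.intro⟩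

/-- MOK AND KMSW ARE NOT IN THE SUPPORT: with the book at the top, Mok read by the countermodel of ANY of its leaves and KMSW WITHOUT its Mok import (`κnoMok`), tranches
1 / 6 / 10 / 11 read canonically over these, node granted, every edge valid: ALL SEVEN statements HOLD. [cite: KimYamauchi2024GanGurevichG2, Appendix A; HaanKwon2026SpecialPeriods, Thm 1.1; KimYamauchi2016ConditionalArtin, Thm 1.1 (separating model; bookkeeping proved here)] -/
theorem c88_mok_kmsw_free (l : Mok2015.LeafSupport.Leaf) :
    ¬ (Mok2015.LeafSupport.mkN (Mok2015.LeafSupport.cm l)).leaf l ∧ (∀ N, ¬ κnoMok.Scope N) ∧ Implications88 νtop (canon νtop (Mok2015.LeafSupport.mkN (Mok2015.LeafSupport.cm l)) κnoMok) (canon₆ νtop (Mok2015.LeafSupport.mkN (Mok2015.LeafSupport.cm l))) (canon₁₀ νtop (Mok2015.LeafSupport.mkN (Mok2015.LeafSupport.cm l)) κnoMok) (canon₁₁ νtop) (canon₈₈W νtop (canon νtop (Mok2015.LeafSupport.mkN (Mok2015.LeafSupport.cm l)) κnoMok) (canon₆ νtop (Mok2015.LeafSupport.mkN (Mok2015.LeafSupport.cm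 l))) (canon₁₀ νtop (Mok2015.LeafSupport.mkN (Mok2015.LeafSupport.cm l)) κnoMok) (canon₁₁ νtop) True) ∧ ((canon₈₈W νtop (canon νtop (Mok2015.LeafSupport.mkN (Mok2015.LeafSupport.cm l)) κnoMok) (canon₆ νtop (Mok2015.LeafSupport.mkN (Mok2015.LeafSupport.cm l))) (canon₁₀ νtop (Mok2015.LeafSupport.mkN (Mok2015.LeafSupport.cm l)) κnoMok) (canon₁₁ νtop) True).KYGGarchimedean ∧ (canon₈₈W νtop (canon νtop (Mok2015.LeafSupport.mkN (Mok2015.LeafSupport.cm l)) κnoMok) (canon₆ νtop (Mok2015.LeafSupport.mkN (Mok2015.LeafSupport.cm l))) (canon₁₀ νtop (Mok2015.LeafSupport.mkN (Mok2015.LeafSupport.cm l)) κnoMok) (canon₁₁ νtop) True).KYGGassump ∧ (canon₈₈W νtop (canon νtop (Mok2015.LeafSupport.mkN (Mok2015.LeafSupport.cm l)) κnoMok) (canon₆ νtop (Mok2015.LeafSupport.mkN (Mok2015.LeafSupport.cm l))) (canon₁₀ νtop (Mok2015.LeafSupport.mkN (Mok2015.LeafSupport.cm l)) κnoMok) (canon₁₁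 νtop) True).KYGGFourier ∧ (canon₈₈W νtop (canon νtop (Mok2015.LeafSupport.mkN (Mok2015.LeafSupport.cm l)) κnoMok) (canon₆ νtop (Mok2015.LeafSupport.mkN (Mok2015.LeafSupport.cm l))) (canon₁₀ νtop (Mok2015.LeafSupport.mkN (Mok2015.LeafSupport.cm l)) κnoMok) (canon₁₁ νtop) True).HKggp ∧ (canon₈₈W νtop (canon νtop (Mok2015.LeafSupport.mkN (Mok2015.LeafSupport.cm l)) κnoMok) (canon₆ νtop (Mok2015.LeafSupport.mkN (Mok2015.LeafSupport.cm l))) (canon₁₀ νtop (Mok2015.LeafSupport.mkN (Mok2015.LeafSupport.cm l)) κnoMok) (canon₁₁ νtop) True).KYArtinHyps ∧ (canon₈₈W νtop (canon νtop (Mok2015.LeafSupport.mkN (Mok2015.LeafSupport.cm l)) κnoMok) (canon₆ νtop (Mok2015.LeafSupport.mkN (Mok2015.LeafSupport.cm l))) (canon₁₀ νtop (Mok2015.LeafSupport.mkN (Mok2015.LeafSupport.cm l)) κnoMok) (canon₁₁ νtop) True).KYArtin ∧ (canon₈₈W νtop (canon νtop (Mok2015.LeafSupport.mkN (Mok2015.LeafSupport.cm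 l)) κnoMok) (canon₆ νtop (Mok2015.LeafSupport.mkN (Mok2015.LeafSupport.cm l))) (canon₁₀ νtop (Mok2015.LeafSupport.mkN (Mok2015.LeafSupport.cm l)) κnoMok) (canon₁₁ νtop) True).KYSym3) :=
  have cmod := Mok2015.LeafSupport.countermodel l
  have ns : ∀ N, ¬ κnoMok.Scope N := κnoMok_facts.2.2.2.2.2.1
  have b : ∀ N, νtop.Everything N := bookInputs_top.everything
  ⟨cmod.2.2.1, ns, canon_implications₈₈W _ _ _ _ _ _, ⟨⟨b, b⟩, ⟨b, b⟩, ⟨b, b⟩, ⟨b, b, b, b, b, b⟩, True.intro, ⟨b, True.intro⟩, True.intro⟩⟩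

/-- THE EIGHTY-EIGHTH TRANCHE REGRADED, in one statement: (i) at the top all seven hold; (ii) node denied: C225's theorem fails, the rest hold; (iii) rows denied one at a time: B1 ↦
C223 fails, C28 ↦ C224 fails, `ArthurGSp4` ↦ C225 fails, the others holding each time; (iv) in the book countermodel of any leaf the six book-side statements fail, the control
holds; (v) for every Mok countermodel with KMSW's Mok import denied (book at the top) all seven hold. [cite: KimYamauchi2024GanGurevichG2, Thms 1.1, 1.4; HaanKwon2026SpecialPeriods, Thm 1.1; KimYamauchi2016ConditionalArtin, Thms 1.1, 10.1 (bookkeeping proved here)] -/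
theorem c88_regraded :
    ((canon₈₈W νtop (canon νtop μtop κtop) (canon₆ νtop μtop) (canon₁₀ νtop μtop κtop) (canon₁₁ νtop) True).KYGGarchimedean ∧ (canon₈₈W νtop (canon νtop μtop κtop) (canon₆ νtop μtop) (canon₁₀ νtop μtop κtop) (canon₁₁ νtop) True).KYGGassump ∧ (canon₈₈W νtop (canon νtop μtop κtop) (canon₆ νtop μtop) (canon₁₀ νtop μtop κtop) (canon₁₁ νtop) True).KYGGFourier ∧ (canon₈₈W νtop (canon νtop μtop κtop) (canon₆ νtop μtop) (canon₁₀ νtop μtop κtop) (canon₁₁ νtop) True).HKggp ∧ (canon₈₈W νtop (canon νtop μtop κtop) (canon₆ νtop μtop) (canon₁₀ νtop μtop κtop) (canon₁₁ νtop) True).KYArtinHyps ∧ (canon₈₈W νtop (canon νtop μtop κtop) (canon₆ νtop μtop) (canon₁₀ νtop μtop κtop) (canon₁₁ νtop) True).KYArtin ∧ (canon₈₈W νtop (canon νtop μtop κtop) (canon₆ νtop μtop) (canon₁₀ νtop μtop κtop) (canon₁₁ νtop) True).KYSym3) ∧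
      (¬ (canon₈₈W νtop (canon νtop μtop κtop) (canon₆ νtop μtop) (canon₁₀ νtop μtop κtop) (canon₁₁ νtop) False).KYArtin ∧ (canon₈₈W νtop (canon νtop μtop κtop) (canon₆ νtop μtop) (canon₁₀ νtop μtop κtop) (canon₁₁ νtop) False).KYGGFourier ∧ (canon₈₈W νtop (canon νtop μtop κtop) (canon₆ νtop μtop) (canon₁₀ νtop μtop κtop) (canon₁₁ νtop) False).HKggp ∧ (canon₈₈W νtop (canon νtop μtop κtop) (canon₆ νtop μtop) (canon₁₀ νtop μtop κtop) (canon₁₁ νtop) False).KYSym3) ∧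
      (¬ (canon₈₈W νtop c₁noB1 (canon₆ νtop μtop) (canon₁₀ νtop μtop κtop) (canon₁₁ νtop) True).KYGGFourier ∧ (canon₈₈W νtop c₁noB1 (canon₆ νtop μtop) (canon₁₀ νtop μtop κtop) (canon₁₁ νtop) True).HKggp ∧ ¬ (canon₈₈W νtop (canon νtop μtop κtop) (canon₆ νtop μtop) (canon₁₀ νtop μtop κtop) (canon₁₁noC28 νtop) True).HKggp ∧ (canon₈₈W νtop (canon νtop μtop κtop) (canon₆ νtop μtop) (canon₁₀ νtop μtop κtop) (canon₁₁noC28 νtop) True).KYGGFourier ∧ ¬ (canon₈₈W νtop (canon νtop μtop κtop) (canon₆ νtop μtop) c₁₀noGSp4 (canon₁₁ νtop) True).KYArtin ∧ (canon₈₈W νtop (canon νtop μtop κtop) (canon₆ νtop μtop) c₁₀noGSp4 (canon₁₁ νtop) True).HKggp) ∧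
      (∀ l : LeafSupport.Leaf, (¬ (LeafSupport.mkN (LeafSupport.cm l)).leaf l) ∧ ¬ (canon₈₈W (LeafSupport.mkN (LeafSupport.cm l)) (canon (LeafSupport.mkN (LeafSupport.cm l)) μtop κtop) (canon₆ (LeafSupport.mkN (LeafSupport.cm l)) μtop) (canon₁₀ (LeafSupport.mkN (LeafSupport.cm l)) μtop κtop) (canon₁₁ (LeafSupport.mkN (LeafSupport.cm l))) True).KYGGFourier ∧ ¬ (canon₈₈W (LeafSupport.mkN (LeafSupport.cm l)) (canon (LeafSupport.mkN (LeafSupport.cm l)) μtop κtop) (canon₆ (LeafSupport.mkN (LeafSupport.cm l)) μtop) (canon₁₀ (LeafSupport.mkN (LeafSupport.cm l)) μtop κtop) (canon₁₁ (LeafSupport.mkN (LeafSupport.cm l))) True).HKggp ∧ ¬ (canon₈₈W (LeafSupport.mkN (LeafSupport.cm l)) (canon (LeafSupport.mkN (LeafSupport.cm l)) μtop κtop) (canon₆ (LeafSupport.mkN (LeafSupport.cm l)) μtop) (canon₁₀ (LeafSupport.mkN (LeafSupport.cm l)) μtop κtop) (canon₁₁ (LeafSupport.mkN (LeafSupport.cm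 l))) True).KYArtin ∧ (canon₈₈W (LeafSupport.mkN (LeafSupport.cm l)) (canon (LeafSupport.mkN (LeafSupport.cm l)) μtop κtop) (canon₆ (LeafSupport.mkN (LeafSupport.cm l)) μtop) (canon₁₀ (LeafSupport.mkN (LeafSupport.cm l)) μtop κtop) (canon₁₁ (LeafSupport.mkN (LeafSupport.cm l))) True).KYSym3) ∧
      (∀ l : Mok2015.LeafSupport.Leaf, (¬ (Mok2015.LeafSupport.mkN (Mok2015.LeafSupport.cm l)).leaf l) ∧ ((canon₈₈W νtop (canon νtop (Mok2015.LeafSupport.mkN (Mok2015.LeafSupport.cm l)) κnoMok) (canon₆ νtop (Mok2015.LeafSupport.mkN (Mok2015.LeafSupport.cm l))) (canon₁₀ νtop (Mok2015.LeafSupport.mkN (Mok2015.LeafSupport.cm l)) κnoMok) (canon₁₁ νtop) True).KYGGarchimedean ∧ (canon₈₈W νtop (canon νtop (Mok2015.LeafSupport.mkN (Mok2015.LeafSupport.cm l)) κnoMok) (canon₆ νtop (Mok2015.LeafSupport.mkN (Mok2015.LeafSupport.cm l))) (canon₁₀ νtop (Mok2015.LeafSupport.mkN (Mok2015.LeafSupport.cm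 l)) κnoMok) (canon₁₁ νtop) True).KYGGassump ∧ (canon₈₈W νtop (canon νtop (Mok2015.LeafSupport.mkN (Mok2015.LeafSupport.cm l)) κnoMok) (canon₆ νtop (Mok2015.LeafSupport.mkN (Mok2015.LeafSupport.cm l))) (canon₁₀ νtop (Mok2015.LeafSupport.mkN (Mok2015.LeafSupport.cm l)) κnoMok) (canon₁₁ νtop) True).KYGGFourier ∧ (canon₈₈W νtop (canon νtop (Mok2015.LeafSupport.mkN (Mok2015.LeafSupport.cm l)) κnoMok) (canon₆ νtop (Mok2015.LeafSupport.mkN (Mok2015.LeafSupport.cm l))) (canon₁₀ νtop (Mok2015.LeafSupport.mkN (Mok2015.LeafSupport.cm l)) κnoMok) (canon₁₁ νtop) True).HKggp ∧ (canon₈₈W νtop (canon νtop (Mok2015.LeafSupport.mkN (Mok2015.LeafSupport.cm l)) κnoMok) (canon₆ νtop (Mok2015.LeafSupport.mkN (Mok2015.LeafSupport.cm l))) (canon₁₀ νtop (Mok2015.LeafSupport.mkN (Mok2015.LeafSupport.cm l)) κnoMok) (canon₁₁ νtop) True).KYArtinHyps ∧ (canon₈₈W νtop (canon νtop (Mok2015.LeafSupport.mkN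 (Mok2015.LeafSupport.cm l)) κnoMok) (canon₆ νtop (Mok2015.LeafSupport.mkN (Mok2015.LeafSupport.cm l))) (canon₁₀ νtop (Mok2015.LeafSupport.mkN (Mok2015.LeafSupport.cm l)) κnoMok) (canon₁₁ νtop) True).KYArtin ∧ (canon₈₈W νtop (canon νtop (Mok2015.LeafSupport.mkN (Mok2015.LeafSupport.cm l)) κnoMok) (canon₆ νtop (Mok2015.LeafSupport.mkN (Mok2015.LeafSupport.cm l))) (canon₁₀ νtop (Mok2015.LeafSupport.mkN (Mok2015.LeafSupport.cm l)) κnoMok) (canon₁₁ νtop) True).KYSym3)) :=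
  ⟨eightyeighth_holds_top,
    ⟨c88_node_denied_top.2.2.1, c88_node_denied_top.2.2.2.2.2.1, c88_node_denied_top.2.2.2.2.2.2.1, c88_node_denied_top.2.2.2.2.2.2.2⟩,
    ⟨c88_rows_denied_top.1.2.1.2.2, c88_rows_denied_top.1.2.2.1, c88_rows_denied_top.2.1.2.1, c88_rows_denied_top.2.1.2.2.1, c88_rows_denied_top.2.2.2.1,
      c88_rows_denied_top.2.2.2.2.2⟩,
    fun l => have h := c88_book_cm l
      ⟨h.2.2.1, h.2.2.2.1.2.2.1, h.2.2.2.1.2.2.2.1, h.2.2.2.1.2.2.2.2, h.2.2.2.2.2⟩,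
    fun l => have h := c88_mok_kmsw_free l
      ⟨h.1, h.2.2.2⟩⟩

end Support

end Downstream

end Literature.NumberTheory.Automorphic.Arthur2013
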